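import Summits.NavierStokesRegularity.NavierStokesRegularity.Theses.PerpetualPump
import Summits.NavierStokesRegularity.NavierStokesRegularity.Theorems.PerpetualPumpAveragedTypeIBlowupTransfer
import Summits.NavierStokesRegularity.NavierStokesRegularity.Theorems.PerpetualPumpAveragedTypeIBlowupNoext
import Summits.NavierStokesRegularity.NavierStokesRegularity.Theorems.PerpetualPumpAveragedTypeIBlowupModeNormBound
import Summits.NavierStokesRegularity.NavierStokesRegularity.Theorems.PerpetualPumpAveragedTypeIBlowupSupBound
import Summits.NavierStokesRegularity.NavierStokesRegularity.Theorems.PerpetualPumpAveragedTypeIBlowupSynthField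
import Summits.NavierStokesRegularity.NavierStokesRegularity.Theorems.PerpetualPumpAveragedTypeIBlowupSynthMild
import Summits.NavierStokesRegularity.NavierStokesRegularity.Theorems.PerpetualPumpAveragedTypeIBlowupChainContinuation
import Summits.NavierStokesRegularity.NavierStokesRegularity.Theorems.PerpetualPumpAveragedTypeIBlowupKernel
import Literature.Analysis.FluidPDE.TaoAveragedCascadeHolds
import Literature.Analysis.FluidPDE.TaoCascadeModeDuhamel
import HarnessLib.Audit

/-!
# Line `Sketch` (threshold-pinning on the exact Volterra chain) for crux `PerpetualPump.AveragedTypeIBlowup`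
# (stmt-NavierStokesRegularity-1835) — lead prover's registered skeleton, ARCHITECTURE v2 (lead c1, 2026-08-16)

Source line: crux workfile `Cruxes/AveragedTypeIBlowup/SketchR1K2.lean` (ideator 2, round 1), card
`threshold-pinning` (triage r1-1/r1-2 PASS), reshaped by lead c0 to the exact Volterra chain of a Tao cascade
operator (Def. 3.1/(4.1), disjoint Fourier supports ⇒ the coefficients `Y_{i,n}(t) = ⟨u(t), ψ_{i,n}⟩` close
exactly, kernel `k_{i,n}(τ) = Re⟨e^{τΔ}ψ_{i,n}, ψ_{i,n}⟩`), reached through Theorem 3.2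
(`localCascade_isAveraged_holds`). Lead c0 LANDED every plumbing stub (`stub_transfer`, `stub_noext`,
`stub_modeNormBound`, `stub_supBound`, `stub_synthField`, `stub_synthMild`, `stub_chainContinuation`, kernel,
die, Lipschitz, uniqueness; `Theorems/PerpetualPumpAveragedTypeIBlowup*.lean`) and the sorry-free compositions
`chain_of_parts`, `cascadeTypeI_of_parts`, `AveragedTypeIBlowup_of` (the crux BY NAME); one stub was left:
`stub_threshold` (a Type-I-rate maximal solution of the chain).

ARCHITECTURE v2 (lead c1; `PICKED.md`, `Lines/Sketch.md`). Circuit: the m = 2 SEEDED GRADED TODA circuit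
(carrier `Y₀`, bond `Y₁`; `Q₀,ₙ = cλₙY₁,ₙ² − cλₙ₋₁Y₁,ₙ₋₁² − ελₙY₀,ₙY₁,ₙ`, `Q₁,ₙ = cλₙY₁,ₙ(Y₀,ₙ₊₁ − Y₀,ₙ) + ελₙY₀,ₙ²`),
whose transfer gate is integrable (invariants `P = b + β`, `R² = D² + 2w²`) and whose ε-seed sets a viscous
clock; one-parameter family = datum amplitude `A` on the carrier at scale `n₀`. Proof plan:
* Layer 1 (tree vocabulary, stubs below): `stub_waveletSmallRadius` (thin Fourier balls ⇒ kernels are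
  exponentials up to a pinched error), `stub_todaLegal` (symmetry/cancellation + closed-form `quadTerm`),
  `stub_kernelDeriv` + `stub_chainODE` (the exact chain IS the circuit ODE with central damping
  `4π²ρ₀²(1+ε₀)^{2n}` up to forcing errors `≤ 4π²(2ρ₀r + r²)(1+ε₀)^{2n} × kernel majorant`), `stub_wellposed`
  (local existence, persistence and Lipschitz dependence on `A`).
* Layer 2 (Mathlib-only ODE analysis in critical variables `bₙ = −(1+ε₀)^{n/2}Y₀,ₙ`, `wₙ = (1+ε₀)^{n/2}Y₁,ₙ`, to be
  registered next: trail-quiet, above-front slaving, incubation, pulse): the WINDOW ONE-STEP THEOREM — a clean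
  ignition-ready state with renormalised front amplitude `b ∈ [b₁, b₊]` is mapped after `Θ(b)(1+ε₀)^{-2n}/D` to a
  clean state one scale up with `g₋(b) ≤ b' ≤ g₊(b)`, `g±(b) = q(b − M/c̄)(1 ± η)`, `q = (1+ε₀)^{1/2}`.
* Layer 3: `stub_ivtNesting` (intermediate-value nesting: the edge inequalities `g₊(b₁) < b₁`, `g₋(b₊) > b₊`
  and continuity in `A` give nested compact amplitude intervals; their intersection is a PINNED orbit — no fire
  lemma, no death branch), Type-I summation along the pinned staircase, non-extension by uniqueness.
`stub_thresholdCore` is the remaining research stub and CONSUMES the Layer-1/3 bridges explicitly;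
`stub_threshold` (c0's registered signature, verbatim) follows from it, so `chain_of_parts`,
`cascadeTypeI_of_parts`, `AveragedTypeIBlowup_of` are unchanged.

Disproof honoured (Cruxes/AveragedTypeIBlowup/Disproof.lean v3): no `_false_without_<H>` theorem exists; items 3
(`stub_noext`), 4b (symmetry kept, free), 8 (the constant `M` is free), 10(a) (uniform pinning = the window
one-step theorem; inside the certified window no amplitude excursion is possible), 11 (saddle ⇒ shooting).
-/

set_option linter.dupNamespace false
set_option linter.unusedVariables false

noncomputable section

open MeasureTheory Set Filter Topology
open scoped ENNReal
open Literature.Analysis.FluidPDE Literature.Analysis.FluidPDE.Tao2016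
open Literature.Analysis.FluidPDE.TaoCascade (quadTerm IsSymmetricCoeff IsCancellingCoeff)

namespace Summit.NavierStokesRegularity.NavierStokesRegularity.Cruxes.AveragedTypeIBlowup.Sketch

/-- Local notation for `ℝ³`. -/
local notation "ℝ³" => EuclideanSpace ℝ (Fin 3)

/-! ## Stub 1 — transfer through Theorem 3.2 -/

/-- **Stub `transfer`.** A Type-I-rate, non-extendable mild solution of a symmetric cancelling LOCAL CASCADE equat … -/
theorem stub_transfer :
    (∀ ε₁ : ℝ, 0 < ε₁ → ∃ ε₀ : ℝ, 0 < ε₀ ∧ ε₀ ≤ ε₁ ∧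
      ∃ C : L2C → L2C → L2C → ℂ, IsLocalCascadeForm ε₀ C ∧
        (∀ u v w, MemH10df u → MemH10df v → MemH10df w → C u v w = C v u w) ∧
        (∀ u, MemH10df u → C u u u = 0) ∧
        ∃ u₀ : SchwartzMap ℝ³ ℝ³, VectorCalculus.IsDivFree ⇑u₀ ∧ ∃ S : ℝ, 0 < S ∧ ∃ u : ℝ → L2C,
          IsMildSolutionFor C (schwartzL2 u₀) (Ico 0 S) u ∧
          (∃ M : ℝ, ∀ t ∈ Ico 0 S, eLpNorm (u t) ⊤ volume ≤ ENNReal.ofReal (M / Real.sqrt (S - t))) ∧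
          ¬ ∃ S' : ℝ, S < S' ∧ ∃ v : ℝ → L2C,
            IsMildSolutionFor C (schwartzL2 u₀) (Ico 0 S') v ∧ ∀ t ∈ Ico 0 S, v t = u t) →
    ∃ 𝒜 : AveragingDatum, 𝒜.IsSymmetric ∧ 𝒜.HasCancellation ∧
      ∃ u₀ : SchwartzMap ℝ³ ℝ³, VectorCalculus.IsDivFree ⇑u₀ ∧ ∃ T : ℝ, 0 < T ∧ ∃ u : ℝ → L2C,
        𝒜.IsMildSolution (schwartzL2 u₀) (Ico 0 T) u ∧
        (∃ M : ℝ, ∀ t ∈ Ico 0 T, eLpNorm (u t) ⊤ volume ≤ ENNReal.ofReal (M / Real.sqrt (T - t))) ∧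
        ¬ ∃ T' : ℝ, T < T' ∧ ∃ v : ℝ → L2C,
          𝒜.IsMildSolution (schwartzL2 u₀) (Ico 0 T') v ∧ ∀ t ∈ Ico 0 T, v t = u t :=
  Theorems.PerpetualPumpAveragedTypeIBlowup.stub_transfer

/-! ## Stub 2 — non-extension from unbounded coefficients -/

/-- **Stub `noext`.** If the wavelet coefficients of a mild solution on `[0,S)` are unbounded in the `H¹⁰` weight … -/
theorem stub_noext :
    ∀ {ε₀ : ℝ}, 0 < ε₀ → ∀ {m : ℕ} (𝒟 : CascadeWaveletData ε₀ m) (T : L2C → L2C → L2C → ℂ) (a : L2C)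
      (S : ℝ) (u : ℝ → L2C), IsMildSolutionFor T a (Ico 0 S) u →
      (∀ C : ℝ, ∃ t ∈ Ico 0 S, ∃ (i : Fin m) (n : ℤ), C < (1 + ε₀) ^ ((10 : ℝ) * n) * |modeCoeff 𝒟 u i n t|) →
      ¬ ∃ S' : ℝ, S < S' ∧ ∃ v : ℝ → L2C, IsMildSolutionFor T a (Ico 0 S') v ∧ ∀ t ∈ Ico 0 S, v t = u t :=
  Theorems.PerpetualPumpAveragedTypeIBlowup.stub_noext

/-! ## Stub 3 — the band Duhamel bound on each mode -/

/-- **Stub `modeNormBound`.** For a mild solution of the cascade equation (4.1)/(3.3) on `[0,S)` with datum `A ψ_{ … -/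
theorem stub_modeNormBound :
    ∀ {ε₀ : ℝ}, 0 < ε₀ → ε₀ ≤ 1 → ∀ {m : ℕ} (𝒟 : CascadeWaveletData ε₀ m)
      (α : Fin m → Fin m → Fin m → ℤ × ℤ × ℤ → ℝ) (i₀ : Fin m) (n₀ : ℤ) (A S : ℝ) (u : ℝ → L2C),
      IsMildSolutionFor (cascadeOperatorForm ε₀ 𝒟.ψ α) ((A : ℂ) • cascadeWavelet ε₀ (𝒟.ψ i₀) n₀) (Ico 0 S) u →
      ∀ (i : Fin m) (n : ℤ), ∀ t ∈ Ico 0 S,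
        ‖modeProjection 𝒟 i n (u t)‖ ≤
          Real.exp (-(4 * Real.pi ^ 2 * (1 + ε₀) ^ (2 * n) * t)) * (if i = i₀ ∧ n = n₀ then |A| else 0) +
          ∫ s in (0 : ℝ)..t, |quadTerm ε₀ α (modeCoeff 𝒟 u) i n s| *
            Real.exp (-(4 * Real.pi ^ 2 * (1 + ε₀) ^ (2 * n) * (t - s))) :=
  Theorems.PerpetualPumpAveragedTypeIBlowup.stub_modeNormBound

/-! ## Stub 4 — the sup-norm bound through the Fourier side -/

/-- **Stub `supBound`.** For a mild solution of the cascade equation on `[0,S)` from a datum in the span of the wa … -/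
theorem stub_supBound :
    ∀ {ε₀ : ℝ}, 0 < ε₀ → ε₀ ≤ 1 → ∀ {m : ℕ} (𝒟 : CascadeWaveletData ε₀ m)
      (α : Fin m → Fin m → Fin m → ℤ × ℤ × ℤ → ℝ), ∃ c : ℝ, 0 ≤ c ∧
      ∀ (i₀ : Fin m) (n₀ : ℤ) (A S : ℝ) (u : ℝ → L2C),
        IsMildSolutionFor (cascadeOperatorForm ε₀ 𝒟.ψ α) ((A : ℂ) • cascadeWavelet ε₀ (𝒟.ψ i₀) n₀) (Ico 0 S) u →
        ∀ t ∈ Ico 0 S, eLpNorm (u t) ⊤ volume ≤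
          ENNReal.ofReal c * ∑' p : Fin m × ℤ,
            ENNReal.ofReal ((1 + ε₀) ^ ((3 : ℝ) * p.2 / 2) * ‖modeProjection 𝒟 p.1 p.2 (u t)‖) :=
  Theorems.PerpetualPumpAveragedTypeIBlowup.stub_supBound

/-! ## Stubs 5–6 — synthesis of the mild solution from a chain solution -/

/-- **Stub `synthField`.** Given a continuous solution `Y` of the exact Volterra chain on `[0,S)` from the datum ` … -/
theorem stub_synthField :
    ∀ {ε₀ : ℝ}, 0 < ε₀ → ε₀ ≤ 1 → ∀ {m : ℕ} (𝒟 : CascadeWaveletData ε₀ m)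
      (α : Fin m → Fin m → Fin m → ℤ × ℤ × ℤ → ℝ) (i₀ : Fin m) (n₀ : ℤ) (A S : ℝ)
      (Y : Fin m → ℤ → ℝ → ℝ), 0 < S →
      (∀ i n, ContinuousOn (Y i n) (Ico 0 S)) →
      (∀ i n t, n < n₀ → Y i n t = 0) →
      (∀ S' : ℝ, S' < S → ∃ C : ℝ, ∀ (i : Fin m) (n : ℤ), ∀ t ∈ Icc 0 S',
        (1 + ε₀) ^ ((20 : ℝ) * n) * |Y i n t| ≤ C) →
      (∀ (i : Fin m) (n : ℤ), ∀ t ∈ Ico 0 S,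
        Y i n t = (if i = i₀ ∧ n = n₀ then A else 0) *
            (pairing (heat t (cascadeWavelet ε₀ (𝒟.ψ i) n)) (cascadeWavelet ε₀ (𝒟.ψ i) n)).re +
          ∫ s in (0 : ℝ)..t,
            (pairing (heat (t - s) (cascadeWavelet ε₀ (𝒟.ψ i) n)) (cascadeWavelet ε₀ (𝒟.ψ i) n)).re *
              quadTerm ε₀ α Y i n s) →
      ∃ u : ℝ → L2C, (∀ t ∈ Ico 0 S, MemH10df (u t)) ∧ ContinuousInH10On (Ico 0 S) u ∧
        ∀ t ∈ Ico 0 S, ∀ w : L2C,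
          HasSum (fun p : Fin m × ℤ => ∫ s in (0 : ℝ)..t,
              (quadTerm ε₀ α Y p.1 p.2 s : ℂ) * pairing (heat (t - s) (cascadeWavelet ε₀ (𝒟.ψ p.1) p.2)) w)
            (pairing (u t) w - pairing (heat t ((A : ℂ) • cascadeWavelet ε₀ (𝒟.ψ i₀) n₀)) w) :=
  Theorems.PerpetualPumpAveragedTypeIBlowup.stub_synthField

/-- **Stub `synthMild`.** A field as in `stub_synthField` is a mild solution of the cascade equation (3.3) on `[0, … -/
theorem stub_synthMild :
    ∀ {ε₀ : ℝ}, 0 < ε₀ → ε₀ ≤ 1 → ∀ {m : ℕ} (𝒟 : CascadeWaveletData ε₀ m)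
      (α : Fin m → Fin m → Fin m → ℤ × ℤ × ℤ → ℝ) (i₀ : Fin m) (n₀ : ℤ) (A S : ℝ)
      (Y : Fin m → ℤ → ℝ → ℝ), 0 < S →
      (∀ i n, ContinuousOn (Y i n) (Ico 0 S)) →
      (∀ i n t, n < n₀ → Y i n t = 0) →
      (∀ S' : ℝ, S' < S → ∃ C : ℝ, ∀ (i : Fin m) (n : ℤ), ∀ t ∈ Icc 0 S',
        (1 + ε₀) ^ ((20 : ℝ) * n) * |Y i n t| ≤ C) →
      (∀ (i : Fin m) (n : ℤ), ∀ t ∈ Ico 0 S,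
        Y i n t = (if i = i₀ ∧ n = n₀ then A else 0) *
            (pairing (heat t (cascadeWavelet ε₀ (𝒟.ψ i) n)) (cascadeWavelet ε₀ (𝒟.ψ i) n)).re +
          ∫ s in (0 : ℝ)..t,
            (pairing (heat (t - s) (cascadeWavelet ε₀ (𝒟.ψ i) n)) (cascadeWavelet ε₀ (𝒟.ψ i) n)).re *
              quadTerm ε₀ α Y i n s) →
      ∀ u : ℝ → L2C, (∀ t ∈ Ico 0 S, MemH10df (u t)) → ContinuousInH10On (Ico 0 S) u →
        (∀ t ∈ Ico 0 S, ∀ w : L2C,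
          HasSum (fun p : Fin m × ℤ => ∫ s in (0 : ℝ)..t,
              (quadTerm ε₀ α Y p.1 p.2 s : ℂ) * pairing (heat (t - s) (cascadeWavelet ε₀ (𝒟.ψ p.1) p.2)) w)
            (pairing (u t) w - pairing (heat t ((A : ℂ) • cascadeWavelet ε₀ (𝒟.ψ i₀) n₀)) w)) →
        IsMildSolutionFor (cascadeOperatorForm ε₀ 𝒟.ψ α) ((A : ℂ) • cascadeWavelet ε₀ (𝒟.ψ i₀) n₀)
            (Ico 0 S) u ∧
          ∀ (i : Fin m) (n : ℤ), ∀ t ∈ Ico 0 S, modeCoeff 𝒟 u i n t = Y i n t :=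
  Theorems.PerpetualPumpAveragedTypeIBlowup.stub_synthMild

/-! ## Stub 7 — continuation of weighted-bounded chain solutions (chain well-posedness, the half we need) -/

/-- **Stub `chainContinuation`.** A continuous solution of the exact Volterra chain on `[0,S)` (no modes below `n₀ … -/
theorem stub_chainContinuation :
    ∀ {ε₀ : ℝ}, 0 < ε₀ → ε₀ ≤ 1 → ∀ {m : ℕ} (𝒟 : CascadeWaveletData ε₀ m)
      (α : Fin m → Fin m → Fin m → ℤ × ℤ × ℤ → ℝ) (i₀ : Fin m) (n₀ : ℤ) (A S : ℝ)
      (Y : Fin m → ℤ → ℝ → ℝ), 0 < S →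
      (∀ i n, ContinuousOn (Y i n) (Ico 0 S)) →
      (∀ i n t, n < n₀ → Y i n t = 0) →
      (∀ S' : ℝ, S' < S → ∃ C : ℝ, ∀ (i : Fin m) (n : ℤ), ∀ t ∈ Icc 0 S',
        (1 + ε₀) ^ ((20 : ℝ) * n) * |Y i n t| ≤ C) →
      (∀ (i : Fin m) (n : ℤ), ∀ t ∈ Ico 0 S,
        Y i n t = (if i = i₀ ∧ n = n₀ then A else 0) *
            (pairing (heat t (cascadeWavelet ε₀ (𝒟.ψ i) n)) (cascadeWavelet ε₀ (𝒟.ψ i) n)).re +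
          ∫ s in (0 : ℝ)..t,
            (pairing (heat (t - s) (cascadeWavelet ε₀ (𝒟.ψ i) n)) (cascadeWavelet ε₀ (𝒟.ψ i) n)).re *
              quadTerm ε₀ α Y i n s) →
      (∃ C : ℝ, ∀ (i : Fin m) (n : ℤ), ∀ t ∈ Ico 0 S, (1 + ε₀) ^ ((10 : ℝ) * n) * |Y i n t| ≤ C) →
      ∃ (S' : ℝ) (Y' : Fin m → ℤ → ℝ → ℝ), S < S' ∧
        (∀ i n, ContinuousOn (Y' i n) (Ico 0 S')) ∧
        (∀ i n t, n < n₀ → Y' i n t = 0) ∧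
        (∀ S'' : ℝ, S'' < S' → ∃ C : ℝ, ∀ (i : Fin m) (n : ℤ), ∀ t ∈ Icc 0 S'',
          (1 + ε₀) ^ ((20 : ℝ) * n) * |Y' i n t| ≤ C) ∧
        (∀ (i : Fin m) (n : ℤ), ∀ t ∈ Ico 0 S',
          Y' i n t = (if i = i₀ ∧ n = n₀ then A else 0) *
              (pairing (heat t (cascadeWavelet ε₀ (𝒟.ψ i) n)) (cascadeWavelet ε₀ (𝒟.ψ i) n)).re +
            ∫ s in (0 : ℝ)..t,
              (pairing (heat (t - s) (cascadeWavelet ε₀ (𝒟.ψ i) n)) (cascadeWavelet ε₀ (𝒟.ψ i) n)).re *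
                quadTerm ε₀ α Y' i n s) ∧
        ∀ (i : Fin m) (n : ℤ), ∀ t ∈ Ico 0 S, Y' i n t = Y i n t :=
  Theorems.PerpetualPumpAveragedTypeIBlowup.stub_chainContinuation

/-! ## Stub 8 — Layer 1 bridges (lead c1 reshaping, 2026-08-16)

The single open stub `stub_threshold` of the previous lead is now reached through explicit Layer-1
bridges (tree vocabulary), an abstract nesting lemma, and one remaining research stub
`stub_thresholdCore` which CONSUMES them (architecture v2, `Lines/Sketch.md` + `PICKED.md`):
window one-step theorem for the seeded graded Toda circuit + intermediate-value nesting. -/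

/-- **Stub `waveletSmallRadius`** (L1a). Wavelet data with two profiles whose Fourier balls have a prescribed smal … -/
theorem stub_waveletSmallRadius :
    ∀ {ε₀ : ℝ}, 0 < ε₀ → ∀ r : ℝ, 0 < r →
      ∃ 𝒟 : CascadeWaveletData ε₀ 2, ∀ i : Fin 2, 𝒟.radius i ≤ r ∧ ‖𝒟.center i‖ = 1 + ε₀ / 4 := by
  sorry

/-- **Stub `todaLegal`** (L1b). The structure constants of the SEEDED GRADED TODA CIRCUIT (`m = 2`, mode `0` = car … -/
theorem stub_todaLegal :
    ∀ c ε : ℝ,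
      IsSymmetricCoeff (fun (i₁ i₂ i₃ : Fin 2) (μ : ℤ × ℤ × ℤ) =>
        if i₁ = 1 ∧ i₂ = 1 ∧ i₃ = 0 ∧ μ = (0, 0, 0) then c else
        if i₁ = 1 ∧ i₂ = 0 ∧ i₃ = 1 ∧ μ = (0, 0, 0) then -c / 2 else
        if i₁ = 0 ∧ i₂ = 1 ∧ i₃ = 1 ∧ μ = (0, 0, 0) then -c / 2 else
        if i₁ = 1 ∧ i₂ = 0 ∧ i₃ = 1 ∧ μ = (0, 1, 0) then c / 2 else
        if i₁ = 0 ∧ i₂ = 1 ∧ i₃ = 1 ∧ μ = (1, 0, 0) then c / 2 else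
        if i₁ = 1 ∧ i₂ = 1 ∧ i₃ = 0 ∧ μ = (0, 0, 1) then -c else
        if i₁ = 0 ∧ i₂ = 0 ∧ i₃ = 1 ∧ μ = (0, 0, 0) then ε else
        if i₁ = 0 ∧ i₂ = 1 ∧ i₃ = 0 ∧ μ = (0, 0, 0) then -ε / 2 else
        if i₁ = 1 ∧ i₂ = 0 ∧ i₃ = 0 ∧ μ = (0, 0, 0) then -ε / 2 else 0) ∧
      IsCancellingCoeff (fun (i₁ i₂ i₃ : Fin 2) (μ : ℤ × ℤ × ℤ) =>
        if i₁ = 1 ∧ i₂ = 1 ∧ i₃ = 0 ∧ μ = (0, 0, 0) then c else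
        if i₁ = 1 ∧ i₂ = 0 ∧ i₃ = 1 ∧ μ = (0, 0, 0) then -c / 2 else
        if i₁ = 0 ∧ i₂ = 1 ∧ i₃ = 1 ∧ μ = (0, 0, 0) then -c / 2 else
        if i₁ = 1 ∧ i₂ = 0 ∧ i₃ = 1 ∧ μ = (0, 1, 0) then c / 2 else
        if i₁ = 0 ∧ i₂ = 1 ∧ i₃ = 1 ∧ μ = (1, 0, 0) then c / 2 else
        if i₁ = 1 ∧ i₂ = 1 ∧ i₃ = 0 ∧ μ = (0, 0, 1) then -c else
        if i₁ = 0 ∧ i₂ = 0 ∧ i₃ = 1 ∧ μ = (0, 0, 0) then ε else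
        if i₁ = 0 ∧ i₂ = 1 ∧ i₃ = 0 ∧ μ = (0, 0, 0) then -ε / 2 else
        if i₁ = 1 ∧ i₂ = 0 ∧ i₃ = 0 ∧ μ = (0, 0, 0) then -ε / 2 else 0) ∧
      ∀ (ε₀ : ℝ) (Y : Fin 2 → ℤ → ℝ → ℝ) (n : ℤ) (t : ℝ),
        quadTerm ε₀ (fun (i₁ i₂ i₃ : Fin 2) (μ : ℤ × ℤ × ℤ) =>
          if i₁ = 1 ∧ i₂ = 1 ∧ i₃ = 0 ∧ μ = (0, 0, 0) then c else
          if i₁ = 1 ∧ i₂ = 0 ∧ i₃ = 1 ∧ μ = (0, 0, 0) then -c / 2 else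
          if i₁ = 0 ∧ i₂ = 1 ∧ i₃ = 1 ∧ μ = (0, 0, 0) then -c / 2 else
          if i₁ = 1 ∧ i₂ = 0 ∧ i₃ = 1 ∧ μ = (0, 1, 0) then c / 2 else
          if i₁ = 0 ∧ i₂ = 1 ∧ i₃ = 1 ∧ μ = (1, 0, 0) then c / 2 else
          if i₁ = 1 ∧ i₂ = 1 ∧ i₃ = 0 ∧ μ = (0, 0, 1) then -c else
          if i₁ = 0 ∧ i₂ = 0 ∧ i₃ = 1 ∧ μ = (0, 0, 0) then ε else
          if i₁ = 0 ∧ i₂ = 1 ∧ i₃ = 0 ∧ μ = (0, 0, 0) then -ε / 2 else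
          if i₁ = 1 ∧ i₂ = 0 ∧ i₃ = 0 ∧ μ = (0, 0, 0) then -ε / 2 else 0) Y 0 n t =
            c * (1 + ε₀) ^ ((5 : ℝ) * (n : ℝ) / 2) * Y 1 n t ^ 2 -
              c * (1 + ε₀) ^ ((5 : ℝ) * ((n : ℝ) - 1) / 2) * Y 1 (n - 1) t ^ 2 -
              ε * (1 + ε₀) ^ ((5 : ℝ) * (n : ℝ) / 2) * (Y 0 n t * Y 1 n t) ∧
        quadTerm ε₀ (fun (i₁ i₂ i₃ : Fin 2) (μ : ℤ × ℤ × ℤ) =>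
          if i₁ = 1 ∧ i₂ = 1 ∧ i₃ = 0 ∧ μ = (0, 0, 0) then c else
          if i₁ = 1 ∧ i₂ = 0 ∧ i₃ = 1 ∧ μ = (0, 0, 0) then -c / 2 else
          if i₁ = 0 ∧ i₂ = 1 ∧ i₃ = 1 ∧ μ = (0, 0, 0) then -c / 2 else
          if i₁ = 1 ∧ i₂ = 0 ∧ i₃ = 1 ∧ μ = (0, 1, 0) then c / 2 else
          if i₁ = 0 ∧ i₂ = 1 ∧ i₃ = 1 ∧ μ = (1, 0, 0) then c / 2 else
          if i₁ = 1 ∧ i₂ = 1 ∧ i₃ = 0 ∧ μ = (0, 0, 1) then -c else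
          if i₁ = 0 ∧ i₂ = 0 ∧ i₃ = 1 ∧ μ = (0, 0, 0) then ε else
          if i₁ = 0 ∧ i₂ = 1 ∧ i₃ = 0 ∧ μ = (0, 0, 0) then -ε / 2 else
          if i₁ = 1 ∧ i₂ = 0 ∧ i₃ = 0 ∧ μ = (0, 0, 0) then -ε / 2 else 0) Y 1 n t =
            c * (1 + ε₀) ^ ((5 : ℝ) * (n : ℝ) / 2) * (Y 1 n t * (Y 0 (n + 1) t - Y 0 n t)) +
              ε * (1 + ε₀) ^ ((5 : ℝ) * (n : ℝ) / 2) * Y 0 n t ^ 2 := by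
  sorry

/-- **Stub `kernelDeriv`** (L1c-i). For wavelet data whose balls have centres on `|ξ| = ρ₀` and radii `≤ r < ρ₀`, … -/
theorem stub_kernelDeriv :
    ∀ {ε₀ : ℝ}, 0 < ε₀ → ε₀ ≤ 1 → ∀ {m : ℕ} (𝒟 : CascadeWaveletData ε₀ m) (ρ₀ r : ℝ), 0 < r → r < ρ₀ →
      (∀ i, 𝒟.radius i ≤ r ∧ ‖𝒟.center i‖ = ρ₀) →
      ∀ (i : Fin m) (n : ℤ),
        (∀ τ : ℝ, 0 ≤ τ →
          (pairing (heat τ (cascadeWavelet ε₀ (𝒟.ψ i) n)) (cascadeWavelet ε₀ (𝒟.ψ i) n)).re =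
            ∫ ξ, Real.exp (-(heatRate ξ * τ)) * modeWeight 𝒟 i n ξ) ∧
        (∀ τ : ℝ, HasDerivAt (fun σ : ℝ => ∫ ξ, Real.exp (-(heatRate ξ * σ)) * modeWeight 𝒟 i n ξ)
          (-∫ ξ, heatRate ξ * Real.exp (-(heatRate ξ * τ)) * modeWeight 𝒟 i n ξ) τ) ∧
        Continuous (fun τ : ℝ => ∫ ξ, heatRate ξ * Real.exp (-(heatRate ξ * τ)) * modeWeight 𝒟 i n ξ) ∧
        (∀ τ : ℝ, 0 ≤ τ →
          0 ≤ ∫ ξ, Real.exp (-(heatRate ξ * τ)) * modeWeight 𝒟 i n ξ ∧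
          4 * Real.pi ^ 2 * (ρ₀ - r) ^ 2 * (1 + ε₀) ^ (2 * n) *
              (∫ ξ, Real.exp (-(heatRate ξ * τ)) * modeWeight 𝒟 i n ξ) ≤
            ∫ ξ, heatRate ξ * Real.exp (-(heatRate ξ * τ)) * modeWeight 𝒟 i n ξ ∧
          (∫ ξ, heatRate ξ * Real.exp (-(heatRate ξ * τ)) * modeWeight 𝒟 i n ξ) ≤
            4 * Real.pi ^ 2 * (ρ₀ + r) ^ 2 * (1 + ε₀) ^ (2 * n) *
              ∫ ξ, Real.exp (-(heatRate ξ * τ)) * modeWeight 𝒟 i n ξ) := by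
  sorry

/-- **Stub `chainODE`** (L1c-ii, abstract kernels). A continuous solution of the Volterra chain `Y_{i,n}(t) = A 1_ … -/
theorem stub_chainODE :
    ∀ {ε₀ : ℝ}, 0 < ε₀ → ∀ {m : ℕ} (α : Fin m → Fin m → Fin m → ℤ × ℤ × ℤ → ℝ)
      (k k₁ : Fin m → ℤ → ℝ → ℝ) (Dlo Dhi : ℤ → ℝ),
      (∀ i n τ, HasDerivAt (k i n) (k₁ i n τ) τ) → (∀ i n, Continuous (k₁ i n)) →
      (∀ i n, k i n 0 = 1) →
      (∀ (i : Fin m) (n : ℤ) (τ : ℝ), 0 ≤ τ →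
        0 ≤ k i n τ ∧ Dlo n * k i n τ ≤ -k₁ i n τ ∧ -k₁ i n τ ≤ Dhi n * k i n τ) →
      ∀ (i₀ : Fin m) (n₀ : ℤ) (A S : ℝ) (Y : Fin m → ℤ → ℝ → ℝ),
      (∀ i n, ContinuousOn (Y i n) (Ico 0 S)) →
      (∀ (i : Fin m) (n : ℤ), ∀ t ∈ Ico 0 S,
        Y i n t = (if i = i₀ ∧ n = n₀ then A else 0) * k i n t +
          ∫ s in (0 : ℝ)..t, k i n (t - s) * quadTerm ε₀ α Y i n s) →
      ∀ (i : Fin m) (n : ℤ), ∀ t ∈ Ioo 0 S, ∃ y' : ℝ, HasDerivAt (Y i n) y' t ∧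
        |y' + (Dlo n + Dhi n) / 2 * Y i n t - quadTerm ε₀ α Y i n t| ≤
          (Dhi n - Dlo n) / 2 *
            (|(if i = i₀ ∧ n = n₀ then A else 0)| * k i n t +
              ∫ s in (0 : ℝ)..t, k i n (t - s) * |quadTerm ε₀ α Y i n s|) := by
  sorry

/-- **Stub `wellposed`** (L1d). Local well-posedness of the Volterra chain from the single-mode datum `A ψ_{i₀,n₀} … -/
theorem stub_wellposed :
    ∀ {ε₀ : ℝ}, 0 < ε₀ → ε₀ ≤ 1 → ∀ {m : ℕ} (𝒟 : CascadeWaveletData ε₀ m)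
      (α : Fin m → Fin m → Fin m → ℤ × ℤ × ℤ → ℝ) (i₀ : Fin m) (n₀ : ℤ),
      (∀ A : ℝ, ∃ (S : ℝ) (Y : Fin m → ℤ → ℝ → ℝ), 0 < S ∧
        (∀ i n, ContinuousOn (Y i n) (Ico 0 S)) ∧
        (∀ i n t, n < n₀ → Y i n t = 0) ∧
        (∀ S' : ℝ, S' < S → ∃ C : ℝ, ∀ (i : Fin m) (n : ℤ), ∀ t ∈ Icc 0 S',
          (1 + ε₀) ^ ((20 : ℝ) * n) * |Y i n t| ≤ C) ∧
        (∀ (i : Fin m) (n : ℤ), ∀ t ∈ Ico 0 S,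
          Y i n t = (if i = i₀ ∧ n = n₀ then A else 0) *
              (pairing (heat t (cascadeWavelet ε₀ (𝒟.ψ i) n)) (cascadeWavelet ε₀ (𝒟.ψ i) n)).re +
            ∫ s in (0 : ℝ)..t,
              (pairing (heat (t - s) (cascadeWavelet ε₀ (𝒟.ψ i) n)) (cascadeWavelet ε₀ (𝒟.ψ i) n)).re *
                quadTerm ε₀ α Y i n s)) ∧
      (∀ (A S S' C : ℝ) (Y : Fin m → ℤ → ℝ → ℝ), 0 ≤ S' → S' < S →
        (∀ i n, ContinuousOn (Y i n) (Ico 0 S)) →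
        (∀ i n t, n < n₀ → Y i n t = 0) →
        (∀ S'' : ℝ, S'' < S → ∃ C' : ℝ, ∀ (i : Fin m) (n : ℤ), ∀ t ∈ Icc 0 S'',
          (1 + ε₀) ^ ((20 : ℝ) * n) * |Y i n t| ≤ C') →
        (∀ (i : Fin m) (n : ℤ), ∀ t ∈ Ico 0 S,
          Y i n t = (if i = i₀ ∧ n = n₀ then A else 0) *
              (pairing (heat t (cascadeWavelet ε₀ (𝒟.ψ i) n)) (cascadeWavelet ε₀ (𝒟.ψ i) n)).re +
            ∫ s in (0 : ℝ)..t,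
              (pairing (heat (t - s) (cascadeWavelet ε₀ (𝒟.ψ i) n)) (cascadeWavelet ε₀ (𝒟.ψ i) n)).re *
                quadTerm ε₀ α Y i n s) →
        (∀ (i : Fin m) (n : ℤ), ∀ t ∈ Icc 0 S', (1 + ε₀) ^ ((10 : ℝ) * n) * |Y i n t| ≤ C) →
        ∃ L δ₀ : ℝ, 0 < δ₀ ∧ ∀ A' : ℝ, |A' - A| < δ₀ →
          ∃ (S'' : ℝ) (Y' : Fin m → ℤ → ℝ → ℝ), S' < S'' ∧
            (∀ i n, ContinuousOn (Y' i n) (Ico 0 S'')) ∧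
            (∀ i n t, n < n₀ → Y' i n t = 0) ∧
            (∀ T : ℝ, T < S'' → ∃ C' : ℝ, ∀ (i : Fin m) (n : ℤ), ∀ t ∈ Icc 0 T,
              (1 + ε₀) ^ ((20 : ℝ) * n) * |Y' i n t| ≤ C') ∧
            (∀ (i : Fin m) (n : ℤ), ∀ t ∈ Ico 0 S'',
              Y' i n t = (if i = i₀ ∧ n = n₀ then A' else 0) *
                  (pairing (heat t (cascadeWavelet ε₀ (𝒟.ψ i) n)) (cascadeWavelet ε₀ (𝒟.ψ i) n)).re +
                ∫ s in (0 : ℝ)..t,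
                  (pairing (heat (t - s) (cascadeWavelet ε₀ (𝒟.ψ i) n)) (cascadeWavelet ε₀ (𝒟.ψ i) n)).re *
                    quadTerm ε₀ α Y' i n s) ∧
            ∀ (i : Fin m) (n : ℤ), ∀ t ∈ Icc 0 S',
              (1 + ε₀) ^ ((10 : ℝ) * n) * |Y i n t - Y' i n t| ≤ L * |A - A'|) := by
  sorry

/-- **Stub `ivtNesting`** (L3a, Mathlib-only). NESTED-INTERVAL SHOOTING: if `β₀` is continuous on `[u₀,v₀]` with ` … -/
theorem stub_ivtNesting :
    ∀ (β : ℕ → ℝ → ℝ) (lo hi u₀ v₀ : ℝ), lo < hi → u₀ ≤ v₀ →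
      ContinuousOn (β 0) (Icc u₀ v₀) → β 0 u₀ = lo → β 0 v₀ = hi →
      (∀ A ∈ Icc u₀ v₀, β 0 A ∈ Icc lo hi) →
      (∀ k : ℕ,
        ContinuousOn (β (k + 1)) {A ∈ Icc u₀ v₀ | ∀ j ≤ k, β j A ∈ Icc lo hi} ∧
        (∀ A ∈ Icc u₀ v₀, (∀ j ≤ k, β j A ∈ Icc lo hi) → β k A = lo → β (k + 1) A < lo) ∧
        (∀ A ∈ Icc u₀ v₀, (∀ j ≤ k, β j A ∈ Icc lo hi) → β k A = hi → hi < β (k + 1) A)) →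
      ∃ A ∈ Icc u₀ v₀, ∀ k : ℕ, β k A ∈ Icc lo hi := by
  sorry

/-- **Stub `linearComparison`** (G1, Mathlib-only). The integrating-factor comparison principle for a scalar diffe … -/
theorem stub_linearComparison :
    (∀ (x K f : ℝ → ℝ) (t₀ t₁ : ℝ), t₀ ≤ t₁ →
      ContinuousOn K (Icc t₀ t₁) → ContinuousOn f (Icc t₀ t₁) → ContinuousOn x (Icc t₀ t₁) →
      (∀ t ∈ Ioo t₀ t₁, ∃ x' : ℝ, HasDerivAt x x' t ∧ x' ≤ K t * x t + f t) →
      ∀ t ∈ Icc t₀ t₁,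
        x t ≤ Real.exp (∫ s in t₀..t, K s) *
          (x t₀ + ∫ s in t₀..t, Real.exp (-(∫ u in t₀..s, K u)) * f s)) ∧
    (∀ (x K f : ℝ → ℝ) (t₀ t₁ : ℝ), t₀ ≤ t₁ →
      ContinuousOn K (Icc t₀ t₁) → ContinuousOn f (Icc t₀ t₁) → ContinuousOn x (Icc t₀ t₁) →
      (∀ t ∈ Ioo t₀ t₁, ∃ x' : ℝ, HasDerivAt x x' t ∧ K t * x t + f t ≤ x') →
      ∀ t ∈ Icc t₀ t₁,
        Real.exp (∫ s in t₀..t, K s) *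
          (x t₀ + ∫ s in t₀..t, Real.exp (-(∫ u in t₀..s, K u)) * f s) ≤ x t) ∧
    (∀ (x : ℝ → ℝ) (R G t₀ t₁ : ℝ), t₀ ≤ t₁ → 0 < R → 0 ≤ G → ContinuousOn x (Icc t₀ t₁) →
      (∀ t ∈ Ioo t₀ t₁, ∃ x' : ℝ, HasDerivAt x x' t ∧ |x' + R * x t| ≤ R * G) →
      ∀ t ∈ Icc t₀ t₁,
        |x t| ≤ |x t₀| * Real.exp (-(R * (t - t₀))) + G * (1 - Real.exp (-(R * (t - t₀))))) := by
  sorry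

/-- **Stub `hittingTime`** (G6, Mathlib-only). STRICT FIRST CROSSINGS PERSIST: if `F(A₀,·)` stays below the level … -/
theorem stub_hittingTime :
    ∀ (F : ℝ → ℝ → ℝ) (A₀ a T δ c : ℝ), a < T → 0 < δ →
      ContinuousOn (Function.uncurry F) (Icc (A₀ - δ) (A₀ + δ) ×ˢ Icc a (T + δ)) →
      (∀ t ∈ Ico a T, F A₀ t < c) → F A₀ T = c → (∀ t ∈ Ioc T (T + δ), c < F A₀ t) →
      ∀ e : ℝ, 0 < e → ∃ d : ℝ, 0 < d ∧ ∀ A : ℝ, |A - A₀| < d →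
        ∃ T' : ℝ, |T' - T| < e ∧ T' ∈ Ioc a (T + δ) ∧ F A T' = c ∧ ∀ t ∈ Ico a T', F A t < c := by
  sorry

/-- **Stub `supContinuity`** (G7, Mathlib-only). The running maximum `A ↦ sup_{t ∈ [a, τ(A)]} g(A,t)` of a jointly … -/
theorem stub_supContinuity :
    ∀ (g : ℝ → ℝ → ℝ) (τ : ℝ → ℝ) (A₀ a T δ : ℝ), a ≤ T → 0 < δ →
      ContinuousOn (Function.uncurry g) (Icc (A₀ - δ) (A₀ + δ) ×ˢ Icc a (T + δ)) →
      τ A₀ = T → (∀ e : ℝ, 0 < e → ∃ d : ℝ, 0 < d ∧ ∀ A : ℝ, |A - A₀| < d → |τ A - T| < e ∧ a ≤ τ A) →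
      ContinuousAt (fun A : ℝ => sSup ((g A) '' Icc a (τ A))) A₀ := by
  sorry

/-- **Stub `gateAlgebra`** (G3a, Mathlib-only). Pointwise calculus of the FORCED TODA GATE in slow time: `b' = −b … -/
theorem stub_gateAlgebra :
    ∀ (b w β : ℝ → ℝ) (q4 f₁ f₂ f₃ σ : ℝ),
      HasDerivAt b (-(b σ) - (w σ) ^ 2 + f₁) σ →
      HasDerivAt w (w σ * (b σ - β σ - 1) + f₂) σ →
      HasDerivAt β (-(q4 * β σ) + (w σ) ^ 2 + f₃) σ →
      0 < w σ →
      HasDerivAt (fun s => b s + β s) (-(b σ + β σ) - (q4 - 1) * β σ + f₁ + f₃) σ ∧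
      HasDerivAt (fun s => 2 * b s * β s - (w s) ^ 2)
        (-(1 + q4) * (2 * b σ * β σ - (w σ) ^ 2) + (1 - q4) * (w σ) ^ 2 +
          2 * β σ * f₁ + 2 * b σ * f₃ - 2 * w σ * f₂) σ ∧
      (∃ R' : ℝ, HasDerivAt (fun s => Real.sqrt ((b s - β s) ^ 2 + 2 * (w s) ^ 2)) R' σ ∧
        |R' + Real.sqrt ((b σ - β σ) ^ 2 + 2 * (w σ) ^ 2)| ≤
          |(q4 - 1) * β σ + f₁ - f₃| + Real.sqrt 2 * |f₂|) ∧
      (∃ u' : ℝ, HasDerivAt (fun s => (b s - β s) / Real.sqrt ((b s - β s) ^ 2 + 2 * (w s) ^ 2)) u' σ ∧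
        u' ≤ -(Real.sqrt ((b σ - β σ) ^ 2 + 2 * (w σ) ^ 2) -
              |(q4 - 1) * β σ + f₁ - f₃| / Real.sqrt ((b σ - β σ) ^ 2 + 2 * (w σ) ^ 2)) *
            (1 - ((b σ - β σ) / Real.sqrt ((b σ - β σ) ^ 2 + 2 * (w σ) ^ 2)) ^ 2) +
          Real.sqrt 2 * |f₂| / Real.sqrt ((b σ - β σ) ^ 2 + 2 * (w σ) ^ 2)) := by
  sorry

/-- **Stub `logisticClock`** (G3b, Mathlib-only). A sub-solution of the forced logistic clock `u' ≤ −R(1 − u²) + ψ … -/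
theorem stub_logisticClock :
    ∀ (u : ℝ → ℝ) (R ψ a₀ a₁ σ₀ σ₁ : ℝ), 0 < R → 0 ≤ ψ → 0 < a₀ → a₀ ≤ 1 → 0 < a₁ → a₁ ≤ 1 →
      ψ ≤ R * a₀ * a₁ / 4 → σ₀ + 2 / R * Real.log (4 / (a₀ * a₁)) ≤ σ₁ →
      ContinuousOn u (Icc σ₀ σ₁) → (∀ σ ∈ Icc σ₀ σ₁, |u σ| ≤ 1) →
      (∀ σ ∈ Ioo σ₀ σ₁, ∃ u' : ℝ, HasDerivAt u u' σ ∧ u' ≤ -(R * (1 - (u σ) ^ 2)) + ψ) →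
      u σ₀ ≤ 1 - a₀ →
      ∃ σh ∈ Icc σ₀ (σ₀ + 2 / R * Real.log (4 / (a₀ * a₁))), u σh ≤ -1 + a₁ ∧
        ∀ σ ∈ Icc σh σ₁, u σ ≤ -1 + a₁ + ψ * (σ - σh) := by
  sorry

/-- **Stub `incubation`** (G8, Mathlib-only). PHASE I of the window one-step theorem for the seeded Toda front pai … -/
theorem stub_incubation :
    ∀ (b w γ wl m0 m1 e0 e1 : ℝ → ℝ) (B W₀ εb θ₀ θ η μ₀ μ₁ Φ₁ T : ℝ),
      0 < εb → εb ≤ 1 / 10 ^ 6 → 0 < θ₀ → θ₀ ≤ 1 → 1 / 2 ≤ θ → θ ≤ 1 → 0 ≤ η → η ≤ 1 / 100 →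
      0 ≤ μ₀ → η * μ₀ ≤ 1 / 10 → 0 ≤ μ₁ → η * μ₁ ≤ εb → η * Real.exp (2 * T) ≤ 1 / 1000 →
      0 ≤ Φ₁ → Φ₁ ≤ 2 → 0 < T → T ≤ 3 → 0 ≤ W₀ → W₀ ^ 2 < θ₀ ^ 2 * B → 20 ≤ B * Real.exp (-T) →
      ContinuousOn b (Icc 0 T) → ContinuousOn w (Icc 0 T) → ContinuousOn γ (Icc 0 T) →
      ContinuousOn wl (Icc 0 T) → ContinuousOn m0 (Icc 0 T) → ContinuousOn m1 (Icc 0 T) →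
      ContinuousOn e0 (Icc 0 T) → ContinuousOn e1 (Icc 0 T) →
      (∀ σ ∈ Ioo 0 T, HasDerivAt b (-(b σ) - (w σ) ^ 2 + (wl σ) ^ 2 - εb * b σ * w σ + e0 σ) σ) →
      (∀ σ ∈ Ioo 0 T, HasDerivAt w (w σ * γ σ + εb * (b σ) ^ 2 + e1 σ) σ) →
      (∀ σ ∈ Icc 0 T, b σ - 2 ≤ γ σ ∧ γ σ ≤ b σ) →
      (∀ σ ∈ Icc 0 T, |e0 σ| ≤ η * m0 σ) → (∀ σ ∈ Icc 0 T, |e1 σ| ≤ η * m1 σ) →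
      (∀ σ ∈ Icc 0 T, 0 ≤ m0 σ ∧ m0 σ ≤ m0 0 * Real.exp (-(θ * σ)) +
        ∫ u in (0 : ℝ)..σ, Real.exp (-(θ * (σ - u))) * |-(w u) ^ 2 + (wl u) ^ 2 - εb * b u * w u|) →
      (∀ σ ∈ Icc 0 T, 0 ≤ m1 σ ∧ m1 σ ≤ m1 0 * Real.exp (-(θ * σ)) +
        ∫ u in (0 : ℝ)..σ, Real.exp (-(θ * (σ - u))) * |w u * (γ u + 1) + εb * (b u) ^ 2|) →
      (∀ σ ∈ Icc 0 T, ∫ u in (0 : ℝ)..σ, (wl u) ^ 2 ≤ Φ₁) →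
      b 0 = B → w 0 = W₀ → m0 0 ≤ μ₀ → m1 0 ≤ μ₁ →
      (∀ σ ∈ Icc 0 T, (w σ) ^ 2 ≤ θ₀ ^ 2 * b σ) →
      (∀ σ ∈ Ioc 0 T, 0 < w σ) ∧
      (∀ σ ∈ Icc 0 T, B * Real.exp (-σ) - 3 / 2 ≤ b σ ∧ b σ ≤ B * Real.exp (-σ) + Φ₁ + 1 / 2) ∧
      (∫ u in (0 : ℝ)..T, (w u) ^ 2 ≤ θ₀ ^ 2) ∧
      (∀ σ ∈ Icc 0 T, m1 σ ≤ μ₁ + 2 * w σ + 2 * εb * (B + 3) ^ 2 * σ) ∧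
      B * (1 - Real.exp (-T)) ≤ max 0 (Real.log (6 * θ₀ * Real.sqrt (B + 4) / (εb * B))) + 6 * (T + 1) + 2 ∧
      (θ₀ ^ 2 * b T ≤ (w T) ^ 2 → b T ≤ B - Real.log (θ₀ / (W₀ + 2 * εb * B)) + 6 * (T + 1)) := by
  sorry

/-- **Stub `previousPair`** (G4', Mathlib-only). The pair just behind the front after a hand-off: the spent bond ` … -/
theorem stub_previousPair :
    ∀ (bp wp b m0 m1 wl e0 e1 : ℝ → ℝ) (B Λ κ q θ η εb ω μ σI σ₁ : ℝ),
      4 / 5 ≤ κ → κ ≤ 1 → 1 ≤ q → q ≤ 21 / 20 → 1 / 2 ≤ θ → θ ≤ 1 → 0 ≤ η → 0 < εb →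
      10 * εb ≤ ω → ω ≤ 1 / 100 → 0 ≤ μ → η * (μ + 2 * Real.sqrt B) ≤ ω / 10 → η * μ ≤ 1 / 20 →
      1000 ≤ B → 0 < σI → σI ≤ 3 → σI ≤ σ₁ → σ₁ ≤ 10 → 100 ≤ Λ → Λ ≤ B * (1 - Real.exp (-σI)) →
      11 * Real.sqrt B * Real.exp (-(κ * Λ / 3)) ≤ ω →
      ContinuousOn bp (Icc 0 σ₁) → ContinuousOn wp (Icc 0 σ₁) → ContinuousOn b (Icc 0 σ₁) →
      ContinuousOn m0 (Icc 0 σ₁) → ContinuousOn m1 (Icc 0 σ₁) → ContinuousOn wl (Icc 0 σ₁) →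
      ContinuousOn e0 (Icc 0 σ₁) → ContinuousOn e1 (Icc 0 σ₁) →
      (∀ σ ∈ Ioo 0 σ₁, HasDerivAt bp
        (κ * (-(bp σ) - (wp σ) ^ 2 + (wl σ) ^ 2 - εb * bp σ * wp σ) + e0 σ) σ) →
      (∀ σ ∈ Ioo 0 σ₁, HasDerivAt wp
        (κ * (wp σ * (bp σ - b σ / q - 1) + εb * (bp σ) ^ 2) + e1 σ) σ) →
      (∀ σ ∈ Icc 0 σ₁, |e0 σ| ≤ η * κ * m0 σ) → (∀ σ ∈ Icc 0 σ₁, |e1 σ| ≤ η * κ * m1 σ) →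
      (∀ σ ∈ Icc 0 σ₁, 0 ≤ m0 σ ∧ m0 σ ≤ m0 0 * Real.exp (-(θ * κ * σ)) +
        κ * ∫ u in (0 : ℝ)..σ, Real.exp (-(θ * κ * (σ - u))) * |-(wp u) ^ 2 + (wl u) ^ 2 - εb * bp u * wp u|) →
      (∀ σ ∈ Icc 0 σ₁, 0 ≤ m1 σ ∧ m1 σ ≤ m1 0 * Real.exp (-(θ * κ * σ)) +
        κ * ∫ u in (0 : ℝ)..σ, Real.exp (-(θ * κ * (σ - u))) * |wp u * (bp u - b u / q) + εb * (bp u) ^ 2|) →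
      (∀ σ ∈ Icc 0 σ₁, |wl σ| ≤ ω) →
      (∀ σ ∈ Icc 0 σI, B * Real.exp (-σ) - 3 ≤ b σ) → (∀ σ ∈ Icc 0 σ₁, -(1 / 2) ≤ b σ ∧ b σ ≤ B + 3) →
      q ^ 4 / 2 - 3 / 20 ≤ bp 0 → bp 0 ≤ q ^ 4 / 2 + 1 / 10 → 0 ≤ wp 0 →
      q ^ 3 * B - 1 ≤ (wp 0) ^ 2 → (wp 0) ^ 2 ≤ q ^ 3 * B + 1 → m0 0 ≤ μ → m1 0 ≤ μ →
      (∀ σ ∈ Icc 0 σ₁, -ω ≤ wp σ ∧ (wp σ) ^ 2 ≤ q ^ 3 * B + 2 ∧ -(2 / 5) ≤ bp σ ∧ bp σ ≤ 17 / 20) ∧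
      (∀ σ ∈ Icc σI σ₁, |wp σ| ≤ ω / 2 ∧ bp σ ≤ 3 / 10) ∧
      (∀ σ ∈ Icc 0 σ₁, κ * ∫ u in (0 : ℝ)..σ, (wp u) ^ 2 ≤ 9 / 10) := by
  sorry

/-- **Stub `trailPair`** (G9, Mathlib-only). THE QUIET TRAIL, globally in slow time of a spent scale: a spent carr … -/
theorem stub_trailPair :
    ∀ (bk wk m0 m1 wl br e0 e1 : ℝ → ℝ) (θ η εb ω μ T : ℝ),
      1 / 2 ≤ θ → θ ≤ 1 → 0 ≤ η → 0 < εb → 10 * εb ≤ ω → ω ≤ 1 / 100 → 0 ≤ μ →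
      η * μ ≤ θ / 10 → η * μ ≤ ω / 12 → η ≤ θ / 100 → 0 ≤ T →
      ContinuousOn bk (Icc 0 T) → ContinuousOn wk (Icc 0 T) → ContinuousOn m0 (Icc 0 T) →
      ContinuousOn m1 (Icc 0 T) → ContinuousOn wl (Icc 0 T) → ContinuousOn br (Icc 0 T) →
      ContinuousOn e0 (Icc 0 T) → ContinuousOn e1 (Icc 0 T) →
      (∀ τ ∈ Ioo 0 T, HasDerivAt bk (-(bk τ) - (wk τ) ^ 2 + (wl τ) ^ 2 - εb * bk τ * wk τ + e0 τ) τ) →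
      (∀ τ ∈ Ioo 0 T, HasDerivAt wk (wk τ * (bk τ - br τ - 1) + εb * (bk τ) ^ 2 + e1 τ) τ) →
      (∀ τ ∈ Icc 0 T, |e0 τ| ≤ η * m0 τ) → (∀ τ ∈ Icc 0 T, |e1 τ| ≤ η * m1 τ) →
      (∀ τ ∈ Icc 0 T, 0 ≤ m0 τ ∧ m0 τ ≤ m0 0 * Real.exp (-(θ * τ)) +
        ∫ u in (0 : ℝ)..τ, Real.exp (-(θ * (τ - u))) * |-(wk u) ^ 2 + (wl u) ^ 2 - εb * bk u * wk u|) →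
      (∀ τ ∈ Icc 0 T, 0 ≤ m1 τ ∧ m1 τ ≤ m1 0 * Real.exp (-(θ * τ)) +
        ∫ u in (0 : ℝ)..τ, Real.exp (-(θ * (τ - u))) * |wk u * (bk u - br u) + εb * (bk u) ^ 2|) →
      (∀ τ ∈ Icc 0 T, |wl τ| ≤ ω) → (∀ τ ∈ Icc 0 T, -(9 / 20) ≤ br τ ∧ br τ ≤ 9 / 10) →
      -(2 / 5) ≤ bk 0 → bk 0 ≤ 3 / 10 → |wk 0| ≤ ω / 2 → m0 0 ≤ μ → m1 0 ≤ μ →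
      ∀ τ ∈ Icc 0 T, -(9 / 20) ≤ bk τ ∧ bk τ ≤ 7 / 20 ∧ |wk τ| ≤ ω ∧
        |bk τ - bk 0 * Real.exp (-τ)| ≤ 1 / 20 ∧
        m0 τ ≤ μ * Real.exp (-(θ * τ)) + 3 * ω ^ 2 / θ ∧ m1 τ ≤ μ * Real.exp (-(θ * τ)) + 3 * ω / θ := by
  sorry

/-- **Stub `slavedLadder`** (G10, Mathlib-only). SLAVED MODES ABOVE THE FRONT: the ladder of carriers/bonds two or … -/
theorem stub_slavedLadder :
    ∀ (x y mx my ex ey : ℕ → ℝ → ℝ) (X Y MX MY κ : ℕ → ℝ) (q θ η εb σ₁ : ℝ) (J : ℕ),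
      1 ≤ q → 1 / 2 ≤ θ → θ ≤ 1 → 0 ≤ η → 0 < εb → 0 ≤ σ₁ → 2 ≤ J →
      (∀ j : ℕ, 2 ≤ j → 1 ≤ κ j) →
      (∀ j : ℕ, 1 ≤ j → 0 ≤ X j ∧ 0 ≤ Y j ∧ 0 ≤ MX j ∧ 0 ≤ MY j) → (∀ j : ℕ, 2 ≤ j → X j ≤ 1 / 4) →
      (∀ j : ℕ, 2 ≤ j →
        Y (j - 1) ^ 2 / q ^ 3 + Y j ^ 2 + εb * X j * Y j + η * MX j ≤ X j / 2 ∧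
        εb * X j ^ 2 + η * MY j ≤ Y j / 4 ∧
        (Y (j - 1) ^ 2 / q ^ 3 + Y j ^ 2 + εb * X j * Y j) / θ ≤ MX j / 2 ∧
        (Y j * (X j + X (j + 1) / q + 1) + εb * X j ^ 2) / θ ≤ MY j / 2) →
      (∀ j : ℕ, 2 ≤ j → ContinuousOn (x j) (Icc 0 σ₁) ∧ ContinuousOn (y j) (Icc 0 σ₁) ∧
        ContinuousOn (mx j) (Icc 0 σ₁) ∧ ContinuousOn (my j) (Icc 0 σ₁) ∧
        ContinuousOn (ex j) (Icc 0 σ₁) ∧ ContinuousOn (ey j) (Icc 0 σ₁)) →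
      ContinuousOn (y 1) (Icc 0 σ₁) →
      (∀ j : ℕ, 2 ≤ j → ∀ σ ∈ Ioo 0 σ₁, HasDerivAt (x j)
        (κ j * (-(x j σ) + (y (j - 1) σ) ^ 2 / q ^ 3 - (y j σ) ^ 2 - εb * x j σ * y j σ) + ex j σ) σ) →
      (∀ j : ℕ, 2 ≤ j → ∀ σ ∈ Ioo 0 σ₁, HasDerivAt (y j)
        (κ j * (y j σ * (x j σ - x (j + 1) σ / q - 1) + εb * (x j σ) ^ 2) + ey j σ) σ) →
      (∀ j : ℕ, 2 ≤ j → ∀ σ ∈ Icc 0 σ₁, |ex j σ| ≤ η * κ j * mx j σ ∧ |ey j σ| ≤ η * κ j * my j σ) →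
      (∀ j : ℕ, 2 ≤ j → ∀ σ ∈ Icc 0 σ₁, 0 ≤ mx j σ ∧ mx j σ ≤ mx j 0 * Real.exp (-(θ * κ j * σ)) +
        κ j * ∫ u in (0 : ℝ)..σ, Real.exp (-(θ * κ j * (σ - u))) *
          |(y (j - 1) u) ^ 2 / q ^ 3 - (y j u) ^ 2 - εb * x j u * y j u|) →
      (∀ j : ℕ, 2 ≤ j → ∀ σ ∈ Icc 0 σ₁, 0 ≤ my j σ ∧ my j σ ≤ my j 0 * Real.exp (-(θ * κ j * σ)) +
        κ j * ∫ u in (0 : ℝ)..σ, Real.exp (-(θ * κ j * (σ - u))) *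
          |y j u * (x j u - x (j + 1) u / q) + εb * (x j u) ^ 2|) →
      (∀ σ ∈ Icc 0 σ₁, |y 1 σ| ≤ Y 1) →
      (∀ j : ℕ, J ≤ j → ∀ σ ∈ Icc 0 σ₁, |x j σ| ≤ X j ∧ |y j σ| ≤ Y j ∧ mx j σ ≤ MX j ∧ my j σ ≤ MY j) →
      (∀ j : ℕ, 2 ≤ j → |x j 0| ≤ X j ∧ |y j 0| ≤ Y j ∧ mx j 0 ≤ MX j ∧ my j 0 ≤ MY j) →
      ∀ j : ℕ, 2 ≤ j → ∀ σ ∈ Icc 0 σ₁, |x j σ| ≤ X j ∧ |y j σ| ≤ Y j ∧ mx j σ ≤ MX j ∧ my j σ ≤ MY j := by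
  sorry

/-- **Stub `pulse`** (G3c, Mathlib-only; uses the landed `stub_gateAlgebra`, `stub_logisticClock`, `stub_linearCom … -/
theorem stub_pulse :
    ∀ (b w β f₁ f₂ f₃ : ℝ → ℝ) (B q4 φ σ₁ : ℝ),
      10 ^ 4 ≤ B → 1 ≤ q4 → q4 ≤ 111 / 100 → 0 ≤ φ → φ ≤ 1 / 2000 →
      (5 * Real.log B + 20) / B ≤ σ₁ → σ₁ ≤ 1 / 10 →
      ContinuousOn b (Icc 0 σ₁) → ContinuousOn w (Icc 0 σ₁) → ContinuousOn β (Icc 0 σ₁) →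
      ContinuousOn f₁ (Icc 0 σ₁) → ContinuousOn f₂ (Icc 0 σ₁) → ContinuousOn f₃ (Icc 0 σ₁) →
      (∀ σ ∈ Ioo 0 σ₁, HasDerivAt b (-(b σ) - (w σ) ^ 2 + f₁ σ) σ) →
      (∀ σ ∈ Ioo 0 σ₁, HasDerivAt w (w σ * (b σ - β σ - 1) + f₂ σ) σ) →
      (∀ σ ∈ Ioo 0 σ₁, HasDerivAt β (-(q4 * β σ) + (w σ) ^ 2 + f₃ σ) σ) →
      (∀ σ ∈ Icc 0 σ₁, |f₁ σ| ≤ φ ∧ |f₂ σ| ≤ φ ∧ |f₃ σ| ≤ φ) →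
      b 0 = B → w 0 = Real.sqrt B / 10 → |β 0| ≤ 1 / 50 →
      ∃ σe ∈ Ioo 0 σ₁,
        (∀ σ ∈ Icc 0 σ₁, β σ ≤ β σe) ∧
        B - 6 * Real.log B - 30 ≤ β σe ∧ β σe ≤ B + 1 ∧
        |(w σe) ^ 2 - q4 * β σe| ≤ φ ∧
        |b σe - 1 / 2| ≤ 1 / 20 ∧
        B / 2 ≤ ∫ u in (0 : ℝ)..σe, (w u) ^ 2 ∧
        (∫ u in (0 : ℝ)..σe, |β u| ≤ 2 * Real.log B + 10) ∧
        (∀ σ ∈ Icc 0 σe, 1 ≤ w σ) ∧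
        (∀ σ ∈ Icc 0 σ₁, -(1 / 2) ≤ b σ ∧ b σ ≤ B + 1 ∧ |w σ| ≤ B ∧ -(1 / 50) ≤ β σ ∧ β σ ≤ B + 1) := by
  sorry

/-- **Stub `extendOfApriori`** (continuation principle, tree vocabulary, abstract kernels `|k| ≤ 1`). If EVERY cha … -/
theorem stub_extendOfApriori :
    ∀ {ε₀ : ℝ}, 0 < ε₀ → ∀ {m : ℕ} (α : Fin m → Fin m → Fin m → ℤ × ℤ × ℤ → ℝ)
      (k : Fin m → ℤ → ℝ → ℝ), (∀ i n τ, |k i n τ| ≤ 1) → (∀ i n, Continuous (k i n)) →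
      ∀ (i₀ : Fin m) (n₀ : ℤ) (A S Tmax : ℝ) (Y : Fin m → ℤ → ℝ → ℝ), 0 < S → S ≤ Tmax →
      (∀ i n, ContinuousOn (Y i n) (Ico 0 S)) →
      (∀ i n t, n < n₀ → Y i n t = 0) →
      (∀ S' : ℝ, S' < S → ∃ C : ℝ, ∀ (i : Fin m) (n : ℤ), ∀ t ∈ Icc 0 S',
        (1 + ε₀) ^ ((20 : ℝ) * n) * |Y i n t| ≤ C) →
      (∀ (i : Fin m) (n : ℤ), ∀ t ∈ Ico 0 S,
        Y i n t = (if i = i₀ ∧ n = n₀ then A else 0) * k i n t +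
          ∫ s in (0 : ℝ)..t, k i n (t - s) * quadTerm ε₀ α Y i n s) →
      (∀ (T : ℝ) (Y' : Fin m → ℤ → ℝ → ℝ), S ≤ T → T ≤ Tmax →
        (∀ i n, ContinuousOn (Y' i n) (Ico 0 T)) →
        (∀ i n t, n < n₀ → Y' i n t = 0) →
        (∀ S' : ℝ, S' < T → ∃ C : ℝ, ∀ (i : Fin m) (n : ℤ), ∀ t ∈ Icc 0 S',
          (1 + ε₀) ^ ((20 : ℝ) * n) * |Y' i n t| ≤ C) →
        (∀ (i : Fin m) (n : ℤ), ∀ t ∈ Ico 0 T,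
          Y' i n t = (if i = i₀ ∧ n = n₀ then A else 0) * k i n t +
            ∫ s in (0 : ℝ)..t, k i n (t - s) * quadTerm ε₀ α Y' i n s) →
        (∀ (i : Fin m) (n : ℤ), ∀ t ∈ Ico 0 S, Y' i n t = Y i n t) →
        ∃ C : ℝ, ∀ (i : Fin m) (n : ℤ), ∀ t ∈ Ico 0 T, (1 + ε₀) ^ ((10 : ℝ) * n) * |Y' i n t| ≤ C) →
      ∃ (T'' : ℝ) (Y'' : Fin m → ℤ → ℝ → ℝ), Tmax < T'' ∧
        (∀ i n, ContinuousOn (Y'' i n) (Ico 0 T'')) ∧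
        (∀ i n t, n < n₀ → Y'' i n t = 0) ∧
        (∀ S' : ℝ, S' < T'' → ∃ C : ℝ, ∀ (i : Fin m) (n : ℤ), ∀ t ∈ Icc 0 S',
          (1 + ε₀) ^ ((20 : ℝ) * n) * |Y'' i n t| ≤ C) ∧
        (∀ (i : Fin m) (n : ℤ), ∀ t ∈ Ico 0 T'',
          Y'' i n t = (if i = i₀ ∧ n = n₀ then A else 0) * k i n t +
            ∫ s in (0 : ℝ)..t, k i n (t - s) * quadTerm ε₀ α Y'' i n s) ∧
        ∀ (i : Fin m) (n : ℤ), ∀ t ∈ Ico 0 S, Y'' i n t = Y i n t := by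
  sorry

/-- **Stub `chainCritical`** (the Layer-1 → Layer-2 BRIDGE, tree vocabulary). For thin wavelet data (radius `≤ r`, … -/
theorem stub_chainCritical :
    ∀ {ε₀ : ℝ}, 0 < ε₀ → ε₀ ≤ 1 → ∀ (𝒟 : CascadeWaveletData ε₀ 2) (r : ℝ), 0 < r → r ≤ (1 + ε₀ / 4) / 2 →
      (∀ i, 𝒟.radius i ≤ r ∧ ‖𝒟.center i‖ = 1 + ε₀ / 4) →
      ∀ (Dc εb : ℝ) (n₀ : ℤ) (A S : ℝ) (Y : Fin 2 → ℤ → ℝ → ℝ),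
      Dc = 4 * Real.pi ^ 2 * ((1 + ε₀ / 4) ^ 2 + r ^ 2) → 0 < S →
      (∀ i n, ContinuousOn (Y i n) (Ico 0 S)) →
      (∀ i n t, n < n₀ → Y i n t = 0) →
      (∀ (i : Fin 2) (n : ℤ), ∀ t ∈ Ico 0 S,
        Y i n t = (if i = 0 ∧ n = n₀ then A else 0) *
            (pairing (heat t (cascadeWavelet ε₀ (𝒟.ψ i) n)) (cascadeWavelet ε₀ (𝒟.ψ i) n)).re +
          ∫ s in (0 : ℝ)..t,
            (pairing (heat (t - s) (cascadeWavelet ε₀ (𝒟.ψ i) n)) (cascadeWavelet ε₀ (𝒟.ψ i) n)).re *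
              quadTerm ε₀ (fun (i₁ i₂ i₃ : Fin 2) (μ : ℤ × ℤ × ℤ) =>
          if i₁ = 1 ∧ i₂ = 1 ∧ i₃ = 0 ∧ μ = (0, 0, 0) then Dc else
          if i₁ = 1 ∧ i₂ = 0 ∧ i₃ = 1 ∧ μ = (0, 0, 0) then -Dc / 2 else
          if i₁ = 0 ∧ i₂ = 1 ∧ i₃ = 1 ∧ μ = (0, 0, 0) then -Dc / 2 else
          if i₁ = 1 ∧ i₂ = 0 ∧ i₃ = 1 ∧ μ = (0, 1, 0) then Dc / 2 else
          if i₁ = 0 ∧ i₂ = 1 ∧ i₃ = 1 ∧ μ = (1, 0, 0) then Dc / 2 else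
          if i₁ = 1 ∧ i₂ = 1 ∧ i₃ = 0 ∧ μ = (0, 0, 1) then -Dc else
          if i₁ = 0 ∧ i₂ = 0 ∧ i₃ = 1 ∧ μ = (0, 0, 0) then εb * Dc else
          if i₁ = 0 ∧ i₂ = 1 ∧ i₃ = 0 ∧ μ = (0, 0, 0) then -(εb * Dc) / 2 else
          if i₁ = 1 ∧ i₂ = 0 ∧ i₃ = 0 ∧ μ = (0, 0, 0) then -(εb * Dc) / 2 else 0) Y i n s) →
      let θ : ℝ := (1 + ε₀ / 4 - r) ^ 2 / ((1 + ε₀ / 4) ^ 2 + r ^ 2)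
      let η : ℝ := 2 * (1 + ε₀ / 4) * r / ((1 + ε₀ / 4) ^ 2 + r ^ 2)
      let q : ℝ := Real.sqrt (1 + ε₀)
      let R : ℤ → ℝ := fun k => Dc * (1 + ε₀) ^ (2 * k)
      let K : Fin 2 → ℤ → ℝ → ℝ := fun i n τ => ∫ ξ, Real.exp (-(heatRate ξ * τ)) * modeWeight 𝒟 i n ξ
      let bv : ℤ → ℝ → ℝ := fun n t => -((1 + ε₀) ^ ((n : ℝ) / 2) * Y 0 n t)
      let wv : ℤ → ℝ → ℝ := fun n t => (1 + ε₀) ^ ((n : ℝ) / 2) * Y 1 n t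
      let G0 : ℤ → ℝ → ℝ := fun k t => (wv (k - 1) t) ^ 2 / q ^ 3 - (wv k t) ^ 2 - εb * bv k t * wv k t
      let G1 : ℤ → ℝ → ℝ := fun k t => wv k t * (bv k t - bv (k + 1) t / q) + εb * (bv k t) ^ 2
      let M0 : ℤ → ℝ → ℝ := fun n t => (1 + ε₀) ^ ((n : ℝ) / 2) *
        ((if n = n₀ then |A| else 0) * K 0 n t + ∫ s in (0 : ℝ)..t, K 0 n (t - s) * |quadTerm ε₀ (fun (i₁ i₂ i₃ : Fin 2) (μ : ℤ × ℤ × ℤ) =>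
          if i₁ = 1 ∧ i₂ = 1 ∧ i₃ = 0 ∧ μ = (0, 0, 0) then Dc else
          if i₁ = 1 ∧ i₂ = 0 ∧ i₃ = 1 ∧ μ = (0, 0, 0) then -Dc / 2 else
          if i₁ = 0 ∧ i₂ = 1 ∧ i₃ = 1 ∧ μ = (0, 0, 0) then -Dc / 2 else
          if i₁ = 1 ∧ i₂ = 0 ∧ i₃ = 1 ∧ μ = (0, 1, 0) then Dc / 2 else
          if i₁ = 0 ∧ i₂ = 1 ∧ i₃ = 1 ∧ μ = (1, 0, 0) then Dc / 2 else
          if i₁ = 1 ∧ i₂ = 1 ∧ i₃ = 0 ∧ μ = (0, 0, 1) then -Dc else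
          if i₁ = 0 ∧ i₂ = 0 ∧ i₃ = 1 ∧ μ = (0, 0, 0) then εb * Dc else
          if i₁ = 0 ∧ i₂ = 1 ∧ i₃ = 0 ∧ μ = (0, 0, 0) then -(εb * Dc) / 2 else
          if i₁ = 1 ∧ i₂ = 0 ∧ i₃ = 0 ∧ μ = (0, 0, 0) then -(εb * Dc) / 2 else 0) Y 0 n s|)
      let M1 : ℤ → ℝ → ℝ := fun n t => (1 + ε₀) ^ ((n : ℝ) / 2) *
        (∫ s in (0 : ℝ)..t, K 1 n (t - s) * |quadTerm ε₀ (fun (i₁ i₂ i₃ : Fin 2) (μ : ℤ × ℤ × ℤ) =>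
          if i₁ = 1 ∧ i₂ = 1 ∧ i₃ = 0 ∧ μ = (0, 0, 0) then Dc else
          if i₁ = 1 ∧ i₂ = 0 ∧ i₃ = 1 ∧ μ = (0, 0, 0) then -Dc / 2 else
          if i₁ = 0 ∧ i₂ = 1 ∧ i₃ = 1 ∧ μ = (0, 0, 0) then -Dc / 2 else
          if i₁ = 1 ∧ i₂ = 0 ∧ i₃ = 1 ∧ μ = (0, 1, 0) then Dc / 2 else
          if i₁ = 0 ∧ i₂ = 1 ∧ i₃ = 1 ∧ μ = (1, 0, 0) then Dc / 2 else
          if i₁ = 1 ∧ i₂ = 1 ∧ i₃ = 0 ∧ μ = (0, 0, 1) then -Dc else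
          if i₁ = 0 ∧ i₂ = 0 ∧ i₃ = 1 ∧ μ = (0, 0, 0) then εb * Dc else
          if i₁ = 0 ∧ i₂ = 1 ∧ i₃ = 0 ∧ μ = (0, 0, 0) then -(εb * Dc) / 2 else
          if i₁ = 1 ∧ i₂ = 0 ∧ i₃ = 0 ∧ μ = (0, 0, 0) then -(εb * Dc) / 2 else 0) Y 1 n s|)
      ∀ T : ℝ, 0 < T → T < S →
        (∀ k : ℤ, k < n₀ → ∀ t ∈ Icc 0 T, bv k t = 0 ∧ wv k t = 0 ∧ M0 k t = 0 ∧ M1 k t = 0) ∧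
        (∀ k : ℤ, ContinuousOn (bv k) (Icc 0 T) ∧ ContinuousOn (wv k) (Icc 0 T) ∧
          ContinuousOn (M0 k) (Icc 0 T) ∧ ContinuousOn (M1 k) (Icc 0 T)) ∧
        (∀ k : ℤ, ∀ t ∈ Ioo 0 T, ∃ e : ℝ, |e| ≤ η * R k * M0 k t ∧
          HasDerivAt (bv k) (R k * (-(bv k t) + G0 k t) + e) t) ∧
        (∀ k : ℤ, ∀ t ∈ Ioo 0 T, ∃ e : ℝ, |e| ≤ η * R k * M1 k t ∧
          HasDerivAt (wv k) (R k * (-(wv k t) + G1 k t) + e) t) ∧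
        (∀ k : ℤ, ∀ t ∈ Icc 0 T, |bv k t| ≤ M0 k t ∧ |wv k t| ≤ M1 k t ∧ 0 ≤ M0 k t ∧ 0 ≤ M1 k t) ∧
        (∀ k : ℤ, ∀ t₁ ∈ Icc 0 T, ∀ t₂ ∈ Icc t₁ T,
          M0 k t₂ ≤ M0 k t₁ * Real.exp (-(θ * R k * (t₂ - t₁))) +
            R k * ∫ u in t₁..t₂, Real.exp (-(θ * R k * (t₂ - u))) * |G0 k u| ∧
          M1 k t₂ ≤ M1 k t₁ * Real.exp (-(θ * R k * (t₂ - t₁))) +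
            R k * ∫ u in t₁..t₂, Real.exp (-(θ * R k * (t₂ - u))) * |G1 k u|) ∧
        (M0 n₀ 0 = (1 + ε₀) ^ ((n₀ : ℝ) / 2) * |A| ∧ ∀ k : ℤ, k ≠ n₀ → M0 k 0 = 0) ∧ (∀ k : ℤ, M1 k 0 = 0) := by
  sorry

/-- **Stub `typeISum`** (Mathlib-only). TYPE-I SUMMATION: at a fixed time a `ℤ`-family of nonnegative band majoran … -/
theorem stub_typeISum :
    ∀ (ε₀ : ℝ) (F : ℤ → ℝ) (n : ℤ) (C₁ ρ : ℝ), 0 < ε₀ → ε₀ ≤ 1 → 0 ≤ C₁ → 0 < ρ → ρ * (1 + ε₀) ^ 2 ≤ 1 / 2 →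
      0 ≤ n → (∀ k : ℤ, 0 ≤ F k) → (∀ k : ℤ, k < 0 → F k = 0) →
      (∀ k : ℤ, 0 ≤ k → k ≤ n + 1 → (1 + ε₀) ^ ((k : ℝ) / 2) * F k ≤ C₁) →
      (∀ j : ℕ, 2 ≤ j → (1 + ε₀) ^ (((n : ℝ) + j) / 2) * F (n + j) ≤ C₁ * ρ ^ j) →
      ∑' k : ℤ, ENNReal.ofReal ((1 + ε₀) ^ ((3 : ℝ) * k / 2) * F k) ≤
        ENNReal.ofReal (8 * C₁ * (1 + ε₀) ^ ((n : ℝ) + 2) / ε₀) := by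
  sorry

/-- **Stub `chainCriticalC1`** (companion of `stub_chainCritical`, landed by its worker): the same critical system … -/
theorem stub_chainCriticalC1 :
    ∀ {ε₀ : ℝ}, 0 < ε₀ → ε₀ ≤ 1 → ∀ (𝒟 : CascadeWaveletData ε₀ 2) (r : ℝ), 0 < r → r ≤ (1 + ε₀ / 4) / 2 →
      (∀ i, 𝒟.radius i ≤ r ∧ ‖𝒟.center i‖ = 1 + ε₀ / 4) →
      ∀ (Dc εb : ℝ) (n₀ : ℤ) (A S : ℝ) (Y : Fin 2 → ℤ → ℝ → ℝ)
        (α : Fin 2 → Fin 2 → Fin 2 → ℤ × ℤ × ℤ → ℝ),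
      α = (fun (i₁ i₂ i₃ : Fin 2) (μ : ℤ × ℤ × ℤ) =>
          if i₁ = 1 ∧ i₂ = 1 ∧ i₃ = 0 ∧ μ = (0, 0, 0) then Dc else
          if i₁ = 1 ∧ i₂ = 0 ∧ i₃ = 1 ∧ μ = (0, 0, 0) then -Dc / 2 else
          if i₁ = 0 ∧ i₂ = 1 ∧ i₃ = 1 ∧ μ = (0, 0, 0) then -Dc / 2 else
          if i₁ = 1 ∧ i₂ = 0 ∧ i₃ = 1 ∧ μ = (0, 1, 0) then Dc / 2 else
          if i₁ = 0 ∧ i₂ = 1 ∧ i₃ = 1 ∧ μ = (1, 0, 0) then Dc / 2 else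
          if i₁ = 1 ∧ i₂ = 1 ∧ i₃ = 0 ∧ μ = (0, 0, 1) then -Dc else
          if i₁ = 0 ∧ i₂ = 0 ∧ i₃ = 1 ∧ μ = (0, 0, 0) then εb * Dc else
          if i₁ = 0 ∧ i₂ = 1 ∧ i₃ = 0 ∧ μ = (0, 0, 0) then -(εb * Dc) / 2 else
          if i₁ = 1 ∧ i₂ = 0 ∧ i₃ = 0 ∧ μ = (0, 0, 0) then -(εb * Dc) / 2 else 0) →
      Dc = 4 * Real.pi ^ 2 * ((1 + ε₀ / 4) ^ 2 + r ^ 2) → 0 < S →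
      (∀ i n, ContinuousOn (Y i n) (Ico 0 S)) →
      (∀ i n t, n < n₀ → Y i n t = 0) →
      (∀ (i : Fin 2) (n : ℤ), ∀ t ∈ Ico 0 S,
        Y i n t = (if i = 0 ∧ n = n₀ then A else 0) *
            (pairing (heat t (cascadeWavelet ε₀ (𝒟.ψ i) n)) (cascadeWavelet ε₀ (𝒟.ψ i) n)).re +
          ∫ s in (0 : ℝ)..t,
            (pairing (heat (t - s) (cascadeWavelet ε₀ (𝒟.ψ i) n)) (cascadeWavelet ε₀ (𝒟.ψ i) n)).re *
              quadTerm ε₀ α Y i n s) →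
      let η : ℝ := 2 * (1 + ε₀ / 4) * r / ((1 + ε₀ / 4) ^ 2 + r ^ 2)
      let q : ℝ := Real.sqrt (1 + ε₀)
      let R : ℤ → ℝ := fun k => Dc * (1 + ε₀) ^ (2 * k)
      let K : Fin 2 → ℤ → ℝ → ℝ := fun i n τ => ∫ ξ, Real.exp (-(heatRate ξ * τ)) * modeWeight 𝒟 i n ξ
      let bv : ℤ → ℝ → ℝ := fun n t => -((1 + ε₀) ^ ((n : ℝ) / 2) * Y 0 n t)
      let wv : ℤ → ℝ → ℝ := fun n t => (1 + ε₀) ^ ((n : ℝ) / 2) * Y 1 n t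
      let G0 : ℤ → ℝ → ℝ := fun k t => (wv (k - 1) t) ^ 2 / q ^ 3 - (wv k t) ^ 2 - εb * bv k t * wv k t
      let G1 : ℤ → ℝ → ℝ := fun k t => wv k t * (bv k t - bv (k + 1) t / q) + εb * (bv k t) ^ 2
      let M0 : ℤ → ℝ → ℝ := fun n t => (1 + ε₀) ^ ((n : ℝ) / 2) *
        ((if n = n₀ then |A| else 0) * K 0 n t +
          ∫ s in (0 : ℝ)..t, K 0 n (t - s) * |quadTerm ε₀ α Y 0 n s|)
      let M1 : ℤ → ℝ → ℝ := fun n t => (1 + ε₀) ^ ((n : ℝ) / 2) *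
        (∫ s in (0 : ℝ)..t, K 1 n (t - s) * |quadTerm ε₀ α Y 1 n s|)
      ∀ T : ℝ, 0 < T → T < S →
        ∃ db dw : ℤ → ℝ → ℝ, ∀ k : ℤ, ContinuousOn (db k) (Icc 0 T) ∧ ContinuousOn (dw k) (Icc 0 T) ∧
          ∀ t ∈ Ioo 0 T, HasDerivAt (bv k) (db k t) t ∧
            |db k t - R k * (-(bv k t) + G0 k t)| ≤ η * R k * M0 k t ∧
            HasDerivAt (wv k) (dw k t) t ∧ |dw k t - R k * (-(wv k t) + G1 k t)| ≤ η * R k * M1 k t := by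
  sorry

/-- **Stub `typeISumWeak`** (Mathlib-only; variant of `stub_typeISum` for SLOW geometric decay). Same Type-I summa … -/
theorem stub_typeISumWeak :
    ∀ (ε₀ : ℝ) (F : ℤ → ℝ) (n : ℤ) (C₁ ρ : ℝ), 0 < ε₀ → ε₀ ≤ 1 → 0 ≤ C₁ → 0 < ρ → ρ * (1 + ε₀) ^ 19 ≤ 1 →
      0 ≤ n → (∀ k : ℤ, 0 ≤ F k) → (∀ k : ℤ, k < 0 → F k = 0) →
      (∀ k : ℤ, 0 ≤ k → k ≤ n + 1 → (1 + ε₀) ^ ((k : ℝ) / 2) * F k ≤ C₁) →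
      (∀ j : ℕ, 2 ≤ j → (1 + ε₀) ^ (((n : ℝ) + j) / 2) * F (n + j) ≤ C₁ * ρ ^ j) →
      ∑' k : ℤ, ENNReal.ofReal ((1 + ε₀) ^ ((3 : ℝ) * k / 2) * F k) ≤
        ENNReal.ofReal (20 * C₁ * (1 + ε₀) ^ ((n : ℝ) + 2) / ε₀) := by
  sorry

/-- **Stub `peakContinuity`** (Mathlib-only). THE RENORMALISED AMPLITUDE IS CONTINUOUS IN THE PARAMETER: if the ca … -/
theorem stub_peakContinuity :
    ∀ (g h : ℝ → ℝ → ℝ) (A₀ T δ : ℝ), 0 < T → 0 < δ →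
      ContinuousOn (Function.uncurry g) (Icc (A₀ - δ) (A₀ + δ) ×ˢ Icc 0 (T + δ)) →
      ContinuousOn (Function.uncurry h) (Icc (A₀ - δ) (A₀ + δ) ×ˢ Icc 0 (T + δ)) →
      (∀ t ∈ Ico 0 T, h A₀ t < 1) → h A₀ T = 1 → (∀ t ∈ Ioc T (T + δ), 1 < h A₀ t) →
      ContinuousAt (fun A => sSup ((g A) '' Icc 0 (sInf {t : ℝ | 0 ≤ t ∧ 1 ≤ h A t}))) A₀ := by
  sorry

/-- **Stub `tailOfWeight`** (tree vocabulary). THE A-PRIORI FAR TAIL: for a solution of the seeded-Toda chain in t … -/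
theorem stub_tailOfWeight :
    ∀ {ε₀ : ℝ}, 0 < ε₀ → ε₀ ≤ 1 → ∀ (𝒟 : CascadeWaveletData ε₀ 2) (Dc εb : ℝ) (n₀ : ℤ) (A S : ℝ)
      (Y : Fin 2 → ℤ → ℝ → ℝ) (α : Fin 2 → Fin 2 → Fin 2 → ℤ × ℤ × ℤ → ℝ) (bv wv M0 M1 : ℤ → ℝ → ℝ),
      α = (fun (i₁ i₂ i₃ : Fin 2) (μ : ℤ × ℤ × ℤ) =>
          if i₁ = 1 ∧ i₂ = 1 ∧ i₃ = 0 ∧ μ = (0, 0, 0) then Dc else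
          if i₁ = 1 ∧ i₂ = 0 ∧ i₃ = 1 ∧ μ = (0, 0, 0) then -Dc / 2 else
          if i₁ = 0 ∧ i₂ = 1 ∧ i₃ = 1 ∧ μ = (0, 0, 0) then -Dc / 2 else
          if i₁ = 1 ∧ i₂ = 0 ∧ i₃ = 1 ∧ μ = (0, 1, 0) then Dc / 2 else
          if i₁ = 0 ∧ i₂ = 1 ∧ i₃ = 1 ∧ μ = (1, 0, 0) then Dc / 2 else
          if i₁ = 1 ∧ i₂ = 1 ∧ i₃ = 0 ∧ μ = (0, 0, 1) then -Dc else
          if i₁ = 0 ∧ i₂ = 0 ∧ i₃ = 1 ∧ μ = (0, 0, 0) then εb * Dc else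
          if i₁ = 0 ∧ i₂ = 1 ∧ i₃ = 0 ∧ μ = (0, 0, 0) then -(εb * Dc) / 2 else
          if i₁ = 1 ∧ i₂ = 0 ∧ i₃ = 0 ∧ μ = (0, 0, 0) then -(εb * Dc) / 2 else 0) →
      0 < Dc → 0 < εb → 0 < S →
      (∀ i n, ContinuousOn (Y i n) (Ico 0 S)) →
      (∀ i n t, n < n₀ → Y i n t = 0) →
      (∀ S' : ℝ, S' < S → ∃ C : ℝ, ∀ (i : Fin 2) (n : ℤ), ∀ t ∈ Icc 0 S',
        (1 + ε₀) ^ ((20 : ℝ) * n) * |Y i n t| ≤ C) →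
      (∀ (n : ℤ) (t : ℝ), bv n t = -((1 + ε₀) ^ ((n : ℝ) / 2) * Y 0 n t)) →
      (∀ (n : ℤ) (t : ℝ), wv n t = (1 + ε₀) ^ ((n : ℝ) / 2) * Y 1 n t) →
      (∀ (n : ℤ) (t : ℝ), M0 n t = (1 + ε₀) ^ ((n : ℝ) / 2) *
        ((if n = n₀ then |A| else 0) * (∫ ξ, Real.exp (-(heatRate ξ * t)) * modeWeight 𝒟 0 n ξ) +
          ∫ s in (0 : ℝ)..t, (∫ ξ, Real.exp (-(heatRate ξ * (t - s))) * modeWeight 𝒟 0 n ξ) *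
            |quadTerm ε₀ α Y 0 n s|)) →
      (∀ (n : ℤ) (t : ℝ), M1 n t = (1 + ε₀) ^ ((n : ℝ) / 2) *
        ∫ s in (0 : ℝ)..t, (∫ ξ, Real.exp (-(heatRate ξ * (t - s))) * modeWeight 𝒟 1 n ξ) *
          |quadTerm ε₀ α Y 1 n s|) →
      ∀ (n : ℤ) (T : ℝ), n₀ ≤ n → 0 < T → T < S →
        ∃ J : ℕ, ∀ j : ℕ, J ≤ j → ∀ t ∈ Icc 0 T,
          |bv (n + j) t| ≤ εb * ((1 + ε₀) ^ (19 * (j - 2)))⁻¹ ∧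
          |wv (n + j) t| ≤ εb * ((1 + ε₀) ^ (19 * (j - 2)))⁻¹ / 5 ∧
          M0 (n + j) t ≤ εb * ((1 + ε₀) ^ (19 * (j - 2)))⁻¹ ∧
          M1 (n + j) t ≤ εb * ((1 + ε₀) ^ (19 * (j - 2)))⁻¹ := by
  sorry

/-- **Stub `typeIOfTube`** (tree vocabulary + `stub_typeISumWeak`). THE TYPE-I FUNCTIONAL OF A STAIRCASE: if the h … -/
theorem stub_typeIOfTube :
    ∀ {ε₀ : ℝ}, 0 < ε₀ → ε₀ ≤ 1 / 20 → ∀ (Dc εb Cb Cd S A : ℝ) (Y : Fin 2 → ℤ → ℝ → ℝ)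
      (α : Fin 2 → Fin 2 → Fin 2 → ℤ × ℤ × ℤ → ℝ) (bv wv : ℤ → ℝ → ℝ) (τ : ℕ → ℝ),
      α = (fun (i₁ i₂ i₃ : Fin 2) (μ : ℤ × ℤ × ℤ) =>
          if i₁ = 1 ∧ i₂ = 1 ∧ i₃ = 0 ∧ μ = (0, 0, 0) then Dc else
          if i₁ = 1 ∧ i₂ = 0 ∧ i₃ = 1 ∧ μ = (0, 0, 0) then -Dc / 2 else
          if i₁ = 0 ∧ i₂ = 1 ∧ i₃ = 1 ∧ μ = (0, 0, 0) then -Dc / 2 else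
          if i₁ = 1 ∧ i₂ = 0 ∧ i₃ = 1 ∧ μ = (0, 1, 0) then Dc / 2 else
          if i₁ = 0 ∧ i₂ = 1 ∧ i₃ = 1 ∧ μ = (1, 0, 0) then Dc / 2 else
          if i₁ = 1 ∧ i₂ = 1 ∧ i₃ = 0 ∧ μ = (0, 0, 1) then -Dc else
          if i₁ = 0 ∧ i₂ = 0 ∧ i₃ = 1 ∧ μ = (0, 0, 0) then εb * Dc else
          if i₁ = 0 ∧ i₂ = 1 ∧ i₃ = 0 ∧ μ = (0, 0, 0) then -(εb * Dc) / 2 else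
          if i₁ = 1 ∧ i₂ = 0 ∧ i₃ = 0 ∧ μ = (0, 0, 0) then -(εb * Dc) / 2 else 0) →
      0 < Dc → 0 < εb → εb ≤ 1 → 1 ≤ Cb → 0 < Cd → 0 < S →
      (∀ (n : ℤ) (t : ℝ), bv n t = -((1 + ε₀) ^ ((n : ℝ) / 2) * Y 0 n t)) →
      (∀ (n : ℤ) (t : ℝ), wv n t = (1 + ε₀) ^ ((n : ℝ) / 2) * Y 1 n t) →
      (∀ i n t, n < 0 → Y i n t = 0) →
      τ 0 = 0 → StrictMono τ → (∀ k, τ k < S) → (∀ t : ℝ, t < S → ∃ k, t < τ k) →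
      (∀ k : ℕ, S - τ k ≤ Cd * ((1 + ε₀) ^ (2 * k))⁻¹) →
      (∀ k : ℕ, ∀ t ∈ Icc (τ k) (τ (k + 1)),
        (∀ i : ℤ, i ≤ k + 1 → |bv i t| ≤ Cb ∧ |wv i t| ≤ Cb) ∧
        (∀ j : ℕ, 2 ≤ j → |bv (k + j) t| ≤ εb * ((1 + ε₀) ^ (19 * (j - 2)))⁻¹ ∧
          |wv (k + j) t| ≤ εb * ((1 + ε₀) ^ (19 * (j - 2)))⁻¹)) →
      (∀ i n, ContinuousOn (Y i n) (Ico 0 S)) →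
      ∃ M : ℝ, ∀ t ∈ Ico 0 S,
        (∑' p : Fin 2 × ℤ, ENNReal.ofReal ((1 + ε₀) ^ ((3 : ℝ) * p.2 / 2) *
          (Real.exp (-(4 * Real.pi ^ 2 * (1 + ε₀) ^ (2 * p.2) * t)) *
              (if p.1 = 0 ∧ p.2 = 0 then |A| else 0) +
            ∫ s in (0 : ℝ)..t, |quadTerm ε₀ α Y p.1 p.2 s| *
              Real.exp (-(4 * Real.pi ^ 2 * (1 + ε₀) ^ (2 * p.2) * (t - s)))))) ≤
          ENNReal.ofReal (M / Real.sqrt (S - t)) := by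
  sorry

/-- **Stub `levelOnePre`** (Mathlib-only). THE LEVEL-1 PAIR BEFORE IGNITION, in the slow time of the front (rate ` … -/
theorem stub_levelOnePre :
    ∀ (x y w x2 mx my ex ey : ℝ → ℝ) (q θ η εb Bx Iw T : ℝ),
      1 ≤ q → q ≤ 21 / 20 → 1 / 2 ≤ θ → θ ≤ 1 → 0 ≤ η → 0 < εb → εb ≤ 1 / 10 ^ 6 →
      1 ≤ Bx → η * Bx ≤ 1 / 10 ^ 4 → 0 ≤ Iw → Iw ≤ 1 / 50 → 0 ≤ T → T ≤ 4 →
      ContinuousOn x (Icc 0 T) → ContinuousOn y (Icc 0 T) → ContinuousOn w (Icc 0 T) →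
      ContinuousOn x2 (Icc 0 T) → ContinuousOn mx (Icc 0 T) → ContinuousOn my (Icc 0 T) →
      ContinuousOn ex (Icc 0 T) → ContinuousOn ey (Icc 0 T) →
      (∀ σ ∈ Ioo 0 T, HasDerivAt x
        (q ^ 4 * (-(x σ) + (w σ) ^ 2 / q ^ 3 - (y σ) ^ 2 - εb * x σ * y σ) + ex σ) σ) →
      (∀ σ ∈ Ioo 0 T, HasDerivAt y
        (q ^ 4 * (y σ * (x σ - x2 σ / q - 1) + εb * (x σ) ^ 2) + ey σ) σ) →
      (∀ σ ∈ Icc 0 T, |ex σ| ≤ η * q ^ 4 * mx σ) → (∀ σ ∈ Icc 0 T, |ey σ| ≤ η * q ^ 4 * my σ) →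
      (∀ σ ∈ Icc 0 T, 0 ≤ mx σ ∧ mx σ ≤ mx 0 * Real.exp (-(θ * q ^ 4 * σ)) +
        q ^ 4 * ∫ u in (0 : ℝ)..σ, Real.exp (-(θ * q ^ 4 * (σ - u))) *
          |(w u) ^ 2 / q ^ 3 - (y u) ^ 2 - εb * x u * y u|) →
      (∀ σ ∈ Icc 0 T, 0 ≤ my σ ∧ my σ ≤ my 0 * Real.exp (-(θ * q ^ 4 * σ)) +
        q ^ 4 * ∫ u in (0 : ℝ)..σ, Real.exp (-(θ * q ^ 4 * (σ - u))) *
          |y u * (x u - x2 u / q) + εb * (x u) ^ 2|) →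
      (∀ σ ∈ Icc 0 T, (w σ) ^ 2 ≤ Bx / 100) → (∀ σ ∈ Icc 0 T, ∫ u in (0 : ℝ)..σ, (w u) ^ 2 ≤ Iw) →
      (∀ σ ∈ Icc 0 T, |x2 σ| ≤ 1 / 2) →
      |x 0| ≤ εb → |y 0| ≤ εb → mx 0 ≤ εb → my 0 ≤ εb →
      ∀ σ ∈ Icc 0 T, |x σ| ≤ εb + q * Iw + 1 / 10 ^ 3 ∧ |y σ| ≤ 11 / 10 * εb ∧
        mx σ ≤ εb + Bx / 40 ∧ my σ ≤ 4 * εb := by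
  sorry

/-- **Stub `levelOneBond`** (Mathlib-only). THE NEXT BOND DURING THE TRANSFER PULSE, slow time of the front from i … -/
theorem stub_levelOneBond :
    ∀ (y β x2 my ey : ℝ → ℝ) (q θ η εb Bβ Λ y0 T : ℝ),
      1 ≤ q → q ≤ 21 / 20 → 1 / 2 ≤ θ → θ ≤ 1 → 0 ≤ η → 0 < εb → 10 ^ 4 ≤ Bβ →
      εb * q ^ 2 * Bβ ^ 2 ≤ 1 → η * (q * Bβ + 1) ^ 3 ≤ 1 / 10 ^ 6 → 0 ≤ Λ → 0 ≤ y0 → y0 ≤ 2 * εb →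
      0 ≤ T → T ≤ 1 / 10 →
      ContinuousOn y (Icc 0 T) → ContinuousOn β (Icc 0 T) → ContinuousOn x2 (Icc 0 T) →
      ContinuousOn my (Icc 0 T) → ContinuousOn ey (Icc 0 T) →
      (∀ σ ∈ Ioo 0 T, HasDerivAt y
        (q ^ 4 * (y σ * (q * β σ - x2 σ / q - 1) + εb * q ^ 2 * (β σ) ^ 2) + ey σ) σ) →
      (∀ σ ∈ Icc 0 T, |ey σ| ≤ η * q ^ 4 * my σ) →
      (∀ σ ∈ Icc 0 T, 0 ≤ my σ ∧ my σ ≤ my 0 * Real.exp (-(θ * q ^ 4 * σ)) +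
        q ^ 4 * ∫ u in (0 : ℝ)..σ, Real.exp (-(θ * q ^ 4 * (σ - u))) *
          |y u * (q * β u - x2 u / q) + εb * q ^ 2 * (β u) ^ 2|) →
      (∀ σ ∈ Icc 0 T, -(1 / 50) ≤ β σ ∧ β σ ≤ Bβ) → (∀ σ ∈ Icc 0 T, ∫ u in (0 : ℝ)..σ, |β u| ≤ Λ) →
      (∀ σ ∈ Icc 0 T, |x2 σ| ≤ 1 / 2) →
      |y 0| ≤ y0 → my 0 ≤ 4 * εb →
      (∀ σ ∈ Icc 0 T, |y σ| ≤ Real.exp (q ^ 5 * Λ) * (y0 + 3 * εb * q ^ 2 * Bβ ^ 2 * σ) ∧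
        my σ ≤ 4 * εb + 2 * ((q * Bβ + 1) * Real.exp (q ^ 5 * Λ) * (y0 + 3 * εb * q ^ 2 * Bβ ^ 2 * σ) +
          εb * q ^ 2 * Bβ ^ 2)) ∧
      (∀ σh ∈ Icc 0 T, σh + 1 / (2 * Bβ) ≤ T → (∫ u in (0 : ℝ)..σh, |β u| ≤ 1) →
        (∀ u ∈ Icc σh (σh + 1 / (2 * Bβ)), Bβ / 5 ≤ β u) →
        ∀ σ ∈ Icc (σh + 1 / (2 * Bβ)) T, 0 < y σ) := by
  sorry

/-- **Stub `preBoot`** (THE PRE-IGNITION BOOTSTRAP of the window one-step theorem; same pinned context as `stub_on … -/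
theorem stub_preBoot :
    ∀ (ε₀ D εb θ η F blo bhi : ℝ) (n₀ : ℤ) (bv wv M0 M1 db dw : ℤ → ℝ → ℝ) (q : ℝ) (R : ℤ → ℝ) (lad : ℕ → ℝ)
      (G0 G1 : ℤ → ℝ → ℝ) (Inv : ℤ → ℝ → ℝ → Prop) (Tube : ℤ → ℝ → Prop) (n : ℤ) (B t₀ T : ℝ),
      q = Real.sqrt (1 + ε₀) → (∀ k : ℤ, R k = D * (1 + ε₀) ^ (2 * k)) →
      (∀ j : ℕ, lad j = εb * ((1 + ε₀) ^ (19 * (j - 2)))⁻¹) →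
      (∀ (k : ℤ) (t : ℝ), G0 k t = (wv (k - 1) t) ^ 2 / q ^ 3 - (wv k t) ^ 2 - εb * bv k t * wv k t) →
      (∀ (k : ℤ) (t : ℝ), G1 k t = wv k t * (bv k t - bv (k + 1) t / q) + εb * (bv k t) ^ 2) →
      (∀ (m : ℤ) (Bm t : ℝ), Inv m Bm t ↔
        (bv m t = Bm ∧ (∀ s ∈ Icc 0 t, bv m s ≤ Bm) ∧
        (0 ≤ wv m t ∧ wv m t ≤ F * εb * Bm ∧ M1 m t ≤ F * εb * Bm ∧ M0 m t ≤ 2 * Bm) ∧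
        (n₀ ≤ m - 1 → 0 ≤ wv (m - 1) t ∧ q ^ 3 * Bm - 1 ≤ (wv (m - 1) t) ^ 2 ∧
          (wv (m - 1) t) ^ 2 ≤ q ^ 3 * Bm + 1 ∧ 9 / 20 ≤ bv (m - 1) t ∧ bv (m - 1) t ≤ 11 / 20 ∧
          M0 (m - 1) t ≤ 5 * (bhi + 4) ^ 2 ∧ M1 (m - 1) t ≤ 5 * (bhi + 4) ^ 2) ∧
        (|bv (m + 1) t| ≤ εb ∧ |wv (m + 1) t| ≤ εb ∧ M0 (m + 1) t ≤ εb ∧ M1 (m + 1) t ≤ εb) ∧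
        (∀ j : ℕ, 2 ≤ j → |bv (m + j) t| ≤ lad j ∧ |wv (m + j) t| ≤ lad j / 5 ∧
          M0 (m + j) t ≤ lad j ∧ M1 (m + j) t ≤ lad j) ∧
        (∀ j : ℕ, 1 ≤ j → ∀ s ∈ Icc 0 t, bv (m + j) s ≤ 1 / 2) ∧
        (∀ k : ℤ, n₀ ≤ k → k ≤ m - 2 → ∃ te ∈ Icc 0 t,
          (-(2 / 5) ≤ bv k te ∧ bv k te ≤ 3 / 10 ∧ |wv k te| ≤ 1 / 200 ∧
            M0 k te ≤ 10 * (bhi + 4) ^ 2 ∧ M1 k te ≤ 10 * (bhi + 4) ^ 2) ∧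
          ∀ s ∈ Icc te t, -(9 / 20) ≤ bv k s ∧ bv k s ≤ 7 / 20 ∧ |wv k s| ≤ 1 / 100 ∧
            M0 k s ≤ 10 * (bhi + 4) ^ 2 + 1 ∧ M1 k s ≤ 10 * (bhi + 4) ^ 2 + 1 ∧ |wv (k - 1) s| ≤ 1 / 100 ∧
            -(1 / 2) ≤ bv (k + 1) s ∧ bv (k + 1) s ≤ 9 / 10))) →
      (∀ (m : ℤ) (t : ℝ), Tube m t ↔
        ((∀ k : ℤ, k ≤ m + 1 → |bv k t| ≤ 2 * (bhi + 3) ∧ |wv k t| ≤ 2 * (bhi + 3) ∧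
          M0 k t ≤ 20 * (bhi + 4) ^ 2 ∧ M1 k t ≤ 20 * (bhi + 4) ^ 2) ∧
        (∀ j : ℕ, 2 ≤ j → |bv (m + j) t| ≤ lad j ∧ |wv (m + j) t| ≤ lad j ∧
          M0 (m + j) t ≤ lad j ∧ M1 (m + j) t ≤ lad j))) →
      -- regime
      0 < ε₀ → ε₀ ≤ 1 / 20 → 0 < D → 1 / 2 ≤ θ → θ ≤ 1 → 0 ≤ η → 0 < εb → εb ≤ 1 / 10 ^ 6 →
      10 ^ 4 + 40 - 5 * Real.log εb ≤ blo → 10 ^ 9 * (bhi + 4) ^ 4 ≤ F →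
      η * (10 ^ 9 * (bhi + 4) ^ 4 * (F + 1)) ≤ 1 → εb * (10 ^ 9 * (F + 1) ^ 2 * (bhi + 4) ^ 3) ≤ 1 →
      10 ^ 3 + 20 * Real.log (bhi + 5) + Real.log (F + 2) ≤ -Real.log εb →
      -- the critical system with memory errors on [0, T]
      n₀ ≤ n → 0 ≤ t₀ → t₀ < T → blo ≤ B → B ≤ bhi →
      (∀ k : ℤ, k < n₀ → ∀ t ∈ Icc 0 T, bv k t = 0 ∧ wv k t = 0 ∧ M0 k t = 0 ∧ M1 k t = 0) →
      (∀ k : ℤ, ContinuousOn (bv k) (Icc 0 T) ∧ ContinuousOn (wv k) (Icc 0 T) ∧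
        ContinuousOn (M0 k) (Icc 0 T) ∧ ContinuousOn (M1 k) (Icc 0 T)) →
      (∀ k : ℤ, ContinuousOn (db k) (Icc 0 T) ∧ ContinuousOn (dw k) (Icc 0 T) ∧
        ∀ t ∈ Ioo 0 T, HasDerivAt (bv k) (db k t) t ∧
          |db k t - R k * (-(bv k t) + G0 k t)| ≤ η * R k * M0 k t ∧
          HasDerivAt (wv k) (dw k t) t ∧ |dw k t - R k * (-(wv k t) + G1 k t)| ≤ η * R k * M1 k t) →
      (∀ k : ℤ, ∀ t ∈ Icc 0 T, |bv k t| ≤ M0 k t ∧ |wv k t| ≤ M1 k t ∧ 0 ≤ M0 k t ∧ 0 ≤ M1 k t) →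
      (∀ k : ℤ, ∀ t₁ ∈ Icc 0 T, ∀ t₂ ∈ Icc t₁ T,
        M0 k t₂ ≤ M0 k t₁ * Real.exp (-(θ * R k * (t₂ - t₁))) +
          R k * ∫ u in t₁..t₂, Real.exp (-(θ * R k * (t₂ - u))) * |G0 k u| ∧
        M1 k t₂ ≤ M1 k t₁ * Real.exp (-(θ * R k * (t₂ - t₁))) +
          R k * ∫ u in t₁..t₂, Real.exp (-(θ * R k * (t₂ - u))) * |G1 k u|) →
      -- the a-priori far tail above the front, and the hand-off invariant at t₀
      (∃ J : ℕ, ∀ j : ℕ, J ≤ j → ∀ t ∈ Icc 0 T,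
        |bv (n + j) t| ≤ lad j ∧ |wv (n + j) t| ≤ lad j / 5 ∧ M0 (n + j) t ≤ lad j ∧ M1 (n + j) t ≤ lad j) →
      Inv n B t₀ →
      ∀ (Pre : ℝ → Prop) (t' : ℝ),
      (∀ s : ℝ, Pre s ↔
        ((B * Real.exp (-(R n * (s - t₀))) - 3 / 2 ≤ bv n s ∧ bv n s ≤ B * Real.exp (-(R n * (s - t₀))) + 5 / 2 ∧
          0 ≤ wv n s ∧ M0 n s ≤ 6 * (B + 3) ∧
          M1 n s ≤ F * εb * B + 2 * wv n s + 2 * εb * (B + 3) ^ 2 * (R n * (s - t₀))) ∧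
        (n₀ ≤ n - 1 → -(1 / 100) ≤ wv (n - 1) s ∧ (wv (n - 1) s) ^ 2 ≤ q ^ 3 * B + 2 ∧
          -(2 / 5) ≤ bv (n - 1) s ∧ bv (n - 1) s ≤ 17 / 20 ∧
          (t₀ + 2 * (100 + 4 * Real.log (bhi + 5)) / (B * R n) ≤ s → |wv (n - 1) s| ≤ 1 / 200 ∧ bv (n - 1) s ≤ 3 / 10) ∧
          M0 (n - 1) s ≤ 6 * (bhi + 4) ^ 2 ∧ M1 (n - 1) s ≤ 6 * (bhi + 4) ^ 2 ∧
          (1 + ε₀) ^ (-(2 : ℤ)) * R n * ∫ u in t₀..s, (wv (n - 1) u) ^ 2 ≤ 9 / 10) ∧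
        (|bv (n + 1) s| ≤ εb + q / 100 + 1 / 10 ^ 3 ∧ |wv (n + 1) s| ≤ 11 / 10 * εb ∧
          M0 (n + 1) s ≤ εb + (B + 3) / 40 ∧ M1 (n + 1) s ≤ 4 * εb) ∧
        (∀ j : ℕ, 2 ≤ j → |bv (n + j) s| ≤ lad j ∧ |wv (n + j) s| ≤ lad j / 5 ∧
          M0 (n + j) s ≤ lad j ∧ M1 (n + j) s ≤ lad j) ∧
        (∀ k : ℤ, n₀ ≤ k → k ≤ n - 2 → -(9 / 20) ≤ bv k s ∧ bv k s ≤ 7 / 20 ∧ |wv k s| ≤ 1 / 100 ∧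
          M0 k s ≤ 10 * (bhi + 4) ^ 2 + 1 ∧ M1 k s ≤ 10 * (bhi + 4) ^ 2 + 1))) →
      t₀ < t' → t' ≤ T → t' ≤ t₀ + 3 / R n →
      (∀ s ∈ Icc t₀ t', (wv n s) ^ 2 ≤ bv n s / 100) →
      (∀ s ∈ Icc t₀ t', Pre s) ∧ (∀ s ∈ Ioc t₀ t', 0 < wv n s) ∧
      (R n * ∫ u in t₀..t', (wv n u) ^ 2 ≤ 1 / 100) ∧
      B * (1 - Real.exp (-(R n * (t' - t₀)))) ≤
        max 0 (Real.log (6 / 10 * Real.sqrt (B + 4) / (εb * B))) + 6 * (R n * (t' - t₀) + 1) + 2 ∧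
      (bv n t' / 100 ≤ (wv n t') ^ 2 → bv n t' ≤ B + Real.log (10 * (F + 2) * εb * B) + 6 * (R n * (t' - t₀) + 1))
 := by
  sorry

/-- **Stub `pulseBoot`** (THE PULSE-PHASE BOOTSTRAP of the window one-step theorem; pinned context of `stub_oneSte … -/
theorem stub_pulseBoot :
    ∀ (ε₀ D εb θ η F blo bhi : ℝ) (n₀ : ℤ) (bv wv M0 M1 db dw : ℤ → ℝ → ℝ) (q : ℝ) (R : ℤ → ℝ) (lad : ℕ → ℝ)
      (G0 G1 : ℤ → ℝ → ℝ) (Inv : ℤ → ℝ → ℝ → Prop) (Tube : ℤ → ℝ → Prop) (n : ℤ) (B t₀ T : ℝ),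
      q = Real.sqrt (1 + ε₀) → (∀ k : ℤ, R k = D * (1 + ε₀) ^ (2 * k)) →
      (∀ j : ℕ, lad j = εb * ((1 + ε₀) ^ (19 * (j - 2)))⁻¹) →
      (∀ (k : ℤ) (t : ℝ), G0 k t = (wv (k - 1) t) ^ 2 / q ^ 3 - (wv k t) ^ 2 - εb * bv k t * wv k t) →
      (∀ (k : ℤ) (t : ℝ), G1 k t = wv k t * (bv k t - bv (k + 1) t / q) + εb * (bv k t) ^ 2) →
      (∀ (m : ℤ) (Bm t : ℝ), Inv m Bm t ↔
        (bv m t = Bm ∧ (∀ s ∈ Icc 0 t, bv m s ≤ Bm) ∧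
        (0 ≤ wv m t ∧ wv m t ≤ F * εb * Bm ∧ M1 m t ≤ F * εb * Bm ∧ M0 m t ≤ 2 * Bm) ∧
        (n₀ ≤ m - 1 → 0 ≤ wv (m - 1) t ∧ q ^ 3 * Bm - 1 ≤ (wv (m - 1) t) ^ 2 ∧
          (wv (m - 1) t) ^ 2 ≤ q ^ 3 * Bm + 1 ∧ 9 / 20 ≤ bv (m - 1) t ∧ bv (m - 1) t ≤ 11 / 20 ∧
          M0 (m - 1) t ≤ 5 * (bhi + 4) ^ 2 ∧ M1 (m - 1) t ≤ 5 * (bhi + 4) ^ 2) ∧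
        (|bv (m + 1) t| ≤ εb ∧ |wv (m + 1) t| ≤ εb ∧ M0 (m + 1) t ≤ εb ∧ M1 (m + 1) t ≤ εb) ∧
        (∀ j : ℕ, 2 ≤ j → |bv (m + j) t| ≤ lad j ∧ |wv (m + j) t| ≤ lad j / 5 ∧
          M0 (m + j) t ≤ lad j ∧ M1 (m + j) t ≤ lad j) ∧
        (∀ j : ℕ, 1 ≤ j → ∀ s ∈ Icc 0 t, bv (m + j) s ≤ 1 / 2) ∧
        (∀ k : ℤ, n₀ ≤ k → k ≤ m - 2 → ∃ te ∈ Icc 0 t,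
          (-(2 / 5) ≤ bv k te ∧ bv k te ≤ 3 / 10 ∧ |wv k te| ≤ 1 / 200 ∧
            M0 k te ≤ 10 * (bhi + 4) ^ 2 ∧ M1 k te ≤ 10 * (bhi + 4) ^ 2) ∧
          ∀ s ∈ Icc te t, -(9 / 20) ≤ bv k s ∧ bv k s ≤ 7 / 20 ∧ |wv k s| ≤ 1 / 100 ∧
            M0 k s ≤ 10 * (bhi + 4) ^ 2 + 1 ∧ M1 k s ≤ 10 * (bhi + 4) ^ 2 + 1 ∧ |wv (k - 1) s| ≤ 1 / 100 ∧
            -(1 / 2) ≤ bv (k + 1) s ∧ bv (k + 1) s ≤ 9 / 10))) →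
      (∀ (m : ℤ) (t : ℝ), Tube m t ↔
        ((∀ k : ℤ, k ≤ m + 1 → |bv k t| ≤ 2 * (bhi + 3) ∧ |wv k t| ≤ 2 * (bhi + 3) ∧
          M0 k t ≤ 20 * (bhi + 4) ^ 2 ∧ M1 k t ≤ 20 * (bhi + 4) ^ 2) ∧
        (∀ j : ℕ, 2 ≤ j → |bv (m + j) t| ≤ lad j ∧ |wv (m + j) t| ≤ lad j ∧
          M0 (m + j) t ≤ lad j ∧ M1 (m + j) t ≤ lad j))) →
      -- regime
      0 < ε₀ → ε₀ ≤ 1 / 20 → 0 < D → 1 / 2 ≤ θ → θ ≤ 1 → 0 ≤ η → 0 < εb → εb ≤ 1 / 10 ^ 6 →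
      10 ^ 4 + 40 - 5 * Real.log εb ≤ blo → 10 ^ 9 * (bhi + 4) ^ 4 ≤ F →
      η * (10 ^ 9 * (bhi + 4) ^ 4 * (F + 1)) ≤ 1 → εb * (10 ^ 9 * (F + 1) ^ 2 * (bhi + 4) ^ 3) ≤ 1 →
      10 ^ 3 + 20 * Real.log (bhi + 5) + Real.log (F + 2) ≤ -Real.log εb →
      -- the critical system with memory errors on [0, T]
      n₀ ≤ n → 0 ≤ t₀ → t₀ < T → blo ≤ B → B ≤ bhi →
      (∀ k : ℤ, k < n₀ → ∀ t ∈ Icc 0 T, bv k t = 0 ∧ wv k t = 0 ∧ M0 k t = 0 ∧ M1 k t = 0) →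
      (∀ k : ℤ, ContinuousOn (bv k) (Icc 0 T) ∧ ContinuousOn (wv k) (Icc 0 T) ∧
        ContinuousOn (M0 k) (Icc 0 T) ∧ ContinuousOn (M1 k) (Icc 0 T)) →
      (∀ k : ℤ, ContinuousOn (db k) (Icc 0 T) ∧ ContinuousOn (dw k) (Icc 0 T) ∧
        ∀ t ∈ Ioo 0 T, HasDerivAt (bv k) (db k t) t ∧
          |db k t - R k * (-(bv k t) + G0 k t)| ≤ η * R k * M0 k t ∧
          HasDerivAt (wv k) (dw k t) t ∧ |dw k t - R k * (-(wv k t) + G1 k t)| ≤ η * R k * M1 k t) →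
      (∀ k : ℤ, ∀ t ∈ Icc 0 T, |bv k t| ≤ M0 k t ∧ |wv k t| ≤ M1 k t ∧ 0 ≤ M0 k t ∧ 0 ≤ M1 k t) →
      (∀ k : ℤ, ∀ t₁ ∈ Icc 0 T, ∀ t₂ ∈ Icc t₁ T,
        M0 k t₂ ≤ M0 k t₁ * Real.exp (-(θ * R k * (t₂ - t₁))) +
          R k * ∫ u in t₁..t₂, Real.exp (-(θ * R k * (t₂ - u))) * |G0 k u| ∧
        M1 k t₂ ≤ M1 k t₁ * Real.exp (-(θ * R k * (t₂ - t₁))) +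
          R k * ∫ u in t₁..t₂, Real.exp (-(θ * R k * (t₂ - u))) * |G1 k u|) →
      -- the a-priori far tail above the front, and the hand-off invariant at t₀
      (∃ J : ℕ, ∀ j : ℕ, J ≤ j → ∀ t ∈ Icc 0 T,
        |bv (n + j) t| ≤ lad j ∧ |wv (n + j) t| ≤ lad j / 5 ∧ M0 (n + j) t ≤ lad j ∧ M1 (n + j) t ≤ lad j) →
      Inv n B t₀ →
      ∀ (Pre Pul : ℝ → Prop) (tι t'' : ℝ),
      (∀ s : ℝ, Pre s ↔
        ((B * Real.exp (-(R n * (s - t₀))) - 3 / 2 ≤ bv n s ∧ bv n s ≤ B * Real.exp (-(R n * (s - t₀))) + 5 / 2 ∧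
          0 ≤ wv n s ∧ M0 n s ≤ 6 * (B + 3) ∧
          M1 n s ≤ F * εb * B + 2 * wv n s + 2 * εb * (B + 3) ^ 2 * (R n * (s - t₀))) ∧
        (n₀ ≤ n - 1 → -(1 / 100) ≤ wv (n - 1) s ∧ (wv (n - 1) s) ^ 2 ≤ q ^ 3 * B + 2 ∧
          -(2 / 5) ≤ bv (n - 1) s ∧ bv (n - 1) s ≤ 17 / 20 ∧
          (t₀ + 2 * (100 + 4 * Real.log (bhi + 5)) / (B * R n) ≤ s → |wv (n - 1) s| ≤ 1 / 200 ∧ bv (n - 1) s ≤ 3 / 10) ∧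
          M0 (n - 1) s ≤ 6 * (bhi + 4) ^ 2 ∧ M1 (n - 1) s ≤ 6 * (bhi + 4) ^ 2 ∧
          (1 + ε₀) ^ (-(2 : ℤ)) * R n * ∫ u in t₀..s, (wv (n - 1) u) ^ 2 ≤ 9 / 10) ∧
        (|bv (n + 1) s| ≤ εb + q / 100 + 1 / 10 ^ 3 ∧ |wv (n + 1) s| ≤ 11 / 10 * εb ∧
          M0 (n + 1) s ≤ εb + (B + 3) / 40 ∧ M1 (n + 1) s ≤ 4 * εb) ∧
        (∀ j : ℕ, 2 ≤ j → |bv (n + j) s| ≤ lad j ∧ |wv (n + j) s| ≤ lad j / 5 ∧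
          M0 (n + j) s ≤ lad j ∧ M1 (n + j) s ≤ lad j) ∧
        (∀ k : ℤ, n₀ ≤ k → k ≤ n - 2 → -(9 / 20) ≤ bv k s ∧ bv k s ≤ 7 / 20 ∧ |wv k s| ≤ 1 / 100 ∧
          M0 k s ≤ 10 * (bhi + 4) ^ 2 + 1 ∧ M1 k s ≤ 10 * (bhi + 4) ^ 2 + 1))) →
      (∀ s : ℝ, Pul s ↔
        ((-(1 / 2) ≤ bv n s ∧ bv n s ≤ bv n tι + 1 / 100 ∧ |wv n s| ≤ bv n tι + 1 / 100 ∧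
          -(q / 50) ≤ bv (n + 1) s ∧ bv (n + 1) s ≤ q * (bv n tι + 1 / 100) ∧
          M0 n s ≤ 3 * (bhi + 4) ^ 2 ∧ M1 n s ≤ 5 * (bhi + 4) ^ 2 ∧ M0 (n + 1) s ≤ 3 / 2 * B ∧
          |wv (n + 1) s| ≤ 1 / 10 ^ 3 ∧ M1 (n + 1) s ≤ 1) ∧
        (n₀ ≤ n - 1 → |wv (n - 1) s| ≤ 1 / 200 ∧ -(2 / 5) ≤ bv (n - 1) s ∧ bv (n - 1) s ≤ 3 / 10 ∧
          M0 (n - 1) s ≤ 6 * (bhi + 4) ^ 2 ∧ M1 (n - 1) s ≤ 6 * (bhi + 4) ^ 2 ∧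
          (1 + ε₀) ^ (-(2 : ℤ)) * R n * ∫ u in t₀..s, (wv (n - 1) u) ^ 2 ≤ 9 / 10) ∧
        (∀ j : ℕ, 2 ≤ j → |bv (n + j) s| ≤ lad j ∧ |wv (n + j) s| ≤ lad j / 5 ∧
          M0 (n + j) s ≤ lad j ∧ M1 (n + j) s ≤ lad j) ∧
        (∀ k : ℤ, n₀ ≤ k → k ≤ n - 2 → -(9 / 20) ≤ bv k s ∧ bv k s ≤ 7 / 20 ∧ |wv k s| ≤ 1 / 100 ∧
          M0 k s ≤ 10 * (bhi + 4) ^ 2 + 1 ∧ M1 k s ≤ 10 * (bhi + 4) ^ 2 + 1))) →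
      t₀ < tι → tι ≤ t₀ + 3 / R n → t₀ + 2 * (100 + 4 * Real.log (bhi + 5)) / (B * R n) ≤ tι → 10 ^ 4 ≤ bv n tι →
      (∀ s ∈ Icc t₀ tι, Pre s) → (∀ s ∈ Ioc t₀ tι, 0 < wv n s) → (R n * ∫ u in t₀..tι, (wv n u) ^ 2 ≤ 1 / 100) →
      (∀ s ∈ Icc t₀ tι, (wv n s) ^ 2 ≤ bv n s / 100) → (wv n tι) ^ 2 = bv n tι / 100 →
      bv n tι ≤ B + Real.log (10 * (F + 2) * εb * B) + 6 * (R n * (tι - t₀) + 1) →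
      B * (1 - Real.exp (-(R n * (tι - t₀)))) ≤
        max 0 (Real.log (6 / 10 * Real.sqrt (B + 4) / (εb * B))) + 6 * (R n * (tι - t₀) + 1) + 2 →
      tι < t'' → t'' ≤ T → t'' ≤ tι + (5 * Real.log (bv n tι) + 20) / bv n tι / R n →
      ∀ s ∈ Icc tι t'', Pul s := by
  sorry

/-- **Stub `handoff`** (THE HAND-OFF of the window one-step theorem; pinned context of `stub_oneStep`, front clock … -/
theorem stub_handoff :
    ∀ (ε₀ D εb θ η F blo bhi : ℝ) (n₀ : ℤ) (bv wv M0 M1 db dw : ℤ → ℝ → ℝ) (q : ℝ) (R : ℤ → ℝ) (lad : ℕ → ℝ)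
      (G0 G1 : ℤ → ℝ → ℝ) (Inv : ℤ → ℝ → ℝ → Prop) (Tube : ℤ → ℝ → Prop) (n : ℤ) (B t₀ T : ℝ),
      q = Real.sqrt (1 + ε₀) → (∀ k : ℤ, R k = D * (1 + ε₀) ^ (2 * k)) →
      (∀ j : ℕ, lad j = εb * ((1 + ε₀) ^ (19 * (j - 2)))⁻¹) →
      (∀ (k : ℤ) (t : ℝ), G0 k t = (wv (k - 1) t) ^ 2 / q ^ 3 - (wv k t) ^ 2 - εb * bv k t * wv k t) →
      (∀ (k : ℤ) (t : ℝ), G1 k t = wv k t * (bv k t - bv (k + 1) t / q) + εb * (bv k t) ^ 2) →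
      (∀ (m : ℤ) (Bm t : ℝ), Inv m Bm t ↔
        (bv m t = Bm ∧ (∀ s ∈ Icc 0 t, bv m s ≤ Bm) ∧
        (0 ≤ wv m t ∧ wv m t ≤ F * εb * Bm ∧ M1 m t ≤ F * εb * Bm ∧ M0 m t ≤ 2 * Bm) ∧
        (n₀ ≤ m - 1 → 0 ≤ wv (m - 1) t ∧ q ^ 3 * Bm - 1 ≤ (wv (m - 1) t) ^ 2 ∧
          (wv (m - 1) t) ^ 2 ≤ q ^ 3 * Bm + 1 ∧ 9 / 20 ≤ bv (m - 1) t ∧ bv (m - 1) t ≤ 11 / 20 ∧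
          M0 (m - 1) t ≤ 5 * (bhi + 4) ^ 2 ∧ M1 (m - 1) t ≤ 5 * (bhi + 4) ^ 2) ∧
        (|bv (m + 1) t| ≤ εb ∧ |wv (m + 1) t| ≤ εb ∧ M0 (m + 1) t ≤ εb ∧ M1 (m + 1) t ≤ εb) ∧
        (∀ j : ℕ, 2 ≤ j → |bv (m + j) t| ≤ lad j ∧ |wv (m + j) t| ≤ lad j / 5 ∧
          M0 (m + j) t ≤ lad j ∧ M1 (m + j) t ≤ lad j) ∧
        (∀ j : ℕ, 1 ≤ j → ∀ s ∈ Icc 0 t, bv (m + j) s ≤ 1 / 2) ∧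
        (∀ k : ℤ, n₀ ≤ k → k ≤ m - 2 → ∃ te ∈ Icc 0 t,
          (-(2 / 5) ≤ bv k te ∧ bv k te ≤ 3 / 10 ∧ |wv k te| ≤ 1 / 200 ∧
            M0 k te ≤ 10 * (bhi + 4) ^ 2 ∧ M1 k te ≤ 10 * (bhi + 4) ^ 2) ∧
          ∀ s ∈ Icc te t, -(9 / 20) ≤ bv k s ∧ bv k s ≤ 7 / 20 ∧ |wv k s| ≤ 1 / 100 ∧
            M0 k s ≤ 10 * (bhi + 4) ^ 2 + 1 ∧ M1 k s ≤ 10 * (bhi + 4) ^ 2 + 1 ∧ |wv (k - 1) s| ≤ 1 / 100 ∧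
            -(1 / 2) ≤ bv (k + 1) s ∧ bv (k + 1) s ≤ 9 / 10))) →
      (∀ (m : ℤ) (t : ℝ), Tube m t ↔
        ((∀ k : ℤ, k ≤ m + 1 → |bv k t| ≤ 2 * (bhi + 3) ∧ |wv k t| ≤ 2 * (bhi + 3) ∧
          M0 k t ≤ 20 * (bhi + 4) ^ 2 ∧ M1 k t ≤ 20 * (bhi + 4) ^ 2) ∧
        (∀ j : ℕ, 2 ≤ j → |bv (m + j) t| ≤ lad j ∧ |wv (m + j) t| ≤ lad j ∧
          M0 (m + j) t ≤ lad j ∧ M1 (m + j) t ≤ lad j))) →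
      -- regime
      0 < ε₀ → ε₀ ≤ 1 / 20 → 0 < D → 1 / 2 ≤ θ → θ ≤ 1 → 0 ≤ η → 0 < εb → εb ≤ 1 / 10 ^ 6 →
      10 ^ 4 + 40 - 5 * Real.log εb ≤ blo → 10 ^ 9 * (bhi + 4) ^ 4 ≤ F →
      η * (10 ^ 9 * (bhi + 4) ^ 4 * (F + 1)) ≤ 1 → εb * (10 ^ 9 * (F + 1) ^ 2 * (bhi + 4) ^ 3) ≤ 1 →
      10 ^ 3 + 20 * Real.log (bhi + 5) + Real.log (F + 2) ≤ -Real.log εb →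
      -- the critical system with memory errors on [0, T]
      n₀ ≤ n → 0 ≤ t₀ → t₀ < T → blo ≤ B → B ≤ bhi →
      (∀ k : ℤ, k < n₀ → ∀ t ∈ Icc 0 T, bv k t = 0 ∧ wv k t = 0 ∧ M0 k t = 0 ∧ M1 k t = 0) →
      (∀ k : ℤ, ContinuousOn (bv k) (Icc 0 T) ∧ ContinuousOn (wv k) (Icc 0 T) ∧
        ContinuousOn (M0 k) (Icc 0 T) ∧ ContinuousOn (M1 k) (Icc 0 T)) →
      (∀ k : ℤ, ContinuousOn (db k) (Icc 0 T) ∧ ContinuousOn (dw k) (Icc 0 T) ∧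
        ∀ t ∈ Ioo 0 T, HasDerivAt (bv k) (db k t) t ∧
          |db k t - R k * (-(bv k t) + G0 k t)| ≤ η * R k * M0 k t ∧
          HasDerivAt (wv k) (dw k t) t ∧ |dw k t - R k * (-(wv k t) + G1 k t)| ≤ η * R k * M1 k t) →
      (∀ k : ℤ, ∀ t ∈ Icc 0 T, |bv k t| ≤ M0 k t ∧ |wv k t| ≤ M1 k t ∧ 0 ≤ M0 k t ∧ 0 ≤ M1 k t) →
      (∀ k : ℤ, ∀ t₁ ∈ Icc 0 T, ∀ t₂ ∈ Icc t₁ T,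
        M0 k t₂ ≤ M0 k t₁ * Real.exp (-(θ * R k * (t₂ - t₁))) +
          R k * ∫ u in t₁..t₂, Real.exp (-(θ * R k * (t₂ - u))) * |G0 k u| ∧
        M1 k t₂ ≤ M1 k t₁ * Real.exp (-(θ * R k * (t₂ - t₁))) +
          R k * ∫ u in t₁..t₂, Real.exp (-(θ * R k * (t₂ - u))) * |G1 k u|) →
      -- the a-priori far tail above the front, and the hand-off invariant at t₀
      (∃ J : ℕ, ∀ j : ℕ, J ≤ j → ∀ t ∈ Icc 0 T,
        |bv (n + j) t| ≤ lad j ∧ |wv (n + j) t| ≤ lad j / 5 ∧ M0 (n + j) t ≤ lad j ∧ M1 (n + j) t ≤ lad j) →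
      Inv n B t₀ →
      ∀ (Pre Pul : ℝ → Prop) (tι : ℝ),
      (∀ s : ℝ, Pre s ↔
        ((B * Real.exp (-(R n * (s - t₀))) - 3 / 2 ≤ bv n s ∧ bv n s ≤ B * Real.exp (-(R n * (s - t₀))) + 5 / 2 ∧
          0 ≤ wv n s ∧ M0 n s ≤ 6 * (B + 3) ∧
          M1 n s ≤ F * εb * B + 2 * wv n s + 2 * εb * (B + 3) ^ 2 * (R n * (s - t₀))) ∧
        (n₀ ≤ n - 1 → -(1 / 100) ≤ wv (n - 1) s ∧ (wv (n - 1) s) ^ 2 ≤ q ^ 3 * B + 2 ∧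
          -(2 / 5) ≤ bv (n - 1) s ∧ bv (n - 1) s ≤ 17 / 20 ∧
          (t₀ + 2 * (100 + 4 * Real.log (bhi + 5)) / (B * R n) ≤ s → |wv (n - 1) s| ≤ 1 / 200 ∧ bv (n - 1) s ≤ 3 / 10) ∧
          M0 (n - 1) s ≤ 6 * (bhi + 4) ^ 2 ∧ M1 (n - 1) s ≤ 6 * (bhi + 4) ^ 2 ∧
          (1 + ε₀) ^ (-(2 : ℤ)) * R n * ∫ u in t₀..s, (wv (n - 1) u) ^ 2 ≤ 9 / 10) ∧
        (|bv (n + 1) s| ≤ εb + q / 100 + 1 / 10 ^ 3 ∧ |wv (n + 1) s| ≤ 11 / 10 * εb ∧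
          M0 (n + 1) s ≤ εb + (B + 3) / 40 ∧ M1 (n + 1) s ≤ 4 * εb) ∧
        (∀ j : ℕ, 2 ≤ j → |bv (n + j) s| ≤ lad j ∧ |wv (n + j) s| ≤ lad j / 5 ∧
          M0 (n + j) s ≤ lad j ∧ M1 (n + j) s ≤ lad j) ∧
        (∀ k : ℤ, n₀ ≤ k → k ≤ n - 2 → -(9 / 20) ≤ bv k s ∧ bv k s ≤ 7 / 20 ∧ |wv k s| ≤ 1 / 100 ∧
          M0 k s ≤ 10 * (bhi + 4) ^ 2 + 1 ∧ M1 k s ≤ 10 * (bhi + 4) ^ 2 + 1))) →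
      (∀ s : ℝ, Pul s ↔
        ((-(1 / 2) ≤ bv n s ∧ bv n s ≤ bv n tι + 1 / 100 ∧ |wv n s| ≤ bv n tι + 1 / 100 ∧
          -(q / 50) ≤ bv (n + 1) s ∧ bv (n + 1) s ≤ q * (bv n tι + 1 / 100) ∧
          M0 n s ≤ 3 * (bhi + 4) ^ 2 ∧ M1 n s ≤ 5 * (bhi + 4) ^ 2 ∧ M0 (n + 1) s ≤ 3 / 2 * B ∧
          |wv (n + 1) s| ≤ 1 / 10 ^ 3 ∧ M1 (n + 1) s ≤ 1) ∧
        (n₀ ≤ n - 1 → |wv (n - 1) s| ≤ 1 / 200 ∧ -(2 / 5) ≤ bv (n - 1) s ∧ bv (n - 1) s ≤ 3 / 10 ∧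
          M0 (n - 1) s ≤ 6 * (bhi + 4) ^ 2 ∧ M1 (n - 1) s ≤ 6 * (bhi + 4) ^ 2 ∧
          (1 + ε₀) ^ (-(2 : ℤ)) * R n * ∫ u in t₀..s, (wv (n - 1) u) ^ 2 ≤ 9 / 10) ∧
        (∀ j : ℕ, 2 ≤ j → |bv (n + j) s| ≤ lad j ∧ |wv (n + j) s| ≤ lad j / 5 ∧
          M0 (n + j) s ≤ lad j ∧ M1 (n + j) s ≤ lad j) ∧
        (∀ k : ℤ, n₀ ≤ k → k ≤ n - 2 → -(9 / 20) ≤ bv k s ∧ bv k s ≤ 7 / 20 ∧ |wv k s| ≤ 1 / 100 ∧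
          M0 k s ≤ 10 * (bhi + 4) ^ 2 + 1 ∧ M1 k s ≤ 10 * (bhi + 4) ^ 2 + 1))) →
      t₀ < tι → tι ≤ t₀ + 3 / R n → t₀ + 2 * (100 + 4 * Real.log (bhi + 5)) / (B * R n) ≤ tι → 10 ^ 4 ≤ bv n tι →
      (∀ s ∈ Icc t₀ tι, Pre s) → (∀ s ∈ Ioc t₀ tι, 0 < wv n s) → (R n * ∫ u in t₀..tι, (wv n u) ^ 2 ≤ 1 / 100) →
      (∀ s ∈ Icc t₀ tι, (wv n s) ^ 2 ≤ bv n s / 100) → (wv n tι) ^ 2 = bv n tι / 100 →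
      bv n tι ≤ B + Real.log (10 * (F + 2) * εb * B) + 6 * (R n * (tι - t₀) + 1) →
      B * (1 - Real.exp (-(R n * (tι - t₀)))) ≤
        max 0 (Real.log (6 / 10 * Real.sqrt (B + 4) / (εb * B))) + 6 * (R n * (tι - t₀) + 1) + 2 →
      tι + (5 * Real.log (bv n tι) + 20) / bv n tι / R n ≤ T →
      (∀ s ∈ Icc tι (tι + (5 * Real.log (bv n tι) + 20) / bv n tι / R n), Pul s) →
      (∃ t₁ ∈ Ioo t₀ T, t₁ ≤ t₀ + 4 / R n ∧ ∃ B' : ℝ, Inv (n + 1) B' t₁ ∧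
        q * (B + Real.log εb - 6 * Real.log (B + 2) - 58) ≤ B' ∧
        B' ≤ q * (B + Real.log (10 * (F + 2) * εb * B) + 25) ∧
        (∀ t ∈ Icc t₀ t₁, Tube n t ∧ bv n t ≤ B + 3) ∧
        (∃ tc ∈ Ioo t₀ t₁, (∀ s ∈ Ico t₀ tc, bv (n + 1) s < 1) ∧ bv (n + 1) tc = 1 ∧
          ∃ δ : ℝ, 0 < δ ∧ tc + δ ≤ t₁ ∧ ∀ s ∈ Ioc tc (tc + δ), 1 < bv (n + 1) s)) := by
  sorry

/-- **Stub `oneStep`** (THE WINDOW ONE-STEP THEOREM of line `Sketch`, abstract let-free form: the derived symbols … -/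
theorem stub_oneStep :
    ∀ (ε₀ D εb θ η F blo bhi : ℝ) (n₀ : ℤ) (bv wv M0 M1 db dw : ℤ → ℝ → ℝ) (q : ℝ) (R : ℤ → ℝ) (lad : ℕ → ℝ)
      (G0 G1 : ℤ → ℝ → ℝ) (Inv : ℤ → ℝ → ℝ → Prop) (Tube : ℤ → ℝ → Prop) (n : ℤ) (B t₀ T : ℝ),
      q = Real.sqrt (1 + ε₀) → (∀ k : ℤ, R k = D * (1 + ε₀) ^ (2 * k)) →
      (∀ j : ℕ, lad j = εb * ((1 + ε₀) ^ (19 * (j - 2)))⁻¹) →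
      (∀ (k : ℤ) (t : ℝ), G0 k t = (wv (k - 1) t) ^ 2 / q ^ 3 - (wv k t) ^ 2 - εb * bv k t * wv k t) →
      (∀ (k : ℤ) (t : ℝ), G1 k t = wv k t * (bv k t - bv (k + 1) t / q) + εb * (bv k t) ^ 2) →
      (∀ (m : ℤ) (Bm t : ℝ), Inv m Bm t ↔
        (bv m t = Bm ∧ (∀ s ∈ Icc 0 t, bv m s ≤ Bm) ∧
        (0 ≤ wv m t ∧ wv m t ≤ F * εb * Bm ∧ M1 m t ≤ F * εb * Bm ∧ M0 m t ≤ 2 * Bm) ∧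
        (n₀ ≤ m - 1 → 0 ≤ wv (m - 1) t ∧ q ^ 3 * Bm - 1 ≤ (wv (m - 1) t) ^ 2 ∧
          (wv (m - 1) t) ^ 2 ≤ q ^ 3 * Bm + 1 ∧ 9 / 20 ≤ bv (m - 1) t ∧ bv (m - 1) t ≤ 11 / 20 ∧
          M0 (m - 1) t ≤ 5 * (bhi + 4) ^ 2 ∧ M1 (m - 1) t ≤ 5 * (bhi + 4) ^ 2) ∧
        (|bv (m + 1) t| ≤ εb ∧ |wv (m + 1) t| ≤ εb ∧ M0 (m + 1) t ≤ εb ∧ M1 (m + 1) t ≤ εb) ∧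
        (∀ j : ℕ, 2 ≤ j → |bv (m + j) t| ≤ lad j ∧ |wv (m + j) t| ≤ lad j / 5 ∧
          M0 (m + j) t ≤ lad j ∧ M1 (m + j) t ≤ lad j) ∧
        (∀ j : ℕ, 1 ≤ j → ∀ s ∈ Icc 0 t, bv (m + j) s ≤ 1 / 2) ∧
        (∀ k : ℤ, n₀ ≤ k → k ≤ m - 2 → ∃ te ∈ Icc 0 t,
          (-(2 / 5) ≤ bv k te ∧ bv k te ≤ 3 / 10 ∧ |wv k te| ≤ 1 / 200 ∧
            M0 k te ≤ 10 * (bhi + 4) ^ 2 ∧ M1 k te ≤ 10 * (bhi + 4) ^ 2) ∧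
          ∀ s ∈ Icc te t, -(9 / 20) ≤ bv k s ∧ bv k s ≤ 7 / 20 ∧ |wv k s| ≤ 1 / 100 ∧
            M0 k s ≤ 10 * (bhi + 4) ^ 2 + 1 ∧ M1 k s ≤ 10 * (bhi + 4) ^ 2 + 1 ∧ |wv (k - 1) s| ≤ 1 / 100 ∧
            -(1 / 2) ≤ bv (k + 1) s ∧ bv (k + 1) s ≤ 9 / 10))) →
      (∀ (m : ℤ) (t : ℝ), Tube m t ↔
        ((∀ k : ℤ, k ≤ m + 1 → |bv k t| ≤ 2 * (bhi + 3) ∧ |wv k t| ≤ 2 * (bhi + 3) ∧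
          M0 k t ≤ 20 * (bhi + 4) ^ 2 ∧ M1 k t ≤ 20 * (bhi + 4) ^ 2) ∧
        (∀ j : ℕ, 2 ≤ j → |bv (m + j) t| ≤ lad j ∧ |wv (m + j) t| ≤ lad j ∧
          M0 (m + j) t ≤ lad j ∧ M1 (m + j) t ≤ lad j))) →
      -- regime
      0 < ε₀ → ε₀ ≤ 1 / 20 → 0 < D → 1 / 2 ≤ θ → θ ≤ 1 → 0 ≤ η → 0 < εb → εb ≤ 1 / 10 ^ 6 →
      10 ^ 4 + 40 - 5 * Real.log εb ≤ blo → 10 ^ 9 * (bhi + 4) ^ 4 ≤ F →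
      η * (10 ^ 9 * (bhi + 4) ^ 4 * (F + 1)) ≤ 1 → εb * (10 ^ 9 * (F + 1) ^ 2 * (bhi + 4) ^ 3) ≤ 1 →
      10 ^ 3 + 20 * Real.log (bhi + 5) + Real.log (F + 2) ≤ -Real.log εb →
      -- the critical system with memory errors on [0, T]
      n₀ ≤ n → 0 ≤ t₀ → t₀ < T → blo ≤ B → B ≤ bhi →
      (∀ k : ℤ, k < n₀ → ∀ t ∈ Icc 0 T, bv k t = 0 ∧ wv k t = 0 ∧ M0 k t = 0 ∧ M1 k t = 0) →
      (∀ k : ℤ, ContinuousOn (bv k) (Icc 0 T) ∧ ContinuousOn (wv k) (Icc 0 T) ∧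
        ContinuousOn (M0 k) (Icc 0 T) ∧ ContinuousOn (M1 k) (Icc 0 T)) →
      (∀ k : ℤ, ContinuousOn (db k) (Icc 0 T) ∧ ContinuousOn (dw k) (Icc 0 T) ∧
        ∀ t ∈ Ioo 0 T, HasDerivAt (bv k) (db k t) t ∧
          |db k t - R k * (-(bv k t) + G0 k t)| ≤ η * R k * M0 k t ∧
          HasDerivAt (wv k) (dw k t) t ∧ |dw k t - R k * (-(wv k t) + G1 k t)| ≤ η * R k * M1 k t) →
      (∀ k : ℤ, ∀ t ∈ Icc 0 T, |bv k t| ≤ M0 k t ∧ |wv k t| ≤ M1 k t ∧ 0 ≤ M0 k t ∧ 0 ≤ M1 k t) →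
      (∀ k : ℤ, ∀ t₁ ∈ Icc 0 T, ∀ t₂ ∈ Icc t₁ T,
        M0 k t₂ ≤ M0 k t₁ * Real.exp (-(θ * R k * (t₂ - t₁))) +
          R k * ∫ u in t₁..t₂, Real.exp (-(θ * R k * (t₂ - u))) * |G0 k u| ∧
        M1 k t₂ ≤ M1 k t₁ * Real.exp (-(θ * R k * (t₂ - t₁))) +
          R k * ∫ u in t₁..t₂, Real.exp (-(θ * R k * (t₂ - u))) * |G1 k u|) →
      -- the a-priori far tail above the front, and the hand-off invariant at t₀
      (∃ J : ℕ, ∀ j : ℕ, J ≤ j → ∀ t ∈ Icc 0 T,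
        |bv (n + j) t| ≤ lad j ∧ |wv (n + j) t| ≤ lad j / 5 ∧ M0 (n + j) t ≤ lad j ∧ M1 (n + j) t ≤ lad j) →
      Inv n B t₀ →
      (∃ t₁ ∈ Ioo t₀ T, t₁ ≤ t₀ + 4 / R n ∧ ∃ B' : ℝ, Inv (n + 1) B' t₁ ∧
        q * (B + Real.log εb - 6 * Real.log (B + 2) - 58) ≤ B' ∧
        B' ≤ q * (B + Real.log (10 * (F + 2) * εb * B) + 25) ∧
        (∀ t ∈ Icc t₀ t₁, Tube n t ∧ bv n t ≤ B + 3) ∧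
        (∃ tc ∈ Ioo t₀ t₁, (∀ s ∈ Ico t₀ tc, bv (n + 1) s < 1) ∧ bv (n + 1) tc = 1 ∧
          ∃ δ : ℝ, 0 < δ ∧ tc + δ ≤ t₁ ∧ ∀ s ∈ Ioc tc (tc + δ), 1 < bv (n + 1) s)) ∨
      (T < t₀ + 4 / R n ∧ ∀ t ∈ Icc t₀ T, Tube n t ∧ bv n t ≤ B + 3) := by
  -- REGISTERED skeleton: `:= stub_oneStepCore stub_preBoot stub_pulseBoot stub_handoff` (stub_oneStepCore PROVED,
  -- Theorems/PerpetualPumpAveragedTypeIBlowupOneStepCore.lean); omitted in the published copy for size.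
  sorry

/-- **Stub `invAtZero`** (tree vocabulary). THE HAND-OFF INVARIANT AT TIME ZERO: for the carrier datum `A = −B < 0 … -/
theorem stub_invAtZero :
    ∀ {ε₀ : ℝ}, 0 < ε₀ → ε₀ ≤ 1 / 20 → ∀ (𝒟 : CascadeWaveletData ε₀ 2) (r Dc εb : ℝ)
      (α : Fin 2 → Fin 2 → Fin 2 → ℤ × ℤ × ℤ → ℝ) (kern : Fin 2 → ℤ → ℝ → ℝ)
      (bvo wvo : (Fin 2 → ℤ → ℝ → ℝ) → ℤ → ℝ → ℝ) (M0o M1o : ℝ → (Fin 2 → ℤ → ℝ → ℝ) → ℤ → ℝ → ℝ)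
      (q : ℝ) (R : ℤ → ℝ) (lad : ℕ → ℝ) (Sol : ℝ → ℝ → (Fin 2 → ℤ → ℝ → ℝ) → Prop),
      0 < r → r ≤ (1 + ε₀ / 4) / 2 → (∀ i, 𝒟.radius i ≤ r ∧ ‖𝒟.center i‖ = 1 + ε₀ / 4) →
      Dc = 4 * Real.pi ^ 2 * ((1 + ε₀ / 4) ^ 2 + r ^ 2) → 0 < εb →
      α = (fun (i₁ i₂ i₃ : Fin 2) (μ : ℤ × ℤ × ℤ) =>
          if i₁ = 1 ∧ i₂ = 1 ∧ i₃ = 0 ∧ μ = (0, 0, 0) then Dc else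
          if i₁ = 1 ∧ i₂ = 0 ∧ i₃ = 1 ∧ μ = (0, 0, 0) then -Dc / 2 else
          if i₁ = 0 ∧ i₂ = 1 ∧ i₃ = 1 ∧ μ = (0, 0, 0) then -Dc / 2 else
          if i₁ = 1 ∧ i₂ = 0 ∧ i₃ = 1 ∧ μ = (0, 1, 0) then Dc / 2 else
          if i₁ = 0 ∧ i₂ = 1 ∧ i₃ = 1 ∧ μ = (1, 0, 0) then Dc / 2 else
          if i₁ = 1 ∧ i₂ = 1 ∧ i₃ = 0 ∧ μ = (0, 0, 1) then -Dc else
          if i₁ = 0 ∧ i₂ = 0 ∧ i₃ = 1 ∧ μ = (0, 0, 0) then εb * Dc else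
          if i₁ = 0 ∧ i₂ = 1 ∧ i₃ = 0 ∧ μ = (0, 0, 0) then -(εb * Dc) / 2 else
          if i₁ = 1 ∧ i₂ = 0 ∧ i₃ = 0 ∧ μ = (0, 0, 0) then -(εb * Dc) / 2 else 0) →
      (∀ (i : Fin 2) (n : ℤ) (τ : ℝ),
        kern i n τ = (pairing (heat τ (cascadeWavelet ε₀ (𝒟.ψ i) n)) (cascadeWavelet ε₀ (𝒟.ψ i) n)).re) →
      (∀ (Y : Fin 2 → ℤ → ℝ → ℝ) (n : ℤ) (t : ℝ), bvo Y n t = -((1 + ε₀) ^ ((n : ℝ) / 2) * Y 0 n t)) →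
      (∀ (Y : Fin 2 → ℤ → ℝ → ℝ) (n : ℤ) (t : ℝ), wvo Y n t = (1 + ε₀) ^ ((n : ℝ) / 2) * Y 1 n t) →
      (∀ (A : ℝ) (Y : Fin 2 → ℤ → ℝ → ℝ) (n : ℤ) (t : ℝ), M0o A Y n t = (1 + ε₀) ^ ((n : ℝ) / 2) *
        ((if n = 0 then |A| else 0) * (∫ ξ, Real.exp (-(heatRate ξ * t)) * modeWeight 𝒟 0 n ξ) +
          ∫ s in (0 : ℝ)..t, (∫ ξ, Real.exp (-(heatRate ξ * (t - s))) * modeWeight 𝒟 0 n ξ) *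
            |quadTerm ε₀ α Y 0 n s|)) →
      (∀ (A : ℝ) (Y : Fin 2 → ℤ → ℝ → ℝ) (n : ℤ) (t : ℝ), M1o A Y n t = (1 + ε₀) ^ ((n : ℝ) / 2) *
        ∫ s in (0 : ℝ)..t, (∫ ξ, Real.exp (-(heatRate ξ * (t - s))) * modeWeight 𝒟 1 n ξ) *
          |quadTerm ε₀ α Y 1 n s|) →
      q = Real.sqrt (1 + ε₀) → (∀ k : ℤ, R k = Dc * (1 + ε₀) ^ (2 * k)) →
      (∀ j : ℕ, lad j = εb * ((1 + ε₀) ^ (19 * (j - 2)))⁻¹) →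
      (∀ (A S : ℝ) (Y : Fin 2 → ℤ → ℝ → ℝ), Sol A S Y ↔
        (0 < S ∧ (∀ i n, ContinuousOn (Y i n) (Ico 0 S)) ∧ (∀ i n t, n < 0 → Y i n t = 0) ∧
        (∀ S' : ℝ, S' < S → ∃ C : ℝ, ∀ (i : Fin 2) (n : ℤ), ∀ t ∈ Icc 0 S',
          (1 + ε₀) ^ ((20 : ℝ) * n) * |Y i n t| ≤ C) ∧
        (∀ (i : Fin 2) (n : ℤ), ∀ t ∈ Ico 0 S,
          Y i n t = (if i = 0 ∧ n = 0 then A else 0) * kern i n t +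
            ∫ s in (0 : ℝ)..t, kern i n (t - s) * quadTerm ε₀ α Y i n s))) →
      ∀ (F bhi : ℝ) (Invo : ℝ → (Fin 2 → ℤ → ℝ → ℝ) → ℤ → ℝ → ℝ → Prop),
      (∀ (A : ℝ) (Y : Fin 2 → ℤ → ℝ → ℝ) (m : ℤ) (Bm t : ℝ), Invo A Y m Bm t ↔
        (bvo Y m t = Bm ∧ (∀ s ∈ Icc 0 t, bvo Y m s ≤ Bm) ∧
        (0 ≤ wvo Y m t ∧ wvo Y m t ≤ F * εb * Bm ∧ M1o A Y m t ≤ F * εb * Bm ∧ M0o A Y m t ≤ 2 * Bm) ∧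
        (0 ≤ m - 1 → 0 ≤ wvo Y (m - 1) t ∧ q ^ 3 * Bm - 1 ≤ (wvo Y (m - 1) t) ^ 2 ∧
          (wvo Y (m - 1) t) ^ 2 ≤ q ^ 3 * Bm + 1 ∧ 9 / 20 ≤ bvo Y (m - 1) t ∧ bvo Y (m - 1) t ≤ 11 / 20 ∧
          M0o A Y (m - 1) t ≤ 5 * (bhi + 4) ^ 2 ∧ M1o A Y (m - 1) t ≤ 5 * (bhi + 4) ^ 2) ∧
        (|bvo Y (m + 1) t| ≤ εb ∧ |wvo Y (m + 1) t| ≤ εb ∧ M0o A Y (m + 1) t ≤ εb ∧ M1o A Y (m + 1) t ≤ εb) ∧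
        (∀ j : ℕ, 2 ≤ j → |bvo Y (m + j) t| ≤ lad j ∧ |wvo Y (m + j) t| ≤ lad j / 5 ∧
          M0o A Y (m + j) t ≤ lad j ∧ M1o A Y (m + j) t ≤ lad j) ∧
        (∀ j : ℕ, 1 ≤ j → ∀ s ∈ Icc 0 t, bvo Y (m + j) s ≤ 1 / 2) ∧
        (∀ k : ℤ, 0 ≤ k → k ≤ m - 2 → ∃ te ∈ Icc 0 t,
          (-(2 / 5) ≤ bvo Y k te ∧ bvo Y k te ≤ 3 / 10 ∧ |wvo Y k te| ≤ 1 / 200 ∧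
            M0o A Y k te ≤ 10 * (bhi + 4) ^ 2 ∧ M1o A Y k te ≤ 10 * (bhi + 4) ^ 2) ∧
          ∀ s ∈ Icc te t, -(9 / 20) ≤ bvo Y k s ∧ bvo Y k s ≤ 7 / 20 ∧ |wvo Y k s| ≤ 1 / 100 ∧
            M0o A Y k s ≤ 10 * (bhi + 4) ^ 2 + 1 ∧ M1o A Y k s ≤ 10 * (bhi + 4) ^ 2 + 1 ∧ |wvo Y (k - 1) s| ≤ 1 / 100 ∧
            -(1 / 2) ≤ bvo Y (k + 1) s ∧ bvo Y (k + 1) s ≤ 9 / 10))) →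
      ∀ (A S B : ℝ) (Y : Fin 2 → ℤ → ℝ → ℝ), Sol A S Y → A = -B → 0 < B → 0 ≤ F → Invo A Y 0 B 0 := by
  sorry

/-- **Stub `peakAt`** (tree vocabulary + `stub_peakContinuity`). THE RENORMALISED AMPLITUDE OF A STEP IS CONTINUOU … -/
theorem stub_peakAt :
    ∀ {ε₀ : ℝ}, 0 < ε₀ → ε₀ ≤ 1 / 20 → ∀ (𝒟 : CascadeWaveletData ε₀ 2) (r Dc εb : ℝ)
      (α : Fin 2 → Fin 2 → Fin 2 → ℤ × ℤ × ℤ → ℝ) (kern : Fin 2 → ℤ → ℝ → ℝ)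
      (bvo wvo : (Fin 2 → ℤ → ℝ → ℝ) → ℤ → ℝ → ℝ) (M0o M1o : ℝ → (Fin 2 → ℤ → ℝ → ℝ) → ℤ → ℝ → ℝ)
      (q : ℝ) (R : ℤ → ℝ) (lad : ℕ → ℝ) (Sol : ℝ → ℝ → (Fin 2 → ℤ → ℝ → ℝ) → Prop),
      0 < r → r ≤ (1 + ε₀ / 4) / 2 → (∀ i, 𝒟.radius i ≤ r ∧ ‖𝒟.center i‖ = 1 + ε₀ / 4) →
      Dc = 4 * Real.pi ^ 2 * ((1 + ε₀ / 4) ^ 2 + r ^ 2) → 0 < εb →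
      α = (fun (i₁ i₂ i₃ : Fin 2) (μ : ℤ × ℤ × ℤ) =>
          if i₁ = 1 ∧ i₂ = 1 ∧ i₃ = 0 ∧ μ = (0, 0, 0) then Dc else
          if i₁ = 1 ∧ i₂ = 0 ∧ i₃ = 1 ∧ μ = (0, 0, 0) then -Dc / 2 else
          if i₁ = 0 ∧ i₂ = 1 ∧ i₃ = 1 ∧ μ = (0, 0, 0) then -Dc / 2 else
          if i₁ = 1 ∧ i₂ = 0 ∧ i₃ = 1 ∧ μ = (0, 1, 0) then Dc / 2 else
          if i₁ = 0 ∧ i₂ = 1 ∧ i₃ = 1 ∧ μ = (1, 0, 0) then Dc / 2 else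
          if i₁ = 1 ∧ i₂ = 1 ∧ i₃ = 0 ∧ μ = (0, 0, 1) then -Dc else
          if i₁ = 0 ∧ i₂ = 0 ∧ i₃ = 1 ∧ μ = (0, 0, 0) then εb * Dc else
          if i₁ = 0 ∧ i₂ = 1 ∧ i₃ = 0 ∧ μ = (0, 0, 0) then -(εb * Dc) / 2 else
          if i₁ = 1 ∧ i₂ = 0 ∧ i₃ = 0 ∧ μ = (0, 0, 0) then -(εb * Dc) / 2 else 0) →
      (∀ (i : Fin 2) (n : ℤ) (τ : ℝ),
        kern i n τ = (pairing (heat τ (cascadeWavelet ε₀ (𝒟.ψ i) n)) (cascadeWavelet ε₀ (𝒟.ψ i) n)).re) →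
      (∀ (Y : Fin 2 → ℤ → ℝ → ℝ) (n : ℤ) (t : ℝ), bvo Y n t = -((1 + ε₀) ^ ((n : ℝ) / 2) * Y 0 n t)) →
      (∀ (Y : Fin 2 → ℤ → ℝ → ℝ) (n : ℤ) (t : ℝ), wvo Y n t = (1 + ε₀) ^ ((n : ℝ) / 2) * Y 1 n t) →
      (∀ (A : ℝ) (Y : Fin 2 → ℤ → ℝ → ℝ) (n : ℤ) (t : ℝ), M0o A Y n t = (1 + ε₀) ^ ((n : ℝ) / 2) *
        ((if n = 0 then |A| else 0) * (∫ ξ, Real.exp (-(heatRate ξ * t)) * modeWeight 𝒟 0 n ξ) +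
          ∫ s in (0 : ℝ)..t, (∫ ξ, Real.exp (-(heatRate ξ * (t - s))) * modeWeight 𝒟 0 n ξ) *
            |quadTerm ε₀ α Y 0 n s|)) →
      (∀ (A : ℝ) (Y : Fin 2 → ℤ → ℝ → ℝ) (n : ℤ) (t : ℝ), M1o A Y n t = (1 + ε₀) ^ ((n : ℝ) / 2) *
        ∫ s in (0 : ℝ)..t, (∫ ξ, Real.exp (-(heatRate ξ * (t - s))) * modeWeight 𝒟 1 n ξ) *
          |quadTerm ε₀ α Y 1 n s|) →
      q = Real.sqrt (1 + ε₀) → (∀ k : ℤ, R k = Dc * (1 + ε₀) ^ (2 * k)) →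
      (∀ j : ℕ, lad j = εb * ((1 + ε₀) ^ (19 * (j - 2)))⁻¹) →
      (∀ (A S : ℝ) (Y : Fin 2 → ℤ → ℝ → ℝ), Sol A S Y ↔
        (0 < S ∧ (∀ i n, ContinuousOn (Y i n) (Ico 0 S)) ∧ (∀ i n t, n < 0 → Y i n t = 0) ∧
        (∀ S' : ℝ, S' < S → ∃ C : ℝ, ∀ (i : Fin 2) (n : ℤ), ∀ t ∈ Icc 0 S',
          (1 + ε₀) ^ ((20 : ℝ) * n) * |Y i n t| ≤ C) ∧
        (∀ (i : Fin 2) (n : ℤ), ∀ t ∈ Ico 0 S,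
          Y i n t = (if i = 0 ∧ n = 0 then A else 0) * kern i n t +
            ∫ s in (0 : ℝ)..t, kern i n (t - s) * quadTerm ε₀ α Y i n s))) →
      ∀ (val : ℝ → Fin 2 → ℤ → ℝ → ℝ),
      (∀ (A S : ℝ) (Y : Fin 2 → ℤ → ℝ → ℝ), Sol A S Y → ∀ (i : Fin 2) (n : ℤ), ∀ t ∈ Ico 0 S, val A i n t = Y i n t) →
      ∀ (A₀ S tc δ : ℝ) (Y : Fin 2 → ℤ → ℝ → ℝ) (k : ℤ), Sol A₀ S Y → 0 < tc → 0 < δ → tc + δ < S →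
      (∀ t ∈ Ico 0 tc, bvo Y (k + 1) t < 1) → bvo Y (k + 1) tc = 1 → (∀ t ∈ Ioc tc (tc + δ), 1 < bvo Y (k + 1) t) →
      ContinuousAt (fun A => sSup ((fun t => bvo (val A) k t) '' Icc 0 (sInf {t : ℝ | 0 ≤ t ∧ 1 ≤ bvo (val A) (k + 1) t}))) A₀ ∧
      sSup ((fun t => bvo (val A₀) k t) '' Icc 0 (sInf {t : ℝ | 0 ≤ t ∧ 1 ≤ bvo (val A₀) (k + 1) t})) =
        sSup ((fun t => bvo Y k t) '' Icc 0 tc) := by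
  sorry

/-- **Stub `stepExists`** (tree vocabulary; consumes the window one-step theorem `stub_oneStep` as a hypothesis). … -/
theorem stub_stepExists :
    ∀ {ε₀ : ℝ}, 0 < ε₀ → ε₀ ≤ 1 / 20 → ∀ (𝒟 : CascadeWaveletData ε₀ 2) (r Dc εb : ℝ)
      (α : Fin 2 → Fin 2 → Fin 2 → ℤ × ℤ × ℤ → ℝ) (kern : Fin 2 → ℤ → ℝ → ℝ)
      (bvo wvo : (Fin 2 → ℤ → ℝ → ℝ) → ℤ → ℝ → ℝ) (M0o M1o : ℝ → (Fin 2 → ℤ → ℝ → ℝ) → ℤ → ℝ → ℝ)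
      (q : ℝ) (R : ℤ → ℝ) (lad : ℕ → ℝ) (Sol : ℝ → ℝ → (Fin 2 → ℤ → ℝ → ℝ) → Prop),
      0 < r → r ≤ (1 + ε₀ / 4) / 2 → (∀ i, 𝒟.radius i ≤ r ∧ ‖𝒟.center i‖ = 1 + ε₀ / 4) →
      Dc = 4 * Real.pi ^ 2 * ((1 + ε₀ / 4) ^ 2 + r ^ 2) → 0 < εb →
      α = (fun (i₁ i₂ i₃ : Fin 2) (μ : ℤ × ℤ × ℤ) =>
          if i₁ = 1 ∧ i₂ = 1 ∧ i₃ = 0 ∧ μ = (0, 0, 0) then Dc else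
          if i₁ = 1 ∧ i₂ = 0 ∧ i₃ = 1 ∧ μ = (0, 0, 0) then -Dc / 2 else
          if i₁ = 0 ∧ i₂ = 1 ∧ i₃ = 1 ∧ μ = (0, 0, 0) then -Dc / 2 else
          if i₁ = 1 ∧ i₂ = 0 ∧ i₃ = 1 ∧ μ = (0, 1, 0) then Dc / 2 else
          if i₁ = 0 ∧ i₂ = 1 ∧ i₃ = 1 ∧ μ = (1, 0, 0) then Dc / 2 else
          if i₁ = 1 ∧ i₂ = 1 ∧ i₃ = 0 ∧ μ = (0, 0, 1) then -Dc else
          if i₁ = 0 ∧ i₂ = 0 ∧ i₃ = 1 ∧ μ = (0, 0, 0) then εb * Dc else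
          if i₁ = 0 ∧ i₂ = 1 ∧ i₃ = 0 ∧ μ = (0, 0, 0) then -(εb * Dc) / 2 else
          if i₁ = 1 ∧ i₂ = 0 ∧ i₃ = 0 ∧ μ = (0, 0, 0) then -(εb * Dc) / 2 else 0) →
      (∀ (i : Fin 2) (n : ℤ) (τ : ℝ),
        kern i n τ = (pairing (heat τ (cascadeWavelet ε₀ (𝒟.ψ i) n)) (cascadeWavelet ε₀ (𝒟.ψ i) n)).re) →
      (∀ (Y : Fin 2 → ℤ → ℝ → ℝ) (n : ℤ) (t : ℝ), bvo Y n t = -((1 + ε₀) ^ ((n : ℝ) / 2) * Y 0 n t)) →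
      (∀ (Y : Fin 2 → ℤ → ℝ → ℝ) (n : ℤ) (t : ℝ), wvo Y n t = (1 + ε₀) ^ ((n : ℝ) / 2) * Y 1 n t) →
      (∀ (A : ℝ) (Y : Fin 2 → ℤ → ℝ → ℝ) (n : ℤ) (t : ℝ), M0o A Y n t = (1 + ε₀) ^ ((n : ℝ) / 2) *
        ((if n = 0 then |A| else 0) * (∫ ξ, Real.exp (-(heatRate ξ * t)) * modeWeight 𝒟 0 n ξ) +
          ∫ s in (0 : ℝ)..t, (∫ ξ, Real.exp (-(heatRate ξ * (t - s))) * modeWeight 𝒟 0 n ξ) *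
            |quadTerm ε₀ α Y 0 n s|)) →
      (∀ (A : ℝ) (Y : Fin 2 → ℤ → ℝ → ℝ) (n : ℤ) (t : ℝ), M1o A Y n t = (1 + ε₀) ^ ((n : ℝ) / 2) *
        ∫ s in (0 : ℝ)..t, (∫ ξ, Real.exp (-(heatRate ξ * (t - s))) * modeWeight 𝒟 1 n ξ) *
          |quadTerm ε₀ α Y 1 n s|) →
      q = Real.sqrt (1 + ε₀) → (∀ k : ℤ, R k = Dc * (1 + ε₀) ^ (2 * k)) →
      (∀ j : ℕ, lad j = εb * ((1 + ε₀) ^ (19 * (j - 2)))⁻¹) →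
      (∀ (A S : ℝ) (Y : Fin 2 → ℤ → ℝ → ℝ), Sol A S Y ↔
        (0 < S ∧ (∀ i n, ContinuousOn (Y i n) (Ico 0 S)) ∧ (∀ i n t, n < 0 → Y i n t = 0) ∧
        (∀ S' : ℝ, S' < S → ∃ C : ℝ, ∀ (i : Fin 2) (n : ℤ), ∀ t ∈ Icc 0 S',
          (1 + ε₀) ^ ((20 : ℝ) * n) * |Y i n t| ≤ C) ∧
        (∀ (i : Fin 2) (n : ℤ), ∀ t ∈ Ico 0 S,
          Y i n t = (if i = 0 ∧ n = 0 then A else 0) * kern i n t +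
            ∫ s in (0 : ℝ)..t, kern i n (t - s) * quadTerm ε₀ α Y i n s))) →
      ∀ (F bhi : ℝ) (Invo : ℝ → (Fin 2 → ℤ → ℝ → ℝ) → ℤ → ℝ → ℝ → Prop),
      (∀ (A : ℝ) (Y : Fin 2 → ℤ → ℝ → ℝ) (m : ℤ) (Bm t : ℝ), Invo A Y m Bm t ↔
        (bvo Y m t = Bm ∧ (∀ s ∈ Icc 0 t, bvo Y m s ≤ Bm) ∧
        (0 ≤ wvo Y m t ∧ wvo Y m t ≤ F * εb * Bm ∧ M1o A Y m t ≤ F * εb * Bm ∧ M0o A Y m t ≤ 2 * Bm) ∧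
        (0 ≤ m - 1 → 0 ≤ wvo Y (m - 1) t ∧ q ^ 3 * Bm - 1 ≤ (wvo Y (m - 1) t) ^ 2 ∧
          (wvo Y (m - 1) t) ^ 2 ≤ q ^ 3 * Bm + 1 ∧ 9 / 20 ≤ bvo Y (m - 1) t ∧ bvo Y (m - 1) t ≤ 11 / 20 ∧
          M0o A Y (m - 1) t ≤ 5 * (bhi + 4) ^ 2 ∧ M1o A Y (m - 1) t ≤ 5 * (bhi + 4) ^ 2) ∧
        (|bvo Y (m + 1) t| ≤ εb ∧ |wvo Y (m + 1) t| ≤ εb ∧ M0o A Y (m + 1) t ≤ εb ∧ M1o A Y (m + 1) t ≤ εb) ∧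
        (∀ j : ℕ, 2 ≤ j → |bvo Y (m + j) t| ≤ lad j ∧ |wvo Y (m + j) t| ≤ lad j / 5 ∧
          M0o A Y (m + j) t ≤ lad j ∧ M1o A Y (m + j) t ≤ lad j) ∧
        (∀ j : ℕ, 1 ≤ j → ∀ s ∈ Icc 0 t, bvo Y (m + j) s ≤ 1 / 2) ∧
        (∀ k : ℤ, 0 ≤ k → k ≤ m - 2 → ∃ te ∈ Icc 0 t,
          (-(2 / 5) ≤ bvo Y k te ∧ bvo Y k te ≤ 3 / 10 ∧ |wvo Y k te| ≤ 1 / 200 ∧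
            M0o A Y k te ≤ 10 * (bhi + 4) ^ 2 ∧ M1o A Y k te ≤ 10 * (bhi + 4) ^ 2) ∧
          ∀ s ∈ Icc te t, -(9 / 20) ≤ bvo Y k s ∧ bvo Y k s ≤ 7 / 20 ∧ |wvo Y k s| ≤ 1 / 100 ∧
            M0o A Y k s ≤ 10 * (bhi + 4) ^ 2 + 1 ∧ M1o A Y k s ≤ 10 * (bhi + 4) ^ 2 + 1 ∧ |wvo Y (k - 1) s| ≤ 1 / 100 ∧
            -(1 / 2) ≤ bvo Y (k + 1) s ∧ bvo Y (k + 1) s ≤ 9 / 10))) →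
      ∀ (Tubeo : ℝ → (Fin 2 → ℤ → ℝ → ℝ) → ℤ → ℝ → Prop),
      (∀ (A : ℝ) (Y : Fin 2 → ℤ → ℝ → ℝ) (m : ℤ) (t : ℝ), Tubeo A Y m t ↔
        ((∀ k : ℤ, k ≤ m + 1 → |bvo Y k t| ≤ 2 * (bhi + 3) ∧ |wvo Y k t| ≤ 2 * (bhi + 3) ∧
          M0o A Y k t ≤ 20 * (bhi + 4) ^ 2 ∧ M1o A Y k t ≤ 20 * (bhi + 4) ^ 2) ∧
        (∀ j : ℕ, 2 ≤ j → |bvo Y (m + j) t| ≤ lad j ∧ |wvo Y (m + j) t| ≤ lad j ∧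
          M0o A Y (m + j) t ≤ lad j ∧ M1o A Y (m + j) t ≤ lad j))) →
      ∀ (θ η blo : ℝ), θ = (1 + ε₀ / 4 - r) ^ 2 / ((1 + ε₀ / 4) ^ 2 + r ^ 2) →
      η = 2 * (1 + ε₀ / 4) * r / ((1 + ε₀ / 4) ^ 2 + r ^ 2) →
      εb ≤ 1 / 10 ^ 6 → 1 / 2 ≤ θ → θ ≤ 1 →
      10 ^ 4 + 40 - 5 * Real.log εb ≤ blo → 10 ^ 9 * (bhi + 4) ^ 4 ≤ F →
      η * (10 ^ 9 * (bhi + 4) ^ 4 * (F + 1)) ≤ 1 → εb * (10 ^ 9 * (F + 1) ^ 2 * (bhi + 4) ^ 3) ≤ 1 →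
      10 ^ 3 + 20 * Real.log (bhi + 5) + Real.log (F + 2) ≤ -Real.log εb →
      (∀ (ε₀ D εb θ η F blo bhi : ℝ) (n₀ : ℤ) (bv wv M0 M1 db dw : ℤ → ℝ → ℝ) (q : ℝ) (R : ℤ → ℝ) (lad : ℕ → ℝ)
      (G0 G1 : ℤ → ℝ → ℝ) (Inv : ℤ → ℝ → ℝ → Prop) (Tube : ℤ → ℝ → Prop) (n : ℤ) (B t₀ T : ℝ),
      q = Real.sqrt (1 + ε₀) → (∀ k : ℤ, R k = D * (1 + ε₀) ^ (2 * k)) →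
      (∀ j : ℕ, lad j = εb * ((1 + ε₀) ^ (19 * (j - 2)))⁻¹) →
      (∀ (k : ℤ) (t : ℝ), G0 k t = (wv (k - 1) t) ^ 2 / q ^ 3 - (wv k t) ^ 2 - εb * bv k t * wv k t) →
      (∀ (k : ℤ) (t : ℝ), G1 k t = wv k t * (bv k t - bv (k + 1) t / q) + εb * (bv k t) ^ 2) →
      (∀ (m : ℤ) (Bm t : ℝ), Inv m Bm t ↔
        (bv m t = Bm ∧ (∀ s ∈ Icc 0 t, bv m s ≤ Bm) ∧
        (0 ≤ wv m t ∧ wv m t ≤ F * εb * Bm ∧ M1 m t ≤ F * εb * Bm ∧ M0 m t ≤ 2 * Bm) ∧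
        (n₀ ≤ m - 1 → 0 ≤ wv (m - 1) t ∧ q ^ 3 * Bm - 1 ≤ (wv (m - 1) t) ^ 2 ∧
          (wv (m - 1) t) ^ 2 ≤ q ^ 3 * Bm + 1 ∧ 9 / 20 ≤ bv (m - 1) t ∧ bv (m - 1) t ≤ 11 / 20 ∧
          M0 (m - 1) t ≤ 5 * (bhi + 4) ^ 2 ∧ M1 (m - 1) t ≤ 5 * (bhi + 4) ^ 2) ∧
        (|bv (m + 1) t| ≤ εb ∧ |wv (m + 1) t| ≤ εb ∧ M0 (m + 1) t ≤ εb ∧ M1 (m + 1) t ≤ εb) ∧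
        (∀ j : ℕ, 2 ≤ j → |bv (m + j) t| ≤ lad j ∧ |wv (m + j) t| ≤ lad j / 5 ∧
          M0 (m + j) t ≤ lad j ∧ M1 (m + j) t ≤ lad j) ∧
        (∀ j : ℕ, 1 ≤ j → ∀ s ∈ Icc 0 t, bv (m + j) s ≤ 1 / 2) ∧
        (∀ k : ℤ, n₀ ≤ k → k ≤ m - 2 → ∃ te ∈ Icc 0 t,
          (-(2 / 5) ≤ bv k te ∧ bv k te ≤ 3 / 10 ∧ |wv k te| ≤ 1 / 200 ∧
            M0 k te ≤ 10 * (bhi + 4) ^ 2 ∧ M1 k te ≤ 10 * (bhi + 4) ^ 2) ∧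
          ∀ s ∈ Icc te t, -(9 / 20) ≤ bv k s ∧ bv k s ≤ 7 / 20 ∧ |wv k s| ≤ 1 / 100 ∧
            M0 k s ≤ 10 * (bhi + 4) ^ 2 + 1 ∧ M1 k s ≤ 10 * (bhi + 4) ^ 2 + 1 ∧ |wv (k - 1) s| ≤ 1 / 100 ∧
            -(1 / 2) ≤ bv (k + 1) s ∧ bv (k + 1) s ≤ 9 / 10))) →
      (∀ (m : ℤ) (t : ℝ), Tube m t ↔
        ((∀ k : ℤ, k ≤ m + 1 → |bv k t| ≤ 2 * (bhi + 3) ∧ |wv k t| ≤ 2 * (bhi + 3) ∧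
          M0 k t ≤ 20 * (bhi + 4) ^ 2 ∧ M1 k t ≤ 20 * (bhi + 4) ^ 2) ∧
        (∀ j : ℕ, 2 ≤ j → |bv (m + j) t| ≤ lad j ∧ |wv (m + j) t| ≤ lad j ∧
          M0 (m + j) t ≤ lad j ∧ M1 (m + j) t ≤ lad j))) →
      -- regime
      0 < ε₀ → ε₀ ≤ 1 / 20 → 0 < D → 1 / 2 ≤ θ → θ ≤ 1 → 0 ≤ η → 0 < εb → εb ≤ 1 / 10 ^ 6 →
      10 ^ 4 + 40 - 5 * Real.log εb ≤ blo → 10 ^ 9 * (bhi + 4) ^ 4 ≤ F →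
      η * (10 ^ 9 * (bhi + 4) ^ 4 * (F + 1)) ≤ 1 → εb * (10 ^ 9 * (F + 1) ^ 2 * (bhi + 4) ^ 3) ≤ 1 →
      10 ^ 3 + 20 * Real.log (bhi + 5) + Real.log (F + 2) ≤ -Real.log εb →
      -- the critical system with memory errors on [0, T]
      n₀ ≤ n → 0 ≤ t₀ → t₀ < T → blo ≤ B → B ≤ bhi →
      (∀ k : ℤ, k < n₀ → ∀ t ∈ Icc 0 T, bv k t = 0 ∧ wv k t = 0 ∧ M0 k t = 0 ∧ M1 k t = 0) →
      (∀ k : ℤ, ContinuousOn (bv k) (Icc 0 T) ∧ ContinuousOn (wv k) (Icc 0 T) ∧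
        ContinuousOn (M0 k) (Icc 0 T) ∧ ContinuousOn (M1 k) (Icc 0 T)) →
      (∀ k : ℤ, ContinuousOn (db k) (Icc 0 T) ∧ ContinuousOn (dw k) (Icc 0 T) ∧
        ∀ t ∈ Ioo 0 T, HasDerivAt (bv k) (db k t) t ∧
          |db k t - R k * (-(bv k t) + G0 k t)| ≤ η * R k * M0 k t ∧
          HasDerivAt (wv k) (dw k t) t ∧ |dw k t - R k * (-(wv k t) + G1 k t)| ≤ η * R k * M1 k t) →
      (∀ k : ℤ, ∀ t ∈ Icc 0 T, |bv k t| ≤ M0 k t ∧ |wv k t| ≤ M1 k t ∧ 0 ≤ M0 k t ∧ 0 ≤ M1 k t) →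
      (∀ k : ℤ, ∀ t₁ ∈ Icc 0 T, ∀ t₂ ∈ Icc t₁ T,
        M0 k t₂ ≤ M0 k t₁ * Real.exp (-(θ * R k * (t₂ - t₁))) +
          R k * ∫ u in t₁..t₂, Real.exp (-(θ * R k * (t₂ - u))) * |G0 k u| ∧
        M1 k t₂ ≤ M1 k t₁ * Real.exp (-(θ * R k * (t₂ - t₁))) +
          R k * ∫ u in t₁..t₂, Real.exp (-(θ * R k * (t₂ - u))) * |G1 k u|) →
      -- the a-priori far tail above the front, and the hand-off invariant at t₀
      (∃ J : ℕ, ∀ j : ℕ, J ≤ j → ∀ t ∈ Icc 0 T,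
        |bv (n + j) t| ≤ lad j ∧ |wv (n + j) t| ≤ lad j / 5 ∧ M0 (n + j) t ≤ lad j ∧ M1 (n + j) t ≤ lad j) →
      Inv n B t₀ →
      (∃ t₁ ∈ Ioo t₀ T, t₁ ≤ t₀ + 4 / R n ∧ ∃ B' : ℝ, Inv (n + 1) B' t₁ ∧
        q * (B + Real.log εb - 6 * Real.log (B + 2) - 58) ≤ B' ∧
        B' ≤ q * (B + Real.log (10 * (F + 2) * εb * B) + 25) ∧
        (∀ t ∈ Icc t₀ t₁, Tube n t ∧ bv n t ≤ B + 3) ∧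
        (∃ tc ∈ Ioo t₀ t₁, (∀ s ∈ Ico t₀ tc, bv (n + 1) s < 1) ∧ bv (n + 1) tc = 1 ∧
          ∃ δ : ℝ, 0 < δ ∧ tc + δ ≤ t₁ ∧ ∀ s ∈ Ioc tc (tc + δ), 1 < bv (n + 1) s)) ∨
      (T < t₀ + 4 / R n ∧ ∀ t ∈ Icc t₀ T, Tube n t ∧ bv n t ≤ B + 3)) →
      ∀ (A S₀ : ℝ) (Y₀ : Fin 2 → ℤ → ℝ → ℝ) (n : ℤ) (B t₀ : ℝ), Sol A S₀ Y₀ → 0 ≤ n → 0 ≤ t₀ → t₀ < S₀ →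
      blo ≤ B → B ≤ bhi → Invo A Y₀ n B t₀ →
      ∃ (S : ℝ) (Y : Fin 2 → ℤ → ℝ → ℝ), Sol A S Y ∧ t₀ < S ∧
        (∀ (i : Fin 2) (m : ℤ), ∀ t ∈ Ico 0 (min S S₀), Y i m t = Y₀ i m t) ∧
        (∃ t₁ ∈ Ioo t₀ S, t₁ ≤ t₀ + 4 / R n ∧ ∃ B' : ℝ, Invo A Y (n + 1) B' t₁ ∧
          q * (B + Real.log εb - 6 * Real.log (B + 2) - 58) ≤ B' ∧
          B' ≤ q * (B + Real.log (10 * (F + 2) * εb * B) + 25) ∧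
          (∀ t ∈ Icc t₀ t₁, Tubeo A Y n t ∧ bvo Y n t ≤ B + 3) ∧
          (∃ tc ∈ Ioo t₀ t₁, (∀ s ∈ Ico t₀ tc, bvo Y (n + 1) s < 1) ∧ bvo Y (n + 1) tc = 1 ∧
            ∃ δ : ℝ, 0 < δ ∧ tc + δ ≤ t₁ ∧ ∀ s ∈ Ioc tc (tc + δ), 1 < bvo Y (n + 1) s)) := by
  sorry

/-- **The chain-level threshold theorem** (formerly the single stub `threshold`), from the bridges and the core. [ … -/
theorem stub_threshold :
    ∀ ε₀ : ℝ, 0 < ε₀ → ε₀ ≤ 1 / 20 →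
      ∃ (m : ℕ) (𝒟 : CascadeWaveletData ε₀ m) (α : Fin m → Fin m → Fin m → ℤ × ℤ × ℤ → ℝ),
        IsSymmetricCoeff α ∧ IsCancellingCoeff α ∧
        ∃ (i₀ : Fin m) (n₀ : ℤ) (A S : ℝ), 0 < S ∧
          (∃ Y : Fin m → ℤ → ℝ → ℝ,
            (∀ i n, ContinuousOn (Y i n) (Ico 0 S)) ∧
            (∀ i n t, n < n₀ → Y i n t = 0) ∧
            (∀ S' : ℝ, S' < S → ∃ C : ℝ, ∀ (i : Fin m) (n : ℤ), ∀ t ∈ Icc 0 S',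
              (1 + ε₀) ^ ((20 : ℝ) * n) * |Y i n t| ≤ C) ∧
            (∀ (i : Fin m) (n : ℤ), ∀ t ∈ Ico 0 S,
              Y i n t = (if i = i₀ ∧ n = n₀ then A else 0) *
                  (pairing (heat t (cascadeWavelet ε₀ (𝒟.ψ i) n)) (cascadeWavelet ε₀ (𝒟.ψ i) n)).re +
                ∫ s in (0 : ℝ)..t,
                  (pairing (heat (t - s) (cascadeWavelet ε₀ (𝒟.ψ i) n)) (cascadeWavelet ε₀ (𝒟.ψ i) n)).re *
                    quadTerm ε₀ α Y i n s) ∧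
            (∃ M : ℝ, ∀ t ∈ Ico 0 S,
              (∑' p : Fin m × ℤ, ENNReal.ofReal ((1 + ε₀) ^ ((3 : ℝ) * p.2 / 2) *
                (Real.exp (-(4 * Real.pi ^ 2 * (1 + ε₀) ^ (2 * p.2) * t)) *
                    (if p.1 = i₀ ∧ p.2 = n₀ then |A| else 0) +
                  ∫ s in (0 : ℝ)..t, |quadTerm ε₀ α Y p.1 p.2 s| *
                    Real.exp (-(4 * Real.pi ^ 2 * (1 + ε₀) ^ (2 * p.2) * (t - s)))))) ≤
                ENNReal.ofReal (M / Real.sqrt (S - t)))) ∧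
          ¬ ∃ (S' : ℝ) (Y' : Fin m → ℤ → ℝ → ℝ), S < S' ∧
            (∀ i n, ContinuousOn (Y' i n) (Ico 0 S')) ∧
            (∀ i n t, n < n₀ → Y' i n t = 0) ∧
            (∀ S'' : ℝ, S'' < S' → ∃ C : ℝ, ∀ (i : Fin m) (n : ℤ), ∀ t ∈ Icc 0 S'',
              (1 + ε₀) ^ ((20 : ℝ) * n) * |Y' i n t| ≤ C) ∧
            (∀ (i : Fin m) (n : ℤ), ∀ t ∈ Ico 0 S',
              Y' i n t = (if i = i₀ ∧ n = n₀ then A else 0) *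
                  (pairing (heat t (cascadeWavelet ε₀ (𝒟.ψ i) n)) (cascadeWavelet ε₀ (𝒟.ψ i) n)).re +
                ∫ s in (0 : ℝ)..t,
                  (pairing (heat (t - s) (cascadeWavelet ε₀ (𝒟.ψ i) n)) (cascadeWavelet ε₀ (𝒟.ψ i) n)).re *
                    quadTerm ε₀ α Y' i n s) := by
  -- REGISTERED skeleton: `:= stub_thresholdCore stub_waveletSmallRadius stub_todaLegal stub_wellposed stub_extendOfApriori
  --   stub_ivtNesting stub_chainCritical stub_chainCriticalC1 stub_oneStep stub_tailOfWeight stub_typeIOfTube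
  --   stub_peakContinuity stub_invAtZero stub_peakAt stub_stepExists` (thresholdCore = the lead's composition, open);
  -- omitted in the published copy for size (crux workfiles are capped at 200 KB).
  sorry

/-- **The chain-level Type-I blow-up from stubs 7–8** (formerly the single stub `chain`): the maximal chain soluti … -/
theorem chain_of_parts :
    ∀ ε₀ : ℝ, 0 < ε₀ → ε₀ ≤ 1 / 20 →
      ∃ (m : ℕ) (𝒟 : CascadeWaveletData ε₀ m) (α : Fin m → Fin m → Fin m → ℤ × ℤ × ℤ → ℝ),
        IsSymmetricCoeff α ∧ IsCancellingCoeff α ∧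
        ∃ (i₀ : Fin m) (n₀ : ℤ) (A S : ℝ) (Y : Fin m → ℤ → ℝ → ℝ), 0 < S ∧
          (∀ i n, ContinuousOn (Y i n) (Ico 0 S)) ∧
          (∀ i n t, n < n₀ → Y i n t = 0) ∧
          (∀ S' : ℝ, S' < S → ∃ C : ℝ, ∀ (i : Fin m) (n : ℤ), ∀ t ∈ Icc 0 S',
            (1 + ε₀) ^ ((20 : ℝ) * n) * |Y i n t| ≤ C) ∧
          (∀ (i : Fin m) (n : ℤ), ∀ t ∈ Ico 0 S,
            Y i n t = (if i = i₀ ∧ n = n₀ then A else 0) *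
                (pairing (heat t (cascadeWavelet ε₀ (𝒟.ψ i) n)) (cascadeWavelet ε₀ (𝒟.ψ i) n)).re +
              ∫ s in (0 : ℝ)..t,
                (pairing (heat (t - s) (cascadeWavelet ε₀ (𝒟.ψ i) n)) (cascadeWavelet ε₀ (𝒟.ψ i) n)).re *
                  quadTerm ε₀ α Y i n s) ∧
          (∃ M : ℝ, ∀ t ∈ Ico 0 S,
            (∑' p : Fin m × ℤ, ENNReal.ofReal ((1 + ε₀) ^ ((3 : ℝ) * p.2 / 2) *
              (Real.exp (-(4 * Real.pi ^ 2 * (1 + ε₀) ^ (2 * p.2) * t)) *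
                  (if p.1 = i₀ ∧ p.2 = n₀ then |A| else 0) +
                ∫ s in (0 : ℝ)..t, |quadTerm ε₀ α Y p.1 p.2 s| *
                  Real.exp (-(4 * Real.pi ^ 2 * (1 + ε₀) ^ (2 * p.2) * (t - s)))))) ≤
              ENNReal.ofReal (M / Real.sqrt (S - t))) ∧
          (∀ C : ℝ, ∃ t ∈ Ico 0 S, ∃ (i : Fin m) (n : ℤ), C < (1 + ε₀) ^ ((10 : ℝ) * n) * |Y i n t|) := by
  intro ε₀ hε₀ hε₀half
  have hε₀1 : ε₀ ≤ 1 := hε₀half.trans (by norm_num)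
  obtain ⟨m, 𝒟, α, hsymm, hcanc, i₀, n₀, A, S, hS, ⟨Y, hcont, hlow, hdec, hchain, hM⟩, hmax⟩ :=
    stub_threshold ε₀ hε₀ hε₀half
  refine ⟨m, 𝒟, α, hsymm, hcanc, i₀, n₀, A, S, Y, hS, hcont, hlow, hdec, hchain, hM, ?_⟩
  by_contra hbd
  push Not at hbd
  obtain ⟨C, hC⟩ := hbd
  obtain ⟨S', Y', hSS', hcont', hlow', hdec', hchain', -⟩ :=
    stub_chainContinuation hε₀ hε₀1 𝒟 α i₀ n₀ A S Y hS hcont hlow hdec hchain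
      ⟨C, fun i n t ht => hC t ht i n⟩
  exact hmax ⟨S', Y', hSS', hcont', hlow', hdec', hchain'⟩

/-! ## Glue (proved) -/

/-- Scalar multiples of divergence-free Schwartz fields are divergence free. [folklore] -/
theorem isDivFree_smul (A : ℝ) {ψ : SchwartzMap ℝ³ ℝ³} (hψ : VectorCalculus.IsDivFree ⇑ψ) :
    VectorCalculus.IsDivFree ⇑(A • ψ) := by
  intro x
  have hd : DifferentiableAt ℝ (⇑ψ) x := (ψ.differentiable).differentiableAt
  have hcoe : (⇑(A • ψ) : ℝ³ → ℝ³) = A • (⇑ψ) := rfl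
  unfold VectorCalculus.divergence
  rw [hcoe, fderiv_const_smul hd A, ContinuousLinearMap.toLinearMap_smul, map_smul]
  have h0 := hψ x
  unfold VectorCalculus.divergence at h0
  rw [h0, smul_zero]

/-- `quadTerm` only reads the coefficient family at the evaluation time. [folklore] -/
theorem quadTerm_congr {ε₀ : ℝ} {m : ℕ} (α : Fin m → Fin m → Fin m → ℤ × ℤ × ℤ → ℝ)
    {X X' : Fin m → ℤ → ℝ → ℝ} {s : ℝ} (h : ∀ (j : Fin m) (k : ℤ), X j k s = X' j k s) (i : Fin m) (n : ℤ) :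
    quadTerm ε₀ α X i n s = quadTerm ε₀ α X' i n s := by
  unfold quadTerm
  simp only [h]

/-- **Composition of stubs 2–7**: the cascade-level Type-I blow-up at arbitrarily fine dyadic parameter (the hypot … -/
theorem cascadeTypeI_of_parts :
    ∀ ε₁ : ℝ, 0 < ε₁ → ∃ ε₀ : ℝ, 0 < ε₀ ∧ ε₀ ≤ ε₁ ∧
      ∃ C : L2C → L2C → L2C → ℂ, IsLocalCascadeForm ε₀ C ∧
        (∀ u v w, MemH10df u → MemH10df v → MemH10df w → C u v w = C v u w) ∧
        (∀ u, MemH10df u → C u u u = 0) ∧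
        ∃ u₀ : SchwartzMap ℝ³ ℝ³, VectorCalculus.IsDivFree ⇑u₀ ∧ ∃ S : ℝ, 0 < S ∧ ∃ u : ℝ → L2C,
          IsMildSolutionFor C (schwartzL2 u₀) (Ico 0 S) u ∧
          (∃ M : ℝ, ∀ t ∈ Ico 0 S, eLpNorm (u t) ⊤ volume ≤ ENNReal.ofReal (M / Real.sqrt (S - t))) ∧
          ¬ ∃ S' : ℝ, S < S' ∧ ∃ v : ℝ → L2C,
            IsMildSolutionFor C (schwartzL2 u₀) (Ico 0 S') v ∧ ∀ t ∈ Ico 0 S, v t = u t := by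
  intro ε₁ hε₁
  set ε₀ : ℝ := min ε₁ (1 / 20) with hε₀def
  have hε₀ : 0 < ε₀ := lt_min hε₁ (by norm_num)
  have hε₀half : ε₀ ≤ 1 / 20 := min_le_right _ _
  have hε₀1 : ε₀ ≤ 1 := hε₀half.trans (by norm_num)
  have hl : (0 : ℝ) < 1 + ε₀ := by positivity
  obtain ⟨m, 𝒟, α, hsymm, hcanc, i₀, n₀, A, S, Y, hS, hcont, hlow, hdec, hchain, ⟨M, hM⟩, hblow⟩ :=
    chain_of_parts ε₀ hε₀ hε₀half
  obtain ⟨u, hmem, hcts, hsum⟩ := stub_synthField hε₀ hε₀1 𝒟 α i₀ n₀ A S Y hS hcont hlow hdec hchain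
  obtain ⟨hmild, hcoeff⟩ :=
    stub_synthMild hε₀ hε₀1 𝒟 α i₀ n₀ A S Y hS hcont hlow hdec hchain u hmem hcts hsum
  obtain ⟨c, hc0, hc⟩ := stub_supBound hε₀ hε₀1 𝒟 α
  -- the datum as a Schwartz field
  set u₀ : SchwartzMap ℝ³ ℝ³ := A • schwartzWavelet hl (𝒟.ψ i₀) n₀ with hu₀def
  have hdat : schwartzL2 u₀ = (A : ℂ) • cascadeWavelet ε₀ (𝒟.ψ i₀) n₀ := by
    rw [hu₀def, schwartzL2_smul, schwartzL2_schwartzWavelet]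
  refine ⟨ε₀, hε₀, min_le_left _ _, cascadeOperatorForm ε₀ 𝒟.ψ α,
    isLocalCascadeForm_cascadeOperatorForm hε₀ hε₀1 𝒟 α,
    fun a b w _ _ _ => cascadeOperatorForm_symm ε₀ 𝒟.ψ hsymm a b w,
    fun a _ => cascadeOperatorForm_cancel ε₀ 𝒟.ψ hcanc a,
    u₀, isDivFree_smul A (isDivFree_schwartzWavelet hl (𝒟.isDivFree i₀) n₀), S, hS, u, ?_, ?_, ?_⟩
  · rw [hdat]
    exact hmild
  · -- the Type-I rate
    refine ⟨c * M, fun t ht => ?_⟩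
    have h1 := hc i₀ n₀ A S u hmild t ht
    have h2 : ∀ p : Fin m × ℤ,
        ENNReal.ofReal ((1 + ε₀) ^ ((3 : ℝ) * p.2 / 2) * ‖modeProjection 𝒟 p.1 p.2 (u t)‖) ≤
          ENNReal.ofReal ((1 + ε₀) ^ ((3 : ℝ) * p.2 / 2) *
            (Real.exp (-(4 * Real.pi ^ 2 * (1 + ε₀) ^ (2 * p.2) * t)) *
                (if p.1 = i₀ ∧ p.2 = n₀ then |A| else 0) +
              ∫ s in (0 : ℝ)..t, |quadTerm ε₀ α Y p.1 p.2 s| *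
                Real.exp (-(4 * Real.pi ^ 2 * (1 + ε₀) ^ (2 * p.2) * (t - s))))) := by
      intro p
      refine ENNReal.ofReal_le_ofReal (mul_le_mul_of_nonneg_left ?_ ?_)
      · have hb := stub_modeNormBound hε₀ hε₀1 𝒟 α i₀ n₀ A S u hmild p.1 p.2 t ht
        have hint : ∫ s in (0 : ℝ)..t, |quadTerm ε₀ α (modeCoeff 𝒟 u) p.1 p.2 s| *
              Real.exp (-(4 * Real.pi ^ 2 * (1 + ε₀) ^ (2 * p.2) * (t - s))) =
            ∫ s in (0 : ℝ)..t, |quadTerm ε₀ α Y p.1 p.2 s| *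
              Real.exp (-(4 * Real.pi ^ 2 * (1 + ε₀) ^ (2 * p.2) * (t - s))) := by
          refine intervalIntegral.integral_congr fun s hs => ?_
          rw [uIcc_of_le ht.1] at hs
          have hsI : s ∈ Ico 0 S := ⟨hs.1, hs.2.trans_lt ht.2⟩
          simp only [quadTerm_congr α (fun j k => hcoeff j k s hsI) p.1 p.2]
        rw [hint] at hb
        exact hb
      · exact Real.rpow_nonneg hl.le _
    calc eLpNorm (u t) ⊤ volume
        ≤ ENNReal.ofReal c * ∑' p : Fin m × ℤ,
            ENNReal.ofReal ((1 + ε₀) ^ ((3 : ℝ) * p.2 / 2) * ‖modeProjection 𝒟 p.1 p.2 (u t)‖) := h1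
      _ ≤ ENNReal.ofReal c * ENNReal.ofReal (M / Real.sqrt (S - t)) := by
          gcongr
          exact (ENNReal.tsum_le_tsum h2).trans (hM t ht)
      _ = ENNReal.ofReal (c * M / Real.sqrt (S - t)) := by
          rw [← ENNReal.ofReal_mul hc0, mul_div_assoc]
  · -- non-extension
    rw [hdat]
    refine stub_noext hε₀ 𝒟 (cascadeOperatorForm ε₀ 𝒟.ψ α) _ S u hmild fun K => ?_
    obtain ⟨t, ht, i, n, hlt⟩ := hblow K
    exact ⟨t, ht, i, n, by rwa [hcoeff i n t ht]⟩

/-- **The crux, by name, from the seven stubs.** Its axiom closure contains `sorryAx` exactly through the `stub_*` … -/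
theorem AveragedTypeIBlowup_of : Theses.PerpetualPump.AveragedTypeIBlowup := by
  unfold Theses.PerpetualPump.AveragedTypeIBlowup
  exact stub_transfer cascadeTypeI_of_parts

end Summit.NavierStokesRegularity.NavierStokesRegularity.Cruxes.AveragedTypeIBlowup.Sketch
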